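import Mathlib.Analysis.Calculus.ContDiff.Defs
import Mathlib.Analysis.Calculus.Deriv.Basic
import Mathlib.Analysis.SpecialFunctions.Trigonometric.Arctan
import Mathlib.Analysis.SpecialFunctions.Trigonometric.ArctanDeriv
import Mathlib.Analysis.Calculus.InverseFunctionTheorem.ApproximatesLinearOn
import Mathlib.Analysis.SpecialFunctions.Complex.Arg
import Mathlib.Analysis.Normed.Group.AddCircle
import Literature.MathematicalPhysics.QuantumLattice.SectorPartitionOfUnityCircle
import Literature.MathematicalPhysics.QuantumLattice.HubbardFermiRadius
import Mathlib.Analysis.Calculus.Deriv.MeanValue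
import Mathlib.Analysis.SpecialFunctions.Trigonometric.Angle
import Mathlib.Analysis.Normed.Group.Quotient
import Mathlib.Topology.Order.IntermediateValue
import Mathlib.Analysis.Calculus.ContDiff.Deriv
import Mathlib.Analysis.Calculus.Deriv.Shift
import Mathlib.Analysis.Calculus.Deriv.Prod
import Mathlib.Analysis.Calculus.MeanValue
import Mathlib.Analysis.SpecialFunctions.Trigonometric.Bounds
import Mathlib.Topology.Instances.Real.Lemmas
import Mathlib.Analysis.Normed.Group.Bounded
import HarnessLib

/-!
# Benfatto–Giuliani–Mastropietro 2003: symmetric Fermi surfaces, s-sectors, the sector lemmata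
(App. 7.1 Lemmas 7.1–7.4, §7.3 Lemma 7.5) and the sector counting Lemma 3.1

Topic `Literature/MathematicalPhysics/QuantumLattice/FermiRG` (fermionic multiscale / sector
renormalisation group). Statements-first typing (D-0069 (2) typer wave, seat t3, DAG file F3b) of

* G. Benfatto, A. Giuliani, V. Mastropietro, *Low temperature analysis of two-dimensional Fermi
  systems with symmetric Fermi surface*, Ann. Henri Poincaré 4 (2003) 137–193,
  arXiv:cond-mat/0207210 [BenfattoGiulianiMastropietro2003]; locators `p.N (Ln)` below are the
  N-th 3000-character chunk (line n) of the materialised arXiv TeX (`lit read arxiv:cond-mat/0207210`),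
  equation / lemma numbers are the printed ones.

## What is here

* **§1.2 hypotheses on the dispersion relation** (p.4 L97–119, items 1, 3, 4 = (2.8a), (2.8b),
  (2.8c)) as a `Prop`-valued predicate `BGM2003.DispersionHyp ε μ e₀ u` on the DATA
  `ε : ℝ² → ℝ` (dispersion), `μ` (chemical potential), `e₀ > 0` (width of the shell) and the polar
  radius `u(θ, e)` of the level curves `Σ(e) = {ε = μ + e} = {u(θ,e) e⃗_r(θ)}` (App. 7.1 (A1.1):
  `ℬ ≅ 𝕋¹ × [-e₀, e₀]`). Hypotheses are PREDICATES, never asserted (the Hubbard band dispersion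
  satisfies them for `-4 < μ < 0` by the tree's `HubbardFermiBandCurvature` / `HubbardFermiRadiusBand*`;
  that instantiation is fs-1's theorem, not this file's).
* the geometric objects of App. 7.1: `s'(θ,e)` (A1.6), unit tangent `τ⃗`, outgoing unit normal `n⃗`,
  curvature `1/r(θ,e)` (A1.7), the normal angle `α(θ,e)` of Lemma 7.1, the Fermi point
  `p⃗_F(θ) = u(θ) e⃗_r(θ)`;
* the **s-sectors** `S_{h,ω}` of (3.44a) (p.13 L102–106), `h = -n ≤ 0`, `γ = 4`, written through the
  polar chart of `ℬ` and with the tree's angular partition `ζ_{h,ω} = sectorWeightCirc n ω`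
  (`SectorPartitionOfUnityCircle`: exactly BGM's `H₂((θ - θ_{h,ω})γ^{-h/2}/π)` of (3.11)/(3.14a) for
  one fixed admissible smooth `H₂`; centres `θ_{h,ω} = sectorCenter n ω = π(ω + ½)γ^{h/2}`,
  `|O_h| = sectorCount n = γ^{-(h-1)/2} = 2^{n+1}`);
* **named facts** (D-0014; unproved here, cite tags on each): Lemma 7.1 [lmA1.1] (A1.9),
  Lemma 7.2 [lms1.1] (A1.10a), Lemma 7.3 [lmA1.3] (A1.13)–(A1.14) (the sector lemma: a momentum of
  `S_{h,ω}` is `O(γ^h)` off `p⃗_F(θ_{h,ω})` normally and `O(γ^{h/2})` tangentially), Lemma 7.4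
  [lmA1.2], the parallelogram Lemma 7.5 [lms1.5] (s1.16)–(s1.18), and the **sector counting
  Lemma 3.1** [lm4.1] (4.3) in the form (4.3app) of its proof §7.4 (p.27 L158 – p.28 L13): the set
  `A_{h,h'}(ω₁; ω̃₂,…,ω̃_L)` of sector strings compatible with MOMENTUM CONSERVATION IN `ℝ²`,
  `Σ_{i=1}^L k⃗^{(i)} = 0`, has at most `c^L γ^{(h-h')(L-3)/2}` elements (`L ≥ 4`), `≤ c` for `L = 2`.

## Relation to the tree (cite, not restate)

* The tree PROVES the four-legged count for the HUBBARD band dispersion with conservation modulo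
  `2πℤ²` on compacts of `μ ∈ (-4,0)`: `BandSectorCounting.count_pairs_exists`
  (`HubbardBandSectorCountingCounts`) with the toolbox `HubbardBandSectorCountingBounds/Toolbox`.
  Lemma 3.1 here is the printed GENERAL-dispersion, arbitrary-`L`, conservation-in-`ℝ²` statement
  (BGM 2003 treat lattice momenta as continuum variables after (3.8a), p.6 L148 – p.7 L2); it stays a
  named fact (FACT-unless-TREE row F-016: the referee rules which residual the tree covers).
* Lemma 7.3's box for the Hubbard dispersion is PROVED in the tree
  (`IsotropicSectors.abs_normalCoord_le_of_gen_ne_zero`, `abs_tangentCoord_le_of_gen_ne_zero`,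
  `SectorPropagatorDecay`, `TorusSectorPropagatorDecay`); the general-`ε` statement here is the fact.
* `dir θ = e⃗_r(θ)` (`HubbardFermiRadius`), `sectorWeightCirc`, `sectorCenter`, `sectorCount`,
  `sectorWidth` are REUSED; nothing is re-declared.

## Typing conventions / deviations, stated once

* `h ≤ 0` is `h = -n`, `n : ℕ`; `γ = 4` as fixed by the paper (p.6 L90–92): `γ^h = 4^{-n}`,
  `γ^{h/2} = 2^{-n}`.
* Distances "on `𝕋¹`" (`‖θ₁ - θ₂‖` in the paper) are `torusDist (θ₁ - θ₂) = ‖(θ₁ - θ₂ : AddCircle (2π))‖`.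
* The sets `ℬ`, `Σ(e)`, `S_{h,ω}` are written as IMAGES of the polar chart `(θ,e) ↦ u(θ,e)e⃗_r(θ)`
  (App. 7.1 (A1.1)); under `DispersionHyp` this is the paper's `{p⃗ : |ε(p⃗) - μ| ≤ γ^h e₀, ζ_{h,ω}(θ) ≠ 0}`
  read inside `ℬ` (for a lattice dispersion, `2πℤ²`-periodic on `ℝ²`, the literal level set in `ℝ²`
  is the `2πℤ²`-orbit of `Σ(e)`; the paper's `Σ(e)` is the curve in the Brillouin zone).
* Unspecified positive constants `c, c₁, c₂, …` of the paper are existentially quantified AFTER the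
  hypotheses (they depend on `ε, μ, e₀`), uniformly in the scale/sector indices, as printed.
* Lemma 7.4: `(x, θ_⊥)` is "the" solution of (A1.11) `p⃗ = p⃗_F(θ_⊥) + x n⃗(θ_⊥)` — unique for `e₀`
  small (p.27 L1–5, a standing smallness assumption of the paper); typed as: every solution with
  `|x| ≤ δ` obeys the bounds, `δ > 0` existential.

Nothing here asserts anything about the Hubbard model, H1, K1 or K3.
-/

noncomputable section

open Real Set


namespace Literature.MathematicalPhysics.QuantumLattice.FermiRG

/-- Distance on the one-dimensional torus `𝕋¹ = ℝ/2πℤ`: `‖θ‖_{𝕋¹} = min_{k ∈ ℤ} |θ - 2πk|`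
(the paper's `‖θ₁ - θ₂‖`, Lemma 7.1). [cite: BenfattoGiulianiMastropietro2003, §7.1 Lemma 7.1 p.26 (L57)] -/
def torusDist (θ : ℝ) : ℝ := ‖((θ : ℝ) : AddCircle (2 * π))‖

/-- The tangential unit vector `e⃗_t(θ) = (-sin θ, cos θ)` (`e⃗_r(θ) = dir θ = (cos θ, sin θ)` is the
tree's `dir`). [cite: BenfattoGiulianiMastropietro2003, §2.3 p.8 (L25) and (A1.6)] -/
def tdir (θ : ℝ) : Fin 2 → ℝ := ![-Real.sin θ, Real.cos θ]

namespace BGM2003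

/-! ### App. 7.1: the polar chart of `ℬ` and its frame -/

/-- The point `q⃗(θ,e) = u(θ,e) e⃗_r(θ)` of the level curve `Σ(e)` (A1.1); `e = 0` gives the Fermi
point `p⃗_F(θ) = u(θ) e⃗_r(θ)`. [cite: BenfattoGiulianiMastropietro2003, §7.1 (A1.1) p.26 (L21)] -/
def levelPoint (u : ℝ → ℝ → ℝ) (θ e : ℝ) : Fin 2 → ℝ := u θ e • dir θ

/-- The Fermi point `p⃗_F(θ) = u(θ,0) e⃗_r(θ)` of `Σ_F = Σ(0)`. [cite: BenfattoGiulianiMastropietro2003, §1.2 p.4 (L121–123)] -/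
def fermiPoint (u : ℝ → ℝ → ℝ) (θ : ℝ) : Fin 2 → ℝ := levelPoint u θ 0

/-- The shell `ℬ = {p⃗ : |ε(p⃗) - μ| ≤ e₀} ≅ 𝕋¹ × [-e₀, e₀]` as the image of the polar chart (A1.1). [cite: BenfattoGiulianiMastropietro2003, §7.1 (A1.1) p.26 (L16–22)] -/
def shell (u : ℝ → ℝ → ℝ) (e₀ : ℝ) : Set (Fin 2 → ℝ) :=
  {p | ∃ θ e : ℝ, |e| ≤ e₀ ∧ p = levelPoint u θ e}

/-- `u'(θ,e) = ∂u/∂θ`. [cite: BenfattoGiulianiMastropietro2003, §7.1 (A1.6) p.26 (L39–41)] -/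
def radiusDeriv (u : ℝ → ℝ → ℝ) (θ e : ℝ) : ℝ := deriv (fun ϑ => u ϑ e) θ

/-- `u''(θ,e) = ∂²u/∂θ²`. [cite: BenfattoGiulianiMastropietro2003, §7.1 (A1.7) p.26 (L51)] -/
def radiusDeriv₂ (u : ℝ → ℝ → ℝ) (θ e : ℝ) : ℝ := deriv (fun ϑ => radiusDeriv u ϑ e) θ

/-- The speed of the polar parametrisation, `s'(θ,e) = √(u'(θ,e)² + u(θ,e)²)` (A1.6). [cite: BenfattoGiulianiMastropietro2003, §7.1 (A1.6) p.26 (L41)] -/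
def speed (u : ℝ → ℝ → ℝ) (θ e : ℝ) : ℝ := Real.sqrt (radiusDeriv u θ e ^ 2 + u θ e ^ 2)

/-- The unit tangent vector `τ⃗(θ,e) = (u' e⃗_r + u e⃗_t)/s'` of `Σ(e)` at `q⃗(θ,e)` (A1.6)
(at `e = 0` this is `τ⃗(θ)` of (3.21)). [cite: BenfattoGiulianiMastropietro2003, §7.1 (A1.6) p.26 (L35–41)] -/
def unitTangent (u : ℝ → ℝ → ℝ) (θ e : ℝ) : Fin 2 → ℝ :=
  (speed u θ e)⁻¹ • (radiusDeriv u θ e • dir θ + u θ e • tdir θ)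

/-- The outgoing unit normal vector `n⃗(θ,e) = (u e⃗_r - u' e⃗_t)/s'` of `Σ(e)` at `q⃗(θ,e)` (A1.7)
(at `e = 0` this is `n⃗(θ)` of (3.21)). [cite: BenfattoGiulianiMastropietro2003, §7.1 (A1.7) p.26 (L45–50)] -/
def unitNormal (u : ℝ → ℝ → ℝ) (θ e : ℝ) : Fin 2 → ℝ :=
  (speed u θ e)⁻¹ • (u θ e • dir θ - radiusDeriv u θ e • tdir θ)

/-- The curvature `1/r(θ,e)` of the polar curve `Σ(e)`:
`(u² + 2u'² - u u'')/(u'² + u²)^{3/2}`, i.e. the coefficient in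
`∂²q⃗/∂θ² = s'' τ⃗ - (s'²/r) n⃗` (A1.7). [cite: BenfattoGiulianiMastropietro2003, §7.1 (A1.7) p.26 (L45–52)] -/
def curvature (u : ℝ → ℝ → ℝ) (θ e : ℝ) : ℝ :=
  (u θ e ^ 2 + 2 * radiusDeriv u θ e ^ 2 - u θ e * radiusDeriv₂ u θ e) / speed u θ e ^ 3

/-- The normal angle `α(θ,e)`: the angle between `n⃗(θ,e)` and `e⃗_r(0) = (1,0)`, as the continuous
lift `θ - arctan(u'/u)` (so `n⃗ = (cos α, sin α)` since `u > 0`). [cite: BenfattoGiulianiMastropietro2003, §7.1 Lemma 7.1 p.26 (L54–58)] -/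
def normalAngle (u : ℝ → ℝ → ℝ) (θ e : ℝ) : ℝ := θ - Real.arctan (radiusDeriv u θ e / u θ e)

/-! ### §1.2: the hypotheses on the dispersion relation (predicate, never asserted) -/

/-- **BGM 2003 §1.2, hypotheses on the dispersion relation** `ε(k⃗)` at chemical potential `μ`
(p.4 L97–119), on the data `(ε, μ, e₀, u)`:
* item 1: for `|e| ≤ e₀`, `ε(k⃗) - μ = e` is a regular `C^∞` convex closed curve `Σ(e)` encircling
  the origin, `Σ(e) = {u(θ,e) e⃗_r(θ)}` in polar coordinates with `u` smooth, `2π`-periodic in `θ`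
  and `u(θ,e) ≥ c > 0`; convexity (2.8a): `r(θ,e)⁻¹ ≥ c > 0`;
* item 3, (2.8b): `0 < c₁ ≤ ∇ε(p⃗)·e⃗_r(θ) ≤ c₂` for `p⃗ = u(θ,e)e⃗_r(θ) ∈ ℬ`;
* item 4, (2.8c): `ε(k⃗) = ε(-k⃗)`, together with its consequence (A1.4) `q⃗(θ+π,e) = -q⃗(θ,e)`,
  i.e. `u(θ+π,e) = u(θ,e)` (p.26 L24–28: «the symmetry property (2.8c) implies (A1.4)» — the
  implication uses item 1 in full, «`ε(k⃗) - μ = e` DEFINES `Σ(e)`», whereas this predicate only sees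
  `ε` on the shell `ℬ`; App. 7's proofs of Lemmas 7.1, 7.5 and 3.1 use exactly (A1.4), so it is an
  explicit field — without it the curve `Σ(e)` need not be centrally symmetric even for symmetric `ε`).
`ε` is taken `C^∞` on `ℝ²` (true for the lattice and jellium examples of the paper, Remark p.4
L125–135); item 2 (`C̄₀⁻¹ = 1` on `Σ(e)`) is automatic for lattice models and belongs to the
continuum model's ultraviolet cutoff, not to the geometry. A PREDICATE: nothing is asserted. [cite: BenfattoGiulianiMastropietro2003, §1.2 (2.8a)–(2.8c) p.4 (L91–123)] -/
structure DispersionHyp (ε : (Fin 2 → ℝ) → ℝ) (μ e₀ : ℝ) (u : ℝ → ℝ → ℝ) : Prop where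
  e₀_pos : 0 < e₀
  smooth_ε : ContDiff ℝ ((⊤ : ℕ∞) : WithTop ℕ∞) ε
  smooth_u : ∃ e₁ : ℝ, e₀ < e₁ ∧ ContDiffOn ℝ ((⊤ : ℕ∞) : WithTop ℕ∞) (Function.uncurry u) (Set.univ ×ˢ Set.Ioo (-e₁) e₁)
  periodic_u : ∀ e : ℝ, Function.Periodic (fun θ => u θ e) (2 * π)
  u_pos : ∃ c : ℝ, 0 < c ∧ ∀ θ e : ℝ, |e| ≤ e₀ → c ≤ u θ e
  level : ∀ θ e : ℝ, |e| ≤ e₀ → ε (levelPoint u θ e) = μ + e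
  convex : ∃ c : ℝ, 0 < c ∧ ∀ θ e : ℝ, |e| ≤ e₀ → c ≤ curvature u θ e
  radial : ∃ c₁ c₂ : ℝ, 0 < c₁ ∧ c₁ ≤ c₂ ∧ ∀ θ e : ℝ, |e| ≤ e₀ →
    c₁ ≤ fderiv ℝ ε (levelPoint u θ e) (dir θ) ∧ fderiv ℝ ε (levelPoint u θ e) (dir θ) ≤ c₂
  symm : ∀ p : Fin 2 → ℝ, ε (-p) = ε p
  antipodal : ∀ θ e : ℝ, |e| ≤ e₀ → u (θ + π) e = u θ e

/-! ### (3.44a): s-sectors -/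

/-- **The s-sector `S_{h,ω}`** of scale `h = -n ≤ 0` and sector index `ω` (3.44a):
`{p⃗ = ρe⃗_r(θ) : |ε(p⃗) - μ| ≤ γ^h e₀, ζ_{h,ω}(θ) ≠ 0}` (`γ = 4`), written through the polar chart
of `ℬ` (`p⃗ = u(θ,e)e⃗_r(θ)`, `ε(p⃗) - μ = e`) and with the tree's `ζ_{h,ω} = sectorWeightCirc n ω`
(`N`-periodic in `ω`, `N = sectorCount n = |O_h|`). Note `S_{h+1,ω} ⊇ S_{h,2ω} ∪ S_{h,2ω+1}`
(p.13 L108–112). [cite: BenfattoGiulianiMastropietro2003, §2.6 (3.44a) p.13 (L101–106)] -/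
def sSector (u : ℝ → ℝ → ℝ) (e₀ : ℝ) (n : ℕ) (ω : ℤ) : Set (Fin 2 → ℝ) :=
  {p | ∃ θ e : ℝ, |e| ≤ (4 : ℝ) ^ (-(n : ℤ)) * e₀ ∧ sectorWeightCirc n ω θ ≠ 0 ∧ p = levelPoint u θ e}

/-! ### App. 7.1: Lemmas 7.1–7.4 (named facts) -/

/-- **BGM 2003 Lemma 7.1 [lmA1.1]** (A1.9). Under the §1.2 hypotheses: the angle `α(θ,e)` between
`n⃗(θ,e)` and `e⃗_r(0)` is a monotone increasing function of `θ` with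
`c₁‖θ₂ - θ₁‖ ≤ ‖α(θ₂,e) - α(θ₁,e)‖ ≤ c₂‖θ₂ - θ₁‖` (distances on `𝕋¹`), and `α(θ+π,e) - α(θ,e) = π`.
Unproved here (named fact). [cite: BenfattoGiulianiMastropietro2003, §7.1 Lemma 7.1 (A1.9) p.26 (L54–63)] -/
def lemma71_normalAngle : Prop :=
  ∀ (ε : (Fin 2 → ℝ) → ℝ) (μ e₀ : ℝ) (u : ℝ → ℝ → ℝ), DispersionHyp ε μ e₀ u →
    ∃ c₁ c₂ : ℝ, 0 < c₁ ∧ c₁ ≤ c₂ ∧ ∀ e : ℝ, |e| ≤ e₀ →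
      Monotone (fun θ => normalAngle u θ e) ∧
      (∀ θ₁ θ₂ : ℝ,
        c₁ * torusDist (θ₂ - θ₁) ≤ torusDist (normalAngle u θ₂ e - normalAngle u θ₁ e) ∧
        torusDist (normalAngle u θ₂ e - normalAngle u θ₁ e) ≤ c₂ * torusDist (θ₂ - θ₁)) ∧
      ∀ θ : ℝ, normalAngle u (θ + π) e - normalAngle u θ e = π

/-- **BGM 2003 Lemma 7.2 [lms1.1]** (A1.10a). Under the §1.2 hypotheses there is `c` such that: if
`p⃗ = ρ e⃗_r(θ) ∈ S_{h,ω}`, `h ≤ 0`, `ω ∈ O_h`, then `|ρ - u(θ)| ≤ cγ^h` and `‖θ - θ_{h,ω}‖ ≤ πγ^{h/2}`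
(`γ = 4`, `h = -n`, distance on `𝕋¹`). Unproved here (named fact). [cite: BenfattoGiulianiMastropietro2003, §7.1 Lemma 7.2 (A1.10a) p.26 (L89–94)] -/
def lemma72_sectorPolar : Prop :=
  ∀ (ε : (Fin 2 → ℝ) → ℝ) (μ e₀ : ℝ) (u : ℝ → ℝ → ℝ), DispersionHyp ε μ e₀ u →
    ∃ c : ℝ, 0 < c ∧ ∀ (n ω : ℕ), ω < sectorCount n →
      ∀ p ∈ sSector u e₀ n ω, ∀ ρ θ : ℝ, 0 < ρ → p = ρ • dir θ →
        |ρ - u θ 0| ≤ c * (4 : ℝ) ^ (-(n : ℤ)) ∧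
        torusDist (θ - sectorCenter n ω) ≤ π * (2 : ℝ) ^ (-(n : ℤ))

/-- **BGM 2003 Lemma 7.3 [lmA1.3] — the sector lemma** (A1.13)–(A1.14). Under the §1.2 hypotheses
there is `c` such that: if `p⃗ ∈ S_{h,ω}`, `h ≤ 0`, `ω ∈ O_h`, then
`p⃗ = p⃗_F(θ_{h,ω}) + k₁ n⃗(θ_{h,ω}) + k₂ τ⃗(θ_{h,ω})` with `|k₁| ≤ cγ^h`, `|k₂| ≤ cγ^{h/2}` (A1.13), and
`|∂ε/∂k₂ (p⃗_F(θ_{h,ω}) + k₁n⃗ + k₂τ⃗)| ≤ cγ^{h/2}` (A1.14) — the derivative of `ε` at `p⃗` along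
`τ⃗(θ_{h,ω})`. (`γ = 4`, `h = -n`.) Unproved here for a general dispersion (named fact); for the
Hubbard band it is the tree's `IsotropicSectors.abs_normalCoord_le_of_gen_ne_zero` /
`abs_tangentCoord_le_of_gen_ne_zero`. [cite: BenfattoGiulianiMastropietro2003, §7.1 Lemma 7.3 (A1.13)–(A1.14) p.26 (L114–123)] -/
def lemma73_sectorBox : Prop :=
  ∀ (ε : (Fin 2 → ℝ) → ℝ) (μ e₀ : ℝ) (u : ℝ → ℝ → ℝ), DispersionHyp ε μ e₀ u →
    ∃ c : ℝ, 0 < c ∧ ∀ (n ω : ℕ), ω < sectorCount n → ∀ p ∈ sSector u e₀ n ω,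
      ∃ k₁ k₂ : ℝ,
        p = fermiPoint u (sectorCenter n ω) + k₁ • unitNormal u (sectorCenter n ω) 0 +
              k₂ • unitTangent u (sectorCenter n ω) 0 ∧
        |k₁| ≤ c * (4 : ℝ) ^ (-(n : ℤ)) ∧ |k₂| ≤ c * (2 : ℝ) ^ (-(n : ℤ)) ∧
        |fderiv ℝ ε p (unitTangent u (sectorCenter n ω) 0)| ≤ c * (2 : ℝ) ^ (-(n : ℤ))

/-- **BGM 2003 Lemma 7.4 [lmA1.2]**. Under the §1.2 hypotheses there are `c, δ > 0` such that: if
`p⃗ ∈ S_{h,ω}`, `h ≤ 0`, and `(x, θ_⊥)` solve (A1.11) `p⃗ = p⃗_F(θ_⊥) + x n⃗(θ_⊥)` (the projection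
`p⃗_⊥ = p⃗_F(θ_⊥)` on the Fermi surface; the solution is unique for `e₀` small, p.27 L1–5 — typed
as: any solution with `|x| ≤ δ`), then `|x| ≤ cγ^h` and `‖θ_⊥ - θ_{h,ω}‖ ≤ cγ^{h/2}`.
Unproved here (named fact). [cite: BenfattoGiulianiMastropietro2003, §7.1 Lemma 7.4 and (A1.11) p.26 (L165) – p.27 (L10)] -/
def lemma74_projection : Prop :=
  ∀ (ε : (Fin 2 → ℝ) → ℝ) (μ e₀ : ℝ) (u : ℝ → ℝ → ℝ), DispersionHyp ε μ e₀ u →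
    ∃ c δ : ℝ, 0 < c ∧ 0 < δ ∧ ∀ (n ω : ℕ), ω < sectorCount n → ∀ p ∈ sSector u e₀ n ω,
      ∀ x θ' : ℝ, |x| ≤ δ → p = fermiPoint u θ' + x • unitNormal u θ' 0 →
        |x| ≤ c * (4 : ℝ) ^ (-(n : ℤ)) ∧ torusDist (θ' - sectorCenter n ω) ≤ c * (2 : ℝ) ^ (-(n : ℤ))

/-! ### §7.3: the parallelogram lemma -/

/-- The set `𝒯 = {(θ₁, θ₂) ∈ 𝕋² : sin(θ₁ - θ₂) ≠ 0}` (A1.20) on which `F(θ₁,θ₂) = p⃗_F(θ₁) + p⃗_F(θ₂)`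
is locally invertible. [cite: BenfattoGiulianiMastropietro2003, §7.3 (A1.19)–(A1.20) p.27 (L68–80)] -/
def pairChartDomain : Set (ℝ × ℝ) := {θ | Real.sin (θ.1 - θ.2) ≠ 0}

/-- The open set `𝒟 = {ρe⃗_r(θ) : 0 < ρ < 2u(θ), θ ∈ 𝕋¹}` (A1.21), the range of
`(θ₁,θ₂) ↦ p⃗_F(θ₁) + p⃗_F(θ₂)` on each half of `𝒯`. [cite: BenfattoGiulianiMastropietro2003, §7.3 (A1.21) p.27 (L82–89)] -/
def pairRange (u : ℝ → ℝ → ℝ) : Set (Fin 2 → ℝ) :=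
  {p | ∃ ρ θ : ℝ, 0 < ρ ∧ ρ < 2 * u θ 0 ∧ p = ρ • dir θ}

/-- `φ(θ₁, θ₂) = min{‖θ₁ - θ₂‖, π - ‖θ₁ - θ₂‖}` (s1.16)/(s1.21): the distance of the pair from the
degenerate configurations `θ₁ = θ₂` and `θ₁ = θ₂ + π`. [cite: BenfattoGiulianiMastropietro2003, §7.3 (s1.16) p.27 (L97) and §7.4 (s1.21) p.28 (L19)] -/
def pairAngle (θ₁ θ₂ : ℝ) : ℝ := min (torusDist (θ₁ - θ₂)) (π - torusDist (θ₁ - θ₂))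

/-- **BGM 2003 Lemma 7.5 [lms1.5] — the parallelogram lemma** (s1.16)–(s1.18). Under the §1.2
hypotheses, for every `c₁ > 0` there are `c₀, c̄₂, η₀ > 0` such that: if `(θ̄₁, θ̄₂) ∈ 𝒯`,
`b⃗ = p⃗_F(θ̄₁) + p⃗_F(θ̄₂)`, `φ = min{‖θ̄₁ - θ̄₂‖, π - ‖θ̄₁ - θ̄₂‖} > 0`,
`r⃗ = r₁n⃗(θ̄₁) + r₂τ⃗(θ̄₁)` with `|r₁| ≤ c₁ηφ`, `|r₂| ≤ η ≤ c₂φ`, and `c₂ ≤ c̄₂`, `η ≤ η₀`, then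
`b⃗ + r⃗ ∈ 𝒟` and `b⃗ + r⃗ = p⃗_F(θ₁) + p⃗_F(θ₂)` with `|θᵢ - θ̄ᵢ| ≤ c₀η` (`c₀` independent of `c₂`).
Unproved here (named fact). [cite: BenfattoGiulianiMastropietro2003, §7.3 Lemma 7.5 (s1.16)–(s1.18) p.27 (L93–108)] -/
def lemma75_parallelogram : Prop :=
  ∀ (ε : (Fin 2 → ℝ) → ℝ) (μ e₀ : ℝ) (u : ℝ → ℝ → ℝ), DispersionHyp ε μ e₀ u →
    ∀ c₁ : ℝ, 0 < c₁ → ∃ c₀ c₂ η₀ : ℝ, 0 < c₀ ∧ 0 < c₂ ∧ 0 < η₀ ∧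
      ∀ θ₁' θ₂' η r₁ r₂ : ℝ, (θ₁', θ₂') ∈ pairChartDomain →
        |r₁| ≤ c₁ * η * pairAngle θ₁' θ₂' → |r₂| ≤ η → η ≤ c₂ * pairAngle θ₁' θ₂' → η ≤ η₀ →
          fermiPoint u θ₁' + fermiPoint u θ₂' + (r₁ • unitNormal u θ₁' 0 + r₂ • unitTangent u θ₁' 0)
              ∈ pairRange u ∧
          ∃ θ₁ θ₂ : ℝ,
            fermiPoint u θ₁' + fermiPoint u θ₂' + (r₁ • unitNormal u θ₁' 0 + r₂ • unitTangent u θ₁' 0) =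
              fermiPoint u θ₁ + fermiPoint u θ₂ ∧
            |θ₁ - θ₁'| ≤ c₀ * η ∧ |θ₂ - θ₂'| ≤ c₀ * η

/-! ### §3.1 / §7.4: the sector counting lemma -/

/-- **The set `A_{h,h'}(ω₁; ω̃₂, …, ω̃_L)` of §7.4** (p.27 L158 – p.28 L4), `h' = -n' ≤ h = -n ≤ 0`:
strings `(ω₁, ω₂, …, ω_L)` of scale-`h'` sector indices (`ωᵢ ∈ O_{h'}`, i.e. `ωᵢ < 2^{n'+1}`; the first
entry FIXED equal to `ω₁`, the others free — the paper lists `(ω₂,…,ω_L)`) such that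
(i) `S_{h',ωᵢ} ⊂ S_{h,ω̃ᵢ}` for `i = 2,…,L` and (ii) there are `k⃗^{(i)} ∈ S_{h',ωᵢ}`, `i = 1,…,L`, with
MOMENTUM CONSERVATION IN `ℝ²`: `Σ_{i=1}^L k⃗^{(i)} = 0`. Indices `i = 1,…,L` are `Fin L` with `f₁ ↦ i₁`. [cite: BenfattoGiulianiMastropietro2003, §7.4 p.27 (L158) – p.28 (L4)] -/
def sectorStrings (u : ℝ → ℝ → ℝ) (e₀ : ℝ) (n n' L : ℕ) (i₁ : Fin L) (ω₁ : ℕ) (ωt : Fin L → ℕ) :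
    Set (Fin L → Fin (sectorCount n')) :=
  {ω | (ω i₁ : ℕ) = ω₁ ∧ (∀ i : Fin L, i ≠ i₁ → sSector u e₀ n' (ω i : ℕ) ⊆ sSector u e₀ n (ωt i)) ∧
    ∃ k : Fin L → (Fin 2 → ℝ), (∀ i : Fin L, k i ∈ sSector u e₀ n' (ω i : ℕ)) ∧ ∑ i, k i = 0}

/-- **BGM 2003 Lemma 3.1 [lm4.1] — the sector counting lemma** (4.3), in the form (4.3app) of its
proof (§7.4): under the §1.2 hypotheses there is `c` such that for all `h' ≤ h ≤ 0` (`h = -n`,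
`h' = -n'`, `γ = 4`), every `ω₁ ∈ O_{h'}` and `ω̃₂,…,ω̃_L ∈ O_h`:
`|A_{h,h'}(ω₁; ω̃₂,…,ω̃_L)| ≤ c^L γ^{(h-h')(L-3)/2} = c^L 2^{(n'-n)(L-3)}` if `L ≥ 4`, and `≤ c` if
`L = 2` (momentum conservation and (2.8c) give exactly one string, p.28 L6–8). In (4.3) this is the
sum of `χ_v` (3.44) over the scale-`h'` refinements `𝒮_{h'}(σ') ≺ 𝒮_h(σ)` of the sectors of the
`L = |P_v|` external lines of a vertex `v`, one line `f₁` held fixed; the general even `L` is the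
6-, 8-, …-legged count. An extension to general convex symmetric Fermi curves of the jellium lemma of
[FMRT]. Unproved here (named fact). For the HUBBARD band with conservation modulo `2πℤ²` and `L = 4`
the tree PROVES `BandSectorCounting.count_pairs_exists` (`HubbardBandSectorCountingCounts`). [cite: BenfattoGiulianiMastropietro2003, §3.1 Lemma 3.1 (4.3) p.17 (L46–58) and §7.4 (4.3app) p.28 (L6–13)] -/
def lemma31_sectorCounting : Prop :=
  ∀ (ε : (Fin 2 → ℝ) → ℝ) (μ e₀ : ℝ) (u : ℝ → ℝ → ℝ), DispersionHyp ε μ e₀ u →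
    ∃ c : ℝ, 0 < c ∧ ∀ (n n' : ℕ), n ≤ n' →
      (∀ (L : ℕ) (i₁ : Fin L) (ω₁ : ℕ) (ωt : Fin L → ℕ), 4 ≤ L → ω₁ < sectorCount n' →
          (∀ i, ωt i < sectorCount n) →
          (Nat.card (sectorStrings u e₀ n n' L i₁ ω₁ ωt) : ℝ) ≤ c ^ L * (2 : ℝ) ^ ((n' - n) * (L - 3))) ∧
      (∀ (i₁ : Fin 2) (ω₁ : ℕ) (ωt : Fin 2 → ℕ), ω₁ < sectorCount n' → (∀ i, ωt i < sectorCount n) →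
          (Nat.card (sectorStrings u e₀ n n' 2 i₁ ω₁ ωt) : ℝ) ≤ c)

end BGM2003

end Literature.MathematicalPhysics.QuantumLattice.FermiRG


/-! ### Lemma 7.2 discharged (proof of `lemma72_sectorPolar`) -/

namespace Literature.MathematicalPhysics.QuantumLattice.FermiRG

namespace BGM2003

open Real Set

/-- Components of a point on the ray `ρ e⃗_r(θ)`. [folklore] -/
private theorem smul_dir_apply_zero (ρ θ : ℝ) : (ρ • dir θ) 0 = ρ * Real.cos θ := by
  simp [dir]

/-- Components of a point on the ray `ρ e⃗_r(θ)`. [folklore] -/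
private theorem smul_dir_apply_one (ρ θ : ℝ) : (ρ • dir θ) 1 = ρ * Real.sin θ := by
  simp [dir]

/-- Polar coordinates are unique for positive radii: `ρ e⃗_r(θ) = ρ' e⃗_r(θ')` with `ρ, ρ' > 0` forces
`ρ = ρ'` and `θ ≡ θ' (mod 2π)`. [folklore] -/
private theorem polar_unique {ρ ρ' θ θ' : ℝ} (hρ : 0 < ρ) (hρ' : 0 < ρ') (h : ρ • dir θ = ρ' • dir θ') :
    ρ = ρ' ∧ ∃ k : ℤ, θ - θ' = 2 * π * k := by
  have hc : ρ * Real.cos θ = ρ' * Real.cos θ' := by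
    simpa [smul_dir_apply_zero] using congrFun h 0
  have hs : ρ * Real.sin θ = ρ' * Real.sin θ' := by
    simpa [smul_dir_apply_one] using congrFun h 1
  have hsq : ρ ^ 2 = ρ' ^ 2 := by
    have h1 : ρ ^ 2 = (ρ * Real.cos θ) ^ 2 + (ρ * Real.sin θ) ^ 2 := by
      nlinarith [Real.sin_sq_add_cos_sq θ]
    have h2 : ρ' ^ 2 = (ρ' * Real.cos θ') ^ 2 + (ρ' * Real.sin θ') ^ 2 := by
      nlinarith [Real.sin_sq_add_cos_sq θ']
    rw [h1, h2, hc, hs]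
  have hρρ : ρ = ρ' := (pow_left_inj₀ hρ.le hρ'.le two_ne_zero).1 hsq
  refine ⟨hρρ, ?_⟩
  subst hρρ
  have hcos : Real.cos θ = Real.cos θ' := mul_left_cancel₀ hρ.ne' hc
  have hsin : Real.sin θ = Real.sin θ' := mul_left_cancel₀ hρ.ne' hs
  exact Real.Angle.angle_eq_iff_two_pi_dvd_sub.1 (Real.Angle.cos_sin_inj hcos hsin)

/-- The radial mean-value estimate behind (A1.10b): along the ray of angle `θ`, between two level
curves `Σ(e_a)`, `Σ(e_b)` (`|e_a|, |e_b| ≤ e₀`) the dispersion grows at rate `≥ c₁` ((2.8b)), so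
`c₁ (u(θ,e_b) - u(θ,e_a)) ≤ e_b - e_a` whenever `u(θ,e_a) < u(θ,e_b)`. [cite: BenfattoGiulianiMastropietro2003, §7.1 Lemma 7.2 proof (A1.10b) p.26 (L96–104)] -/
private theorem radial_increment {ε : (Fin 2 → ℝ) → ℝ} {μ e₀ : ℝ} {u : ℝ → ℝ → ℝ}
    (hD : DispersionHyp ε μ e₀ u) {c₁ c₂ : ℝ}
    (hrad : ∀ θ e : ℝ, |e| ≤ e₀ →
      c₁ ≤ fderiv ℝ ε (levelPoint u θ e) (dir θ) ∧ fderiv ℝ ε (levelPoint u θ e) (dir θ) ≤ c₂)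
    (θ : ℝ) {ea eb : ℝ} (hea : |ea| ≤ e₀) (heb : |eb| ≤ e₀) (hlt : u θ ea < u θ eb) :
    c₁ * (u θ eb - u θ ea) ≤ eb - ea := by
  -- the dispersion along the ray
  set f : ℝ → ℝ := fun t => ε (t • dir θ) with hf
  have hεd : Differentiable ℝ ε := hD.smooth_ε.differentiable (by simp)
  have hderiv : ∀ t : ℝ, HasDerivAt f (fderiv ℝ ε (t • dir θ) (dir θ)) t := by
    intro t
    have h := (hεd (t • dir θ)).hasFDerivAt.comp_hasDerivAt t ((hasDerivAt_id t).smul_const (dir θ))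
    rw [one_smul] at h
    exact h
  have hfc : ContinuousOn f (Icc (u θ ea) (u θ eb)) := fun t _ => (hderiv t).continuousAt.continuousWithinAt
  have hfd : DifferentiableOn ℝ f (Ioo (u θ ea) (u θ eb)) := fun t _ => (hderiv t).differentiableAt.differentiableWithinAt
  obtain ⟨ξ, hξ, hslope⟩ := exists_deriv_eq_slope f hlt hfc hfd
  -- `ξ` lies on a level curve `Σ(e'')` with `e''` between `ea` and `eb` (intermediate values of `u(θ,·)`)
  obtain ⟨e₁, he₁, hsm⟩ := hD.smooth_u
  have hcont : ContinuousOn (fun t => u θ t) (uIcc ea eb) := by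
    have hsub : uIcc ea eb ⊆ Icc (-e₀) e₀ := uIcc_subset_Icc (abs_le.1 hea) (abs_le.1 heb)
    have hmaps : MapsTo (fun t : ℝ => (θ, t)) (uIcc ea eb) (univ ×ˢ Ioo (-e₁) e₁) := by
      intro t ht
      have ht' := hsub ht
      exact ⟨mem_univ _, ⟨by linarith [ht'.1], by linarith [ht'.2]⟩⟩
    have h := hsm.continuousOn.comp (continuous_const.prodMk continuous_id).continuousOn hmaps
    exact h
  have hξu : ξ ∈ uIcc (u θ ea) (u θ eb) := by
    rw [uIcc_of_le hlt.le]; exact Ioo_subset_Icc_self hξ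
  obtain ⟨e'', he''mem, he''⟩ := intermediate_value_uIcc hcont hξu
  have he''abs : |e''| ≤ e₀ := abs_le.2 (by
    have := uIcc_subset_Icc (abs_le.1 hea) (abs_le.1 heb) he''mem; exact ⟨this.1, this.2⟩)
  -- the slope is the radial derivative at `ξ e⃗_r(θ) = q⃗(θ, e'')`, hence `≥ c₁`
  have hdξ : deriv f ξ = fderiv ℝ ε (levelPoint u θ e'') (dir θ) := by
    rw [(hderiv ξ).deriv, levelPoint, ← he'']
  have hge : c₁ ≤ (f (u θ eb) - f (u θ ea)) / (u θ eb - u θ ea) := by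
    rw [← hslope, hdξ]; exact (hrad θ e'' he''abs).1
  have hfb : f (u θ eb) = μ + eb := hD.level θ eb heb
  have hfa : f (u θ ea) = μ + ea := hD.level θ ea hea
  rw [hfb, hfa, le_div_iff₀ (sub_pos.2 hlt)] at hge
  linarith

/-- **BGM 2003 Lemma 7.2 [lms1.1] (A1.10a) — PROVED** (discharges the named fact
`lemma72_sectorPolar`): with `c = e₀/c₁` (`c₁` the lower radial bound of (2.8b)),
`|ρ - u(θ)| ≤ |e|/c₁ ≤ cγ^h` by the radial mean-value estimate (A1.10b), and
`‖θ - θ_{h,ω}‖ ≤ ¾πγ^{h/2} ≤ πγ^{h/2}` from the support of `ζ_{h,ω}`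
(`sectorWeightCirc_eq_zero`). [cite: BenfattoGiulianiMastropietro2003, §7.1 Lemma 7.2 (A1.10a)–(A1.10b) p.26 (L89–104)] -/
theorem lemma72_sectorPolar_holds : lemma72_sectorPolar := by
  intro ε μ e₀ u hD
  obtain ⟨c₁, c₂, hc₁, -, hrad⟩ := hD.radial
  obtain ⟨cu, hcu, hu⟩ := hD.u_pos
  refine ⟨e₀ / c₁, div_pos hD.e₀_pos hc₁, ?_⟩
  intro n ω _hω p hp ρ θ hρ hpeq
  obtain ⟨θ', e, he, hζ, rfl⟩ := hp
  have h4le : (4 : ℝ) ^ (-(n : ℤ)) ≤ 1 := zpow_le_one_of_nonpos₀ (by norm_num) (by simp)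
  have h4pos : 0 < (4 : ℝ) ^ (-(n : ℤ)) := zpow_pos (by norm_num) _
  have he₀ : |e| ≤ e₀ := he.trans (by nlinarith [hD.e₀_pos])
  have h0 : |(0 : ℝ)| ≤ e₀ := by rw [abs_zero]; exact hD.e₀_pos.le
  have hupos : 0 < u θ' e := lt_of_lt_of_le hcu (hu θ' e he₀)
  -- polar uniqueness: `ρ = u(θ', e)` and `θ = θ' + 2πk`
  obtain ⟨hρu, k, hk⟩ := polar_unique hupos hρ hpeq
  have hθ : θ = θ' + ((-k : ℤ) : ℝ) * (2 * π) := by push_cast; linarith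
  constructor
  · -- radial part
    have hper : u θ 0 = u θ' 0 := by rw [hθ]; exact (hD.periodic_u 0).int_mul (-k) θ'
    rw [← hρu, hper]
    have key : c₁ * |u θ' e - u θ' 0| ≤ |e| := by
      rcases lt_trichotomy (u θ' 0) (u θ' e) with hlt | heq | hgt
      · have h := radial_increment hD hrad θ' h0 he₀ hlt
        rw [abs_of_pos (sub_pos.2 hlt)]
        have : e - 0 ≤ |e| := by rw [sub_zero]; exact le_abs_self e
        linarith
      · rw [← heq, sub_self, abs_zero, mul_zero]; exact abs_nonneg e
      · have h := radial_increment hD hrad θ' he₀ h0 hgt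
        rw [abs_of_neg (sub_neg.2 hgt)]
        have : 0 - e ≤ |e| := by rw [zero_sub]; exact neg_le_abs e
        linarith
    rw [← le_div_iff₀' hc₁] at key
    calc |u θ' e - u θ' 0| ≤ |e| / c₁ := key
      _ ≤ (4 : ℝ) ^ (-(n : ℤ)) * e₀ / c₁ := div_le_div_of_nonneg_right he hc₁.le
      _ = e₀ / c₁ * (4 : ℝ) ^ (-(n : ℤ)) := by ring
  · -- angular part: `ζ_{n,ω}(θ') ≠ 0` puts `θ'` within `¾ w_n` of `θ_{n,ω}` modulo `2π`
    have hex : ∃ j : ℤ, |θ' - (((ω : ℤ) : ℝ) + 1 / 2) * sectorWidth n - 2 * π * j| <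
        3 * sectorWidth n / 4 := by
      by_contra hcon
      exact hζ (sectorWeightCirc_eq_zero fun j => not_lt.1 fun h => hcon ⟨j, h⟩)
    obtain ⟨j, hj⟩ := hex
    have hw : sectorWidth n = π * (2 : ℝ) ^ (-(n : ℤ)) := by
      rw [sectorWidth, zpow_neg, zpow_natCast, div_eq_mul_inv]
    have hcast : (((ω : ℤ) : ℝ) + 1 / 2) * sectorWidth n = sectorCenter n ω := by
      rw [sectorCenter, Int.cast_natCast]
    rw [hcast] at hj
    -- the circle distance is at most the distance to any representative
    have hrep : ((θ - sectorCenter n ω : ℝ) : AddCircle (2 * π)) =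
        ((θ' - sectorCenter n ω - 2 * π * j : ℝ) : AddCircle (2 * π)) := by
      rw [eq_comm, ← sub_eq_zero, ← AddCircle.coe_sub, AddCircle.coe_eq_zero_iff]
      exact ⟨k - j, by rw [hθ]; push_cast; ring⟩
    have hle : torusDist (θ - sectorCenter n ω) ≤ |θ' - sectorCenter n ω - 2 * π * j| := by
      rw [torusDist, hrep]
      exact QuotientAddGroup.norm_mk_le_norm.trans (le_of_eq (Real.norm_eq_abs _))
    have hwpos : 0 < sectorWidth n := sectorWidth_pos n
    calc torusDist (θ - sectorCenter n ω) ≤ |θ' - sectorCenter n ω - 2 * π * j| := hle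
      _ ≤ 3 * sectorWidth n / 4 := hj.le
      _ ≤ sectorWidth n := by linarith
      _ = π * (2 : ℝ) ^ (-(n : ℤ)) := hw

end BGM2003

end Literature.MathematicalPhysics.QuantumLattice.FermiRG


/-! ### Lemma 7.3 discharged (proof of `lemma73_sectorBox`) -/

namespace Literature.MathematicalPhysics.QuantumLattice.FermiRG

namespace BGM2003

open Real Set

section SectorBoxProof

variable {ε : (Fin 2 → ℝ) → ℝ} {μ e₀ : ℝ} {u : ℝ → ℝ → ℝ}

/-! #### Elementary facts about the frame vectors (sup norm on `Fin 2 → ℝ`) -/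

/-- `|v ⋅ w| ≤ 2‖v‖‖w‖` in `ℝ²` with the sup norm. [folklore] -/
private theorem abs_dotProduct_le (v w : Fin 2 → ℝ) : |v ⬝ᵥ w| ≤ 2 * ‖v‖ * ‖w‖ := by
  rw [dotProduct, Fin.sum_univ_two]
  have h0 : |v 0 * w 0| ≤ ‖v‖ * ‖w‖ := by
    rw [abs_mul]; exact mul_le_mul (norm_le_pi_norm v 0) (norm_le_pi_norm w 0) (abs_nonneg _) (norm_nonneg _)
  have h1 : |v 1 * w 1| ≤ ‖v‖ * ‖w‖ := by
    rw [abs_mul]; exact mul_le_mul (norm_le_pi_norm v 1) (norm_le_pi_norm w 1) (abs_nonneg _) (norm_nonneg _)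
  calc |v 0 * w 0 + v 1 * w 1| ≤ |v 0 * w 0| + |v 1 * w 1| := abs_add_le _ _
    _ ≤ 2 * ‖v‖ * ‖w‖ := by linarith

/-- `‖e⃗_r(θ)‖ ≤ 1`. [folklore] -/
private theorem norm_dir_le_one (θ : ℝ) : ‖dir θ‖ ≤ 1 :=
  (pi_norm_le_iff_of_nonneg zero_le_one).2 fun i => by
    rw [Real.norm_eq_abs]; exact abs_dir_le_one θ i

/-- `‖e⃗_t(θ)‖ ≤ 1`. [folklore] -/
private theorem norm_tdir_le_one (θ : ℝ) : ‖tdir θ‖ ≤ 1 :=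
  (pi_norm_le_iff_of_nonneg zero_le_one).2 fun i => by
    fin_cases i
    · simpa [tdir] using Real.abs_sin_le_one θ
    · simpa [tdir] using Real.abs_cos_le_one θ

/-- `‖e⃗_r(a) - e⃗_r(b)‖ ≤ |a - b|`. [folklore] -/
private theorem norm_dir_sub_le (a b : ℝ) : ‖dir a - dir b‖ ≤ |a - b| :=
  (pi_norm_le_iff_of_nonneg (abs_nonneg _)).2 fun i => by
    fin_cases i
    · simpa [dir] using Real.abs_cos_sub_cos_le a b
    · simpa [dir] using Real.abs_sin_sub_sin_le a b

/-- `‖e⃗_t(a) - e⃗_t(b)‖ ≤ |a - b|`. [folklore] -/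
private theorem norm_tdir_sub_le (a b : ℝ) : ‖tdir a - tdir b‖ ≤ |a - b| :=
  (pi_norm_le_iff_of_nonneg (abs_nonneg _)).2 fun i => by
    fin_cases i
    · have h := Real.abs_sin_sub_sin_le b a
      rw [abs_sub_comm b a] at h
      simpa [tdir, neg_add_eq_sub] using h
    · simpa [tdir] using Real.abs_cos_sub_cos_le a b

/-- `e⃗_r · e⃗_r = 1`. [folklore] -/
private theorem dir_dot_dir (θ : ℝ) : dir θ ⬝ᵥ dir θ = 1 := by
  simp [dotProduct, Fin.sum_univ_two, dir]; nlinarith [Real.sin_sq_add_cos_sq θ]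

/-- `e⃗_t · e⃗_r = 0`. [folklore] -/
private theorem tdir_dot_dir (θ : ℝ) : tdir θ ⬝ᵥ dir θ = 0 := by
  simp [dotProduct, Fin.sum_univ_two, dir, tdir]; ring

/-- `e⃗_r(θ - 2πj) = e⃗_r(θ)`. [folklore] -/
private theorem dir_sub_int_mul (θ : ℝ) (j : ℤ) : dir (θ - j * (2 * π)) = dir θ := by
  ext i; fin_cases i
  · simp [dir, Real.cos_sub_int_mul_two_pi]
  · simp [dir, Real.sin_sub_int_mul_two_pi]

/-- The derivative of `θ ↦ e⃗_r(θ) · w` is `e⃗_t(θ) · w`. [folklore] -/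
private theorem hasDerivAt_dir_dot (w : Fin 2 → ℝ) (θ : ℝ) :
    HasDerivAt (fun ϑ => dir ϑ ⬝ᵥ w) (tdir θ ⬝ᵥ w) θ := by
  have h : HasDerivAt (fun ϑ => Real.cos ϑ * w 0 + Real.sin ϑ * w 1)
      (-Real.sin θ * w 0 + Real.cos θ * w 1) θ :=
    ((Real.hasDerivAt_cos θ).mul_const _).add ((Real.hasDerivAt_sin θ).mul_const _)
  have h1 : (fun ϑ => dir ϑ ⬝ᵥ w) = fun ϑ => Real.cos ϑ * w 0 + Real.sin ϑ * w 1 := by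
    funext ϑ; simp [dotProduct, Fin.sum_univ_two, dir]
  have h2 : tdir θ ⬝ᵥ w = -Real.sin θ * w 0 + Real.cos θ * w 1 := by
    simp [dotProduct, Fin.sum_univ_two, tdir]
  rw [h1, h2]; exact h

/-- The derivative of `θ ↦ e⃗_t(θ) · w` is `-(e⃗_r(θ) · w)`. [folklore] -/
private theorem hasDerivAt_tdir_dot (w : Fin 2 → ℝ) (θ : ℝ) :
    HasDerivAt (fun ϑ => tdir ϑ ⬝ᵥ w) (-(dir θ ⬝ᵥ w)) θ := by
  have h : HasDerivAt (fun ϑ => -Real.sin ϑ * w 0 + Real.cos ϑ * w 1)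
      (-Real.cos θ * w 0 + -Real.sin θ * w 1) θ :=
    ((Real.hasDerivAt_sin θ).neg.mul_const _).add ((Real.hasDerivAt_cos θ).mul_const _)
  have h1 : (fun ϑ => tdir ϑ ⬝ᵥ w) = fun ϑ => -Real.sin ϑ * w 0 + Real.cos ϑ * w 1 := by
    funext ϑ; simp [dotProduct, Fin.sum_univ_two, tdir]
  have h2 : -(dir θ ⬝ᵥ w) = -Real.cos θ * w 0 + -Real.sin θ * w 1 := by
    simp [dotProduct, Fin.sum_univ_two, dir]; ring
  rw [h1, h2]; exact h

/-! #### The frame at a point of the shell -/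

/-- `s'(θ,e)² = u'² + u²`. [folklore] -/
private theorem speed_sq_sec (u : ℝ → ℝ → ℝ) (θ e : ℝ) :
    speed u θ e ^ 2 = radiusDeriv u θ e ^ 2 + u θ e ^ 2 :=
  Real.sq_sqrt (by positivity)

/-- `s' ≥ u`. [folklore] -/
private theorem le_speed (u : ℝ → ℝ → ℝ) (θ e : ℝ) (hu : 0 ≤ u θ e) : u θ e ≤ speed u θ e := by
  unfold speed
  calc u θ e = Real.sqrt (u θ e ^ 2) := (Real.sqrt_sq hu).symm
    _ ≤ Real.sqrt (radiusDeriv u θ e ^ 2 + u θ e ^ 2) := Real.sqrt_le_sqrt (by nlinarith)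

/-- Components of `n⃗` and `τ⃗` in terms of `a = u/s'`, `b = u'/s'`. [folklore] -/
private theorem unitNormal_eq (u : ℝ → ℝ → ℝ) (θ e : ℝ) :
    unitNormal u θ e = ![(speed u θ e)⁻¹ * u θ e * Real.cos θ + (speed u θ e)⁻¹ * radiusDeriv u θ e * Real.sin θ,
      (speed u θ e)⁻¹ * u θ e * Real.sin θ - (speed u θ e)⁻¹ * radiusDeriv u θ e * Real.cos θ] := by
  ext i; fin_cases i <;> simp [unitNormal, dir, tdir] <;> ring

/-- Components of `τ⃗`. [folklore] -/
private theorem unitTangent_eq (u : ℝ → ℝ → ℝ) (θ e : ℝ) :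
    unitTangent u θ e = ![(speed u θ e)⁻¹ * radiusDeriv u θ e * Real.cos θ - (speed u θ e)⁻¹ * u θ e * Real.sin θ,
      (speed u θ e)⁻¹ * radiusDeriv u θ e * Real.sin θ + (speed u θ e)⁻¹ * u θ e * Real.cos θ] := by
  ext i; fin_cases i <;> simp [unitTangent, dir, tdir] <;> ring

/-- `(u/s')² + (u'/s')² = 1`. [folklore] -/
private theorem frame_coeff_sq {θ e : ℝ} (hs : 0 < speed u θ e) :
    ((speed u θ e)⁻¹ * u θ e) ^ 2 + ((speed u θ e)⁻¹ * radiusDeriv u θ e) ^ 2 = 1 := by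
  rw [mul_pow, mul_pow, ← mul_add, add_comm, ← speed_sq_sec, inv_pow, inv_mul_cancel₀ (pow_ne_zero 2 hs.ne')]

/-- Orthonormal decomposition in the frame `(n⃗, τ⃗)`: `v = (v·n⃗)n⃗ + (v·τ⃗)τ⃗`. [folklore] -/
private theorem frame_decomp {θ e : ℝ} (hs : 0 < speed u θ e) (v : Fin 2 → ℝ) :
    v = (v ⬝ᵥ unitNormal u θ e) • unitNormal u θ e + (v ⬝ᵥ unitTangent u θ e) • unitTangent u θ e := by
  have hab := frame_coeff_sq hs
  have hcs := Real.sin_sq_add_cos_sq θ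
  set a := (speed u θ e)⁻¹ * u θ e with ha
  set b := (speed u θ e)⁻¹ * radiusDeriv u θ e with hb
  rw [unitNormal_eq, unitTangent_eq, ← ha, ← hb]
  ext i; fin_cases i
  · simp [dotProduct, Fin.sum_univ_two]
    linear_combination (-(v 0) * (Real.sin θ ^ 2 + Real.cos θ ^ 2)) * hab + (-(v 0)) * hcs
  · simp [dotProduct, Fin.sum_univ_two]
    linear_combination (-(v 1) * (Real.sin θ ^ 2 + Real.cos θ ^ 2)) * hab + (-(v 1)) * hcs

/-- `‖n⃗‖ ≤ 1` (its components are `≤ 1` by Cauchy–Schwarz). [folklore] -/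
private theorem norm_unitNormal_le {θ e : ℝ} (hs : 0 < speed u θ e) : ‖unitNormal u θ e‖ ≤ 1 := by
  have hab := frame_coeff_sq hs
  have hcs := Real.sin_sq_add_cos_sq θ
  set a := (speed u θ e)⁻¹ * u θ e with ha
  set b := (speed u θ e)⁻¹ * radiusDeriv u θ e with hb
  rw [unitNormal_eq, ← ha, ← hb]
  refine (pi_norm_le_iff_of_nonneg zero_le_one).2 fun i => ?_
  fin_cases i
  · simp only [Real.norm_eq_abs]
    refine abs_le_one_iff_mul_self_le_one.2 ?_
    simp
    nlinarith [sq_nonneg (a * Real.sin θ - b * Real.cos θ)]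
  · simp only [Real.norm_eq_abs]
    refine abs_le_one_iff_mul_self_le_one.2 ?_
    simp
    nlinarith [sq_nonneg (a * Real.cos θ + b * Real.sin θ)]

/-- `‖τ⃗‖ ≤ 1`. [folklore] -/
private theorem norm_unitTangent_le {θ e : ℝ} (hs : 0 < speed u θ e) : ‖unitTangent u θ e‖ ≤ 1 := by
  have hab := frame_coeff_sq hs
  have hcs := Real.sin_sq_add_cos_sq θ
  set a := (speed u θ e)⁻¹ * u θ e with ha
  set b := (speed u θ e)⁻¹ * radiusDeriv u θ e with hb
  rw [unitTangent_eq, ← ha, ← hb]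
  refine (pi_norm_le_iff_of_nonneg zero_le_one).2 fun i => ?_
  fin_cases i
  · simp only [Real.norm_eq_abs]
    refine abs_le_one_iff_mul_self_le_one.2 ?_
    simp
    nlinarith [sq_nonneg (b * Real.sin θ + a * Real.cos θ)]
  · simp only [Real.norm_eq_abs]
    refine abs_le_one_iff_mul_self_le_one.2 ?_
    simp
    nlinarith [sq_nonneg (b * Real.cos θ - a * Real.sin θ)]

/-- `e⃗_r(θ) · n⃗(θ,e) = u/s'` and `e⃗_t(θ) · n⃗(θ,e) = -u'/s'`. [folklore] -/
private theorem dir_dot_unitNormal (u : ℝ → ℝ → ℝ) (θ e : ℝ) :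
    dir θ ⬝ᵥ unitNormal u θ e = (speed u θ e)⁻¹ * u θ e ∧
      tdir θ ⬝ᵥ unitNormal u θ e = -((speed u θ e)⁻¹ * radiusDeriv u θ e) := by
  have hcs := Real.sin_sq_add_cos_sq θ
  rw [unitNormal_eq]
  constructor
  · simp [dotProduct, Fin.sum_univ_two, dir]
    linear_combination ((speed u θ e)⁻¹ * u θ e) * hcs
  · simp [dotProduct, Fin.sum_univ_two, tdir]
    linear_combination (-((speed u θ e)⁻¹ * radiusDeriv u θ e)) * hcs

/-! #### Regularity of the polar radius extracted from `DispersionHyp` -/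

/-- Each slice `θ ↦ u(θ,e)`, `|e| ≤ e₀`, is `C^∞`. [folklore] -/
private theorem contDiff_slice (hD : DispersionHyp ε μ e₀ u) {e : ℝ} (he : |e| ≤ e₀) :
    ContDiff ℝ ((⊤ : ℕ∞) : WithTop ℕ∞) (fun θ => u θ e) := by
  obtain ⟨e₁, he₁, hsm⟩ := hD.smooth_u
  have hmem : ∀ θ : ℝ, (θ, e) ∈ univ ×ˢ Ioo (-e₁) e₁ := fun θ =>
    ⟨mem_univ _, ⟨by linarith [(abs_le.1 he).1], by linarith [(abs_le.1 he).2]⟩⟩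
  exact hsm.comp_contDiff (contDiff_id.prodMk contDiff_const) hmem

/-- `θ ↦ u(θ,e)` has derivative `u'(θ,e)`. [folklore] -/
private theorem hasDerivAt_u (hD : DispersionHyp ε μ e₀ u) {e : ℝ} (he : |e| ≤ e₀) (θ : ℝ) :
    HasDerivAt (fun ϑ => u ϑ e) (radiusDeriv u θ e) θ :=
  (((contDiff_slice hD he).differentiable (by simp)).differentiableAt).hasDerivAt

/-- `θ ↦ u'(θ,0)` is `C^∞` and has derivative `u''(θ,0)`. [folklore] -/
private theorem contDiff_radiusDeriv (hD : DispersionHyp ε μ e₀ u) {e : ℝ} (he : |e| ≤ e₀) :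
    ContDiff ℝ ((⊤ : ℕ∞) : WithTop ℕ∞) (fun θ => radiusDeriv u θ e) := by
  have h := (contDiff_infty_iff_deriv.1 (contDiff_slice hD he)).2
  exact h

/-- `θ ↦ u'(θ,e)` has derivative `u''(θ,e)`. [folklore] -/
private theorem hasDerivAt_radiusDeriv (hD : DispersionHyp ε μ e₀ u) {e : ℝ} (he : |e| ≤ e₀) (θ : ℝ) :
    HasDerivAt (fun ϑ => radiusDeriv u ϑ e) (radiusDeriv₂ u θ e) θ :=
  (((contDiff_radiusDeriv hD he).differentiable (by simp)).differentiableAt).hasDerivAt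

/-- A continuous `2π`-periodic real function is bounded. [folklore] -/
private theorem periodic_bound {f : ℝ → ℝ} (hf : Continuous f) (hp : Function.Periodic f (2 * π)) :
    ∃ M : ℝ, 0 ≤ M ∧ ∀ θ : ℝ, |f θ| ≤ M := by
  obtain ⟨C, hC⟩ := isBounded_iff_forall_norm_le.1 (hp.isBounded_of_continuous (by positivity) hf)
  refine ⟨max C 0, le_max_right _ _, fun θ => ?_⟩
  exact (Real.norm_eq_abs _ ▸ hC (f θ) ⟨θ, rfl⟩).trans (le_max_left _ _)

/-- The derivative of a `2π`-periodic function is `2π`-periodic. [folklore] -/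
private theorem periodic_deriv {f : ℝ → ℝ} (hp : Function.Periodic f (2 * π)) :
    Function.Periodic (deriv f) (2 * π) := by
  intro θ
  have h : (fun x => f (x + 2 * π)) = f := funext hp
  rw [← deriv_comp_add_const f (2 * π) θ, h]

/-! #### The radial estimate `|u(θ,e) - u(θ,0)| ≤ |e|/c₁` -/

/-- The radial estimate of Lemma 7.2: `|u(θ,e) - u(θ,0)| ≤ |e|/c₁` ((A1.10b) with (2.8b)). [cite: BenfattoGiulianiMastropietro2003, §7.1 Lemma 7.2 proof (A1.10b) p.26 (L96–104)] -/
private theorem radial_abs (hD : DispersionHyp ε μ e₀ u) {c₁ c₂ : ℝ} (hc₁ : 0 < c₁)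
    (hrad : ∀ θ e : ℝ, |e| ≤ e₀ →
      c₁ ≤ fderiv ℝ ε (levelPoint u θ e) (dir θ) ∧ fderiv ℝ ε (levelPoint u θ e) (dir θ) ≤ c₂)
    (θ : ℝ) {e : ℝ} (he : |e| ≤ e₀) : |u θ e - u θ 0| ≤ |e| / c₁ := by
  have h0 : |(0 : ℝ)| ≤ e₀ := by rw [abs_zero]; exact hD.e₀_pos.le
  rw [le_div_iff₀ hc₁]
  rcases lt_trichotomy (u θ 0) (u θ e) with hlt | heq | hgt
  · have h := radial_increment hD hrad θ h0 he hlt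
    rw [abs_of_pos (sub_pos.2 hlt)]
    have : e - 0 ≤ |e| := by rw [sub_zero]; exact le_abs_self e
    linarith
  · rw [← heq, sub_self, abs_zero, zero_mul]; exact abs_nonneg e
  · have h := radial_increment hD hrad θ he h0 hgt
    rw [abs_of_neg (sub_neg.2 hgt)]
    have : 0 - e ≤ |e| := by rw [zero_sub]; exact neg_le_abs e
    linarith

/-! #### The tangential derivative of `ε` vanishes along `Σ(e)` -/

/-- `∇ε(q⃗(θ,e)) · ∂_θ q⃗(θ,e) = 0` ((A1.17): `ε ∘ q⃗(·,e) ≡ μ + e`). [folklore] -/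
private theorem fderiv_levelPoint_tangential (hD : DispersionHyp ε μ e₀ u) {e : ℝ} (he : |e| ≤ e₀) (θ : ℝ) :
    fderiv ℝ ε (levelPoint u θ e) (radiusDeriv u θ e • dir θ + u θ e • tdir θ) = 0 := by
  -- derivative of the curve `θ ↦ q⃗(θ,e)`
  have hdir : HasDerivAt dir (tdir θ) θ := by
    rw [hasDerivAt_pi]
    intro i; fin_cases i
    · simpa [dir, tdir] using (Real.hasDerivAt_cos θ)
    · simpa [dir, tdir] using (Real.hasDerivAt_sin θ)
  have hq : HasDerivAt (fun ϑ => levelPoint u ϑ e) (radiusDeriv u θ e • dir θ + u θ e • tdir θ) θ := by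
    have h := (hasDerivAt_u hD he θ).smul hdir
    rw [add_comm] at h
    exact h
  have hεd : Differentiable ℝ ε := hD.smooth_ε.differentiable (by simp)
  have hcomp : HasDerivAt (fun ϑ => ε (levelPoint u ϑ e))
      (fderiv ℝ ε (levelPoint u θ e) (radiusDeriv u θ e • dir θ + u θ e • tdir θ)) θ :=
    (hεd _).hasFDerivAt.comp_hasDerivAt θ hq
  have hconst : HasDerivAt (fun ϑ => ε (levelPoint u ϑ e)) 0 θ := by
    have : (fun ϑ => ε (levelPoint u ϑ e)) = fun _ => μ + e := funext fun ϑ => hD.level ϑ e he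
    rw [this]; exact hasDerivAt_const θ (μ + e)
  exact hcomp.unique hconst

end SectorBoxProof

end BGM2003

end Literature.MathematicalPhysics.QuantumLattice.FermiRG


namespace Literature.MathematicalPhysics.QuantumLattice.FermiRG

namespace BGM2003

open Real Set

section SectorBoxMain

variable {ε : (Fin 2 → ℝ) → ℝ} {μ e₀ : ℝ} {u : ℝ → ℝ → ℝ}

/-! #### Joint bounds on the box `[-π, 3π] × [-e₀, e₀]` -/

/-- On the compact box `K = [-π, 3π] × [-e₀, e₀]` (which contains every sector centre and every
representative angle of a sector point): `u`, `u'` and `‖∇ε(q⃗(θ,e))‖` are bounded by `M`, and `u`,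
`u'` are `L`-Lipschitz in `(θ, e)`. [folklore] -/
private theorem joint_bounds (hD : DispersionHyp ε μ e₀ u) :
    ∃ M L : ℝ, 0 ≤ M ∧ 0 ≤ L ∧ ∀ θ θ' e e' : ℝ, θ ∈ Icc (-π) (3 * π) → θ' ∈ Icc (-π) (3 * π) →
      |e| ≤ e₀ → |e'| ≤ e₀ →
        |u θ e| ≤ M ∧ |radiusDeriv u θ e| ≤ M ∧ ‖fderiv ℝ ε (levelPoint u θ e)‖ ≤ M ∧
        |u θ' e' - u θ e| ≤ L * (|θ' - θ| + |e' - e|) ∧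
        |radiusDeriv u θ' e' - radiusDeriv u θ e| ≤ L * (|θ' - θ| + |e' - e|) := by
  obtain ⟨e₁, he₁, hsm⟩ := hD.smooth_u
  set O : Set (ℝ × ℝ) := univ ×ˢ Ioo (-e₁) e₁ with hO
  have hOo : IsOpen O := isOpen_univ.prod isOpen_Ioo
  set K : Set (ℝ × ℝ) := Icc (-π) (3 * π) ×ˢ Icc (-e₀) e₀ with hK
  have hKc : IsCompact K := isCompact_Icc.prod isCompact_Icc
  have hKconv : Convex ℝ K := (convex_Icc _ _).prod (convex_Icc _ _)
  have hKO : K ⊆ O := fun q hq => ⟨mem_univ _, ⟨by linarith [hq.2.1], by linarith [hq.2.2]⟩⟩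
  set Φ : ℝ × ℝ → ℝ := Function.uncurry u with hΦ
  set Φ₁ : ℝ × ℝ → ℝ := fun q => fderiv ℝ Φ q (1, 0) with hΦ₁
  have hΦ₁smooth : ContDiffOn ℝ ((⊤ : ℕ∞) : WithTop ℕ∞) Φ₁ O :=
    (hsm.fderiv_of_isOpen hOo (m := ((⊤ : ℕ∞) : WithTop ℕ∞)) (by simp)).clm_apply contDiffOn_const
  have hΦdiff : ∀ q ∈ O, DifferentiableAt ℝ Φ q := fun q hq =>
    (hsm.differentiableOn (by simp)).differentiableAt (hOo.mem_nhds hq)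
  have hΦ₁diff : ∀ q ∈ O, DifferentiableAt ℝ Φ₁ q := fun q hq =>
    (hΦ₁smooth.differentiableOn (by simp)).differentiableAt (hOo.mem_nhds hq)
  -- `Φ₁` is the partial derivative `u'`
  have hΦ₁eq : ∀ q ∈ O, Φ₁ q = radiusDeriv u q.1 q.2 := by
    intro q hq
    have hline : HasDerivAt (fun ϑ : ℝ => (ϑ, q.2)) ((1 : ℝ), (0 : ℝ)) q.1 :=
      (hasDerivAt_id q.1).prodMk (hasDerivAt_const q.1 q.2)
    have hcomp := (hΦdiff q hq).hasFDerivAt.comp_hasDerivAt q.1 hline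
    change fderiv ℝ Φ q (1, 0) = deriv (fun ϑ => u ϑ q.2) q.1
    rw [← hcomp.deriv]
    rfl
  -- sup bounds
  obtain ⟨M₀, hM₀⟩ := hKc.exists_bound_of_continuousOn (hsm.continuousOn.mono hKO)
  obtain ⟨M₁, hM₁⟩ := hKc.exists_bound_of_continuousOn (hΦ₁smooth.continuousOn.mono hKO)
  have hεC : Continuous (fderiv ℝ ε) := hD.smooth_ε.continuous_fderiv (by simp)
  have hlev : ContinuousOn (fun q : ℝ × ℝ => fderiv ℝ ε (levelPoint u q.1 q.2)) K := by
    refine hεC.comp_continuousOn ?_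
    have h1 : ContinuousOn (fun q : ℝ × ℝ => Φ q • dir q.1) K := by
      refine (hsm.continuousOn.mono hKO).smul ?_
      have : Continuous fun q : ℝ × ℝ => dir q.1 := by
        refine continuous_pi fun i => ?_
        fin_cases i
        · exact (Real.continuous_cos.comp continuous_fst)
        · exact (Real.continuous_sin.comp continuous_fst)
      exact this.continuousOn
    exact h1
  obtain ⟨M₂, hM₂⟩ := hKc.exists_bound_of_continuousOn hlev
  -- Lipschitz bounds
  obtain ⟨L₀, hL₀⟩ := hKc.exists_bound_of_continuousOn ((hsm.continuousOn_fderiv_of_isOpen hOo (by simp)).mono hKO)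
  obtain ⟨L₁, hL₁⟩ := hKc.exists_bound_of_continuousOn ((hΦ₁smooth.continuousOn_fderiv_of_isOpen hOo (by simp)).mono hKO)
  have lip0 : ∀ q ∈ K, ∀ q' ∈ K, ‖Φ q' - Φ q‖ ≤ L₀ * ‖q' - q‖ := fun q hq q' hq' =>
    hKconv.norm_image_sub_le_of_norm_fderiv_le (fun x hx => hΦdiff x (hKO hx)) hL₀ hq hq'
  have lip1 : ∀ q ∈ K, ∀ q' ∈ K, ‖Φ₁ q' - Φ₁ q‖ ≤ L₁ * ‖q' - q‖ := fun q hq q' hq' =>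
    hKconv.norm_image_sub_le_of_norm_fderiv_le (fun x hx => hΦ₁diff x (hKO hx)) hL₁ hq hq'
  have hL₀0 : 0 ≤ L₀ := (norm_nonneg _).trans (hL₀ (0, 0) ⟨⟨by linarith [pi_pos], by linarith [pi_pos]⟩,
    ⟨by linarith [hD.e₀_pos], hD.e₀_pos.le⟩⟩)
  have hL₁0 : 0 ≤ L₁ := (norm_nonneg _).trans (hL₁ (0, 0) ⟨⟨by linarith [pi_pos], by linarith [pi_pos]⟩,
    ⟨by linarith [hD.e₀_pos], hD.e₀_pos.le⟩⟩)
  refine ⟨max (max M₀ M₁) (max M₂ 0), max L₀ L₁, le_max_of_le_right (le_max_right _ _),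
    hL₀0.trans (le_max_left _ _), ?_⟩
  intro θ θ' e e' hθ hθ' he he'
  have hq : (θ, e) ∈ K := ⟨hθ, abs_le.1 he⟩
  have hq' : (θ', e') ∈ K := ⟨hθ', abs_le.1 he'⟩
  have hnorm : ‖((θ', e') : ℝ × ℝ) - (θ, e)‖ ≤ |θ' - θ| + |e' - e| := by
    rw [Prod.mk_sub_mk, Prod.norm_def]
    exact max_le_add_of_nonneg (by positivity) (by positivity) |>.trans (by simp [Real.norm_eq_abs])
  refine ⟨?_, ?_, ?_, ?_, ?_⟩
  · exact ((Real.norm_eq_abs _).symm.le.trans (hM₀ _ hq)).trans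
      ((le_max_left _ _).trans (le_max_left _ _))
  · have h := hM₁ _ hq
    rw [hΦ₁eq _ (hKO hq), Real.norm_eq_abs] at h
    exact h.trans ((le_max_right _ _).trans (le_max_left _ _))
  · exact (hM₂ _ hq).trans ((le_max_left _ _).trans (le_max_right _ _))
  · have h := lip0 _ hq _ hq'
    rw [Real.norm_eq_abs] at h
    change |u θ' e' - u θ e| ≤ _ at h
    calc |u θ' e' - u θ e| ≤ L₀ * ‖((θ', e') : ℝ × ℝ) - (θ, e)‖ := h
      _ ≤ max L₀ L₁ * (|θ' - θ| + |e' - e|) :=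
        mul_le_mul (le_max_left _ _) hnorm (norm_nonneg _) (hL₀0.trans (le_max_left _ _))
  · have h := lip1 _ hq _ hq'
    rw [hΦ₁eq _ (hKO hq), hΦ₁eq _ (hKO hq'), Real.norm_eq_abs] at h
    calc |radiusDeriv u θ' e' - radiusDeriv u θ e| ≤ L₁ * ‖((θ', e') : ℝ × ℝ) - (θ, e)‖ := h
      _ ≤ max L₀ L₁ * (|θ' - θ| + |e' - e|) :=
        mul_le_mul (le_max_right _ _) hnorm (norm_nonneg _) (hL₀0.trans (le_max_left _ _))

end SectorBoxMain

end BGM2003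

end Literature.MathematicalPhysics.QuantumLattice.FermiRG


namespace Literature.MathematicalPhysics.QuantumLattice.FermiRG

namespace BGM2003

open Real Set

section SectorBoxFinal

variable {ε : (Fin 2 → ℝ) → ℝ} {μ e₀ : ℝ} {u : ℝ → ℝ → ℝ}

/-- Second-order tangency estimate (A1.15): along the Fermi curve,
`|[p⃗_F(ϑ) - p⃗_F(θ₀)] · n⃗(θ₀)| ≤ B₂ |ϑ - θ₀|²`, and the first-order one (A1.16)
`|[p⃗_F(ϑ) - p⃗_F(θ₀)] · w| ≤ B₁ |ϑ - θ₀|` for `‖w‖ ≤ 1`, with `B₁ = 2(M₀ + M₁)`,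
`B₂ = 2(M₂ + 2M₁ + M₀)` (`Mᵢ` bounds on `u, u', u''` at `e = 0`). [cite: BenfattoGiulianiMastropietro2003, §7.1 (A1.15)–(A1.16) p.26 (L134–141)] -/
private theorem fermi_chord_bounds (hD : DispersionHyp ε μ e₀ u) {M₀ M₁ M₂ : ℝ}
    (hM₀ : ∀ θ, |u θ 0| ≤ M₀) (hM₁ : ∀ θ, |radiusDeriv u θ 0| ≤ M₁) (hM₂ : ∀ θ, |radiusDeriv₂ u θ 0| ≤ M₂)
    (hM₀0 : 0 ≤ M₀) (hM₁0 : 0 ≤ M₁) (hM₂0 : 0 ≤ M₂)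
    (θ₀ : ℝ) (hs : 0 < speed u θ₀ 0) (w : Fin 2 → ℝ) (hw : ‖w‖ ≤ 1) (ϑ : ℝ) :
    |(fermiPoint u ϑ - fermiPoint u θ₀) ⬝ᵥ w| ≤ 2 * (M₀ + M₁) * |ϑ - θ₀| ∧
      |(fermiPoint u ϑ - fermiPoint u θ₀) ⬝ᵥ unitNormal u θ₀ 0| ≤
        2 * (M₂ + 2 * M₁ + M₀) * |ϑ - θ₀| ^ 2 := by
  have h0 : |(0 : ℝ)| ≤ e₀ := by rw [abs_zero]; exact hD.e₀_pos.le
  -- the chord function against a fixed vector `w'` and its two derivatives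
  have hg : ∀ w' : Fin 2 → ℝ, ∀ θ, HasDerivAt (fun t => (fermiPoint u t - fermiPoint u θ₀) ⬝ᵥ w')
      (radiusDeriv u θ 0 * (dir θ ⬝ᵥ w') + u θ 0 * (tdir θ ⬝ᵥ w')) θ := by
    intro w' θ
    have h1 : (fun t => (fermiPoint u t - fermiPoint u θ₀) ⬝ᵥ w') =
        fun t => u t 0 * (dir t ⬝ᵥ w') - fermiPoint u θ₀ ⬝ᵥ w' := by
      funext t; simp [fermiPoint, levelPoint, sub_dotProduct, smul_dotProduct]
    rw [h1]
    exact (((hasDerivAt_u hD h0 θ).mul (hasDerivAt_dir_dot w' θ)).sub_const _)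
  have hg' : ∀ w' : Fin 2 → ℝ, ∀ θ,
      HasDerivAt (fun t => radiusDeriv u t 0 * (dir t ⬝ᵥ w') + u t 0 * (tdir t ⬝ᵥ w'))
        (radiusDeriv₂ u θ 0 * (dir θ ⬝ᵥ w') + radiusDeriv u θ 0 * (tdir θ ⬝ᵥ w') +
          (radiusDeriv u θ 0 * (tdir θ ⬝ᵥ w') + u θ 0 * (-(dir θ ⬝ᵥ w')))) θ := by
    intro w' θ
    exact ((hasDerivAt_radiusDeriv hD h0 θ).mul (hasDerivAt_dir_dot w' θ)).add
      ((hasDerivAt_u hD h0 θ).mul (hasDerivAt_tdir_dot w' θ))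
  -- sizes of the frame pairings
  have hdw : ∀ w' : Fin 2 → ℝ, ‖w'‖ ≤ 1 → ∀ θ, |dir θ ⬝ᵥ w'| ≤ 2 ∧ |tdir θ ⬝ᵥ w'| ≤ 2 := by
    intro w' hw' θ
    constructor
    · calc |dir θ ⬝ᵥ w'| ≤ 2 * ‖dir θ‖ * ‖w'‖ := abs_dotProduct_le _ _
        _ ≤ 2 * 1 * 1 := by gcongr; exact norm_dir_le_one θ
        _ = 2 := by norm_num
    · calc |tdir θ ⬝ᵥ w'| ≤ 2 * ‖tdir θ‖ * ‖w'‖ := abs_dotProduct_le _ _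
        _ ≤ 2 * 1 * 1 := by gcongr; exact norm_tdir_le_one θ
        _ = 2 := by norm_num
  -- first-order bound for a general unit-size `w`
  have first : ∀ w' : Fin 2 → ℝ, ‖w'‖ ≤ 1 →
      |(fermiPoint u ϑ - fermiPoint u θ₀) ⬝ᵥ w'| ≤ 2 * (M₀ + M₁) * |ϑ - θ₀| := by
    intro w' hw'
    have hbound : ∀ θ ∈ (univ : Set ℝ),
        ‖deriv (fun t => (fermiPoint u t - fermiPoint u θ₀) ⬝ᵥ w') θ‖ ≤ 2 * (M₀ + M₁) := by
      intro θ _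
      rw [(hg w' θ).deriv, Real.norm_eq_abs]
      obtain ⟨hd1, hd2⟩ := hdw w' hw' θ
      calc |radiusDeriv u θ 0 * (dir θ ⬝ᵥ w') + u θ 0 * (tdir θ ⬝ᵥ w')|
          ≤ |radiusDeriv u θ 0| * |dir θ ⬝ᵥ w'| + |u θ 0| * |tdir θ ⬝ᵥ w'| := by
            rw [← abs_mul, ← abs_mul]; exact abs_add_le _ _
        _ ≤ M₁ * 2 + M₀ * 2 := by
            gcongr
            · exact hM₁ θ
            · exact hM₀ θ
        _ = 2 * (M₀ + M₁) := by ring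
    have h := (convex_univ).norm_image_sub_le_of_norm_deriv_le
      (fun θ _ => (hg w' θ).differentiableAt) hbound (mem_univ θ₀) (mem_univ ϑ)
    rw [Real.norm_eq_abs, Real.norm_eq_abs] at h
    simpa using h
  refine ⟨first w hw, ?_⟩
  -- second-order bound against `n⃗(θ₀)`: the first derivative vanishes at `θ₀`
  set n₀ := unitNormal u θ₀ 0 with hn₀
  have hn1 : ‖n₀‖ ≤ 1 := norm_unitNormal_le hs
  set g₁ : ℝ → ℝ := fun t => radiusDeriv u t 0 * (dir t ⬝ᵥ n₀) + u t 0 * (tdir t ⬝ᵥ n₀) with hg₁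
  have hg₁zero : g₁ θ₀ = 0 := by
    obtain ⟨h1, h2⟩ := dir_dot_unitNormal u θ₀ 0
    simp only [hg₁]
    rw [h1, h2]; ring
  -- `|g₁(t)| ≤ B₂ |t - θ₀|`
  have hg₁lip : ∀ t : ℝ, |g₁ t| ≤ 2 * (M₂ + 2 * M₁ + M₀) * |t - θ₀| := by
    intro t
    have hbound : ∀ θ ∈ (univ : Set ℝ), ‖deriv g₁ θ‖ ≤ 2 * (M₂ + 2 * M₁ + M₀) := by
      intro θ _
      rw [(hg' n₀ θ).deriv, Real.norm_eq_abs]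
      obtain ⟨hd1, hd2⟩ := hdw n₀ hn1 θ
      calc |radiusDeriv₂ u θ 0 * (dir θ ⬝ᵥ n₀) + radiusDeriv u θ 0 * (tdir θ ⬝ᵥ n₀) +
            (radiusDeriv u θ 0 * (tdir θ ⬝ᵥ n₀) + u θ 0 * -(dir θ ⬝ᵥ n₀))|
          ≤ |radiusDeriv₂ u θ 0 * (dir θ ⬝ᵥ n₀)| + |radiusDeriv u θ 0 * (tdir θ ⬝ᵥ n₀)| +
            (|radiusDeriv u θ 0 * (tdir θ ⬝ᵥ n₀)| + |u θ 0 * -(dir θ ⬝ᵥ n₀)|) :=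
            (abs_add_le _ _).trans (add_le_add (abs_add_le _ _) (abs_add_le _ _))
        _ = |radiusDeriv₂ u θ 0| * |dir θ ⬝ᵥ n₀| + |radiusDeriv u θ 0| * |tdir θ ⬝ᵥ n₀| +
            (|radiusDeriv u θ 0| * |tdir θ ⬝ᵥ n₀| + |u θ 0| * |dir θ ⬝ᵥ n₀|) := by
            simp only [abs_mul, abs_neg]
        _ ≤ M₂ * 2 + M₁ * 2 + (M₁ * 2 + M₀ * 2) := by
            gcongr
            · exact hM₂ θ
            · exact hM₁ θ
            · exact hM₁ θ
            · exact hM₀ θ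
        _ = 2 * (M₂ + 2 * M₁ + M₀) := by ring
    have h := (convex_univ).norm_image_sub_le_of_norm_deriv_le (f := g₁) (𝕜 := ℝ)
      (fun θ _ => (hg' n₀ θ).differentiableAt) hbound (mem_univ θ₀) (mem_univ t)
    rw [Real.norm_eq_abs, Real.norm_eq_abs, hg₁zero, sub_zero] at h
    exact h
  -- integrate once more on the segment `[[θ₀, ϑ]]`
  have hbound2 : ∀ t ∈ uIcc θ₀ ϑ,
      ‖deriv (fun t => (fermiPoint u t - fermiPoint u θ₀) ⬝ᵥ n₀) t‖ ≤
        2 * (M₂ + 2 * M₁ + M₀) * |ϑ - θ₀| := by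
    intro t ht
    rw [(hg n₀ t).deriv, Real.norm_eq_abs]
    exact (hg₁lip t).trans (mul_le_mul_of_nonneg_left (abs_sub_left_of_mem_uIcc ht) (by positivity))
  have h := (convex_uIcc θ₀ ϑ).norm_image_sub_le_of_norm_deriv_le
    (fun t _ => (hg n₀ t).differentiableAt) hbound2 left_mem_uIcc right_mem_uIcc
  rw [Real.norm_eq_abs, Real.norm_eq_abs] at h
  have e0 : (fermiPoint u θ₀ - fermiPoint u θ₀) ⬝ᵥ n₀ = 0 := by simp
  rw [e0, sub_zero] at h
  calc |(fermiPoint u ϑ - fermiPoint u θ₀) ⬝ᵥ n₀| ≤ 2 * (M₂ + 2 * M₁ + M₀) * |ϑ - θ₀| * |ϑ - θ₀| := h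
    _ = 2 * (M₂ + 2 * M₁ + M₀) * |ϑ - θ₀| ^ 2 := by ring

end SectorBoxFinal

end BGM2003

end Literature.MathematicalPhysics.QuantumLattice.FermiRG


namespace Literature.MathematicalPhysics.QuantumLattice.FermiRG

namespace BGM2003

open Real Set

/-- **BGM 2003 Lemma 7.3 [lmA1.3] (A1.13)–(A1.14) — PROVED** (discharges the named fact
`lemma73_sectorBox`), following App. 7.1: write `p⃗ = u(θ,e)e⃗_r(θ) ∈ S_{h,ω}` with `θ` the
representative within `¾πγ^{h/2}` of `θ_{h,ω}` (support of `ζ_{h,ω}`); split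
`p⃗ - p⃗_F(θ_{h,ω}) = [q⃗(θ,e) - q⃗(θ,0)] + [p⃗_F(θ) - p⃗_F(θ_{h,ω})]`; the first term is radial of size
`≤ |e|/c₁ ≤ cγ^h` (Lemma 7.2 / (A1.10b)), the second is `O(θ - θ_{h,ω})` tangentially (A1.16) and
`O((θ - θ_{h,ω})²)` normally (A1.15, the first derivative `p⃗_F' = s'τ⃗ ⊥ n⃗`), by two mean-value steps
with the bounds on `u, u', u''`; for (A1.14), `∇ε(p⃗) ⊥ ∂_θq⃗(θ,e)` (A1.17) and
`s'(θ_{h,ω})τ⃗(θ_{h,ω}) - ∂_θq⃗(θ,e) = O(|θ - θ_{h,ω}| + |e|)` by the joint Lipschitz bounds of `u, u'`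
on the box `[-π,3π] × [-e₀,e₀]` (A1.18). [cite: BenfattoGiulianiMastropietro2003, §7.1 Lemma 7.3 (A1.13)–(A1.18) p.26 (L114–161)] -/
theorem lemma73_sectorBox_holds : lemma73_sectorBox := by
  intro ε μ e₀ u hD
  obtain ⟨c₁, c₂, hc₁, -, hrad⟩ := hD.radial
  obtain ⟨cu, hcu, hu⟩ := hD.u_pos
  have he₀ := hD.e₀_pos
  have h0 : |(0 : ℝ)| ≤ e₀ := by rw [abs_zero]; exact he₀.le
  -- bounds on `u, u', u''` at `e = 0` (continuous and `2π`-periodic)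
  obtain ⟨M₀, hM₀0, hM₀⟩ := periodic_bound (contDiff_slice hD h0).continuous (hD.periodic_u 0)
  have hper1 : Function.Periodic (fun θ => radiusDeriv u θ 0) (2 * π) := periodic_deriv (hD.periodic_u 0)
  obtain ⟨M₁, hM₁0, hM₁⟩ := periodic_bound (contDiff_radiusDeriv hD h0).continuous hper1
  have hper2 : Function.Periodic (fun θ => radiusDeriv₂ u θ 0) (2 * π) := periodic_deriv hper1
  have hcont2 : Continuous (fun θ => radiusDeriv₂ u θ 0) :=
    (contDiff_radiusDeriv hD h0).continuous_deriv (by simp)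
  obtain ⟨M₂, hM₂0, hM₂⟩ := periodic_bound hcont2 hper2
  -- joint bounds on the box
  obtain ⟨M, L, hM0, hL0, hJ⟩ := joint_bounds hD
  -- the constant
  have hC₁0 : 0 ≤ 2 * e₀ / c₁ + 2 * (M₂ + 2 * M₁ + M₀) * π ^ 2 := by positivity
  have hC₂0 : 0 ≤ 2 * e₀ / c₁ + 2 * (M₀ + M₁) * π := by positivity
  have hC₃0 : 0 ≤ M * (2 * (L + M)) * (π + e₀) / cu := by positivity
  refine ⟨(2 * e₀ / c₁ + 2 * (M₂ + 2 * M₁ + M₀) * π ^ 2) + (2 * e₀ / c₁ + 2 * (M₀ + M₁) * π) +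
    M * (2 * (L + M)) * (π + e₀) / cu + 1, by positivity, ?_⟩
  intro n ω hω p hp
  obtain ⟨θ, e, he, hζ, rfl⟩ := hp
  -- scales
  have h4pos : 0 < (4 : ℝ) ^ (-(n : ℤ)) := zpow_pos (by norm_num) _
  have h2pos : 0 < (2 : ℝ) ^ (-(n : ℤ)) := zpow_pos (by norm_num) _
  have h4le : (4 : ℝ) ^ (-(n : ℤ)) ≤ 1 := zpow_le_one_of_nonpos₀ (by norm_num) (by simp)
  have h2le : (2 : ℝ) ^ (-(n : ℤ)) ≤ 1 := zpow_le_one_of_nonpos₀ (by norm_num) (by simp)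
  have h42 : (4 : ℝ) ^ (-(n : ℤ)) = ((2 : ℝ) ^ (-(n : ℤ))) ^ 2 := by
    rw [← zpow_natCast, ← zpow_mul, show (4 : ℝ) = 2 ^ (2 : ℤ) by norm_num, ← zpow_mul]
    congr 1; ring
  have h4le2 : (4 : ℝ) ^ (-(n : ℤ)) ≤ (2 : ℝ) ^ (-(n : ℤ)) := by rw [h42]; nlinarith
  have he' : |e| ≤ e₀ := he.trans (by nlinarith)
  have hw : sectorWidth n = π * (2 : ℝ) ^ (-(n : ℤ)) := by
    rw [sectorWidth, zpow_neg, zpow_natCast, div_eq_mul_inv]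
  -- the centre `θ₀` and the representative angle `θs`
  set θ₀ := sectorCenter n ω with hθ₀
  have hθ₀nn : 0 ≤ θ₀ := by
    rw [hθ₀, sectorCenter]; exact mul_nonneg (by positivity) (sectorWidth_pos n).le
  have hθ₀le : θ₀ ≤ 2 * π := by
    rw [hθ₀, sectorCenter, ← sectorCount_mul_sectorWidth n]
    refine mul_le_mul_of_nonneg_right ?_ (sectorWidth_pos n).le
    have : (ω : ℝ) + 1 ≤ sectorCount n := by exact_mod_cast hω
    linarith
  obtain ⟨j, hj⟩ : ∃ j : ℤ, |θ - (((ω : ℤ) : ℝ) + 1 / 2) * sectorWidth n - 2 * π * j| <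
      3 * sectorWidth n / 4 := by
    by_contra hcon
    exact hζ (sectorWeightCirc_eq_zero fun j => not_lt.1 fun h => hcon ⟨j, h⟩)
  have hcast : (((ω : ℤ) : ℝ) + 1 / 2) * sectorWidth n = θ₀ := by rw [hθ₀, sectorCenter, Int.cast_natCast]
  rw [hcast] at hj
  set θs := θ - j * (2 * π) with hθs
  have hd : |θs - θ₀| < 3 * sectorWidth n / 4 := by
    have : θs - θ₀ = θ - θ₀ - 2 * π * j := by rw [hθs]; ring
    rw [this]; exact hj
  have hdπ : |θs - θ₀| ≤ 3 * π / 4 := by have := sectorWidth_le_pi n; linarith [hd.le]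
  have hd2 : |θs - θ₀| ≤ π * (2 : ℝ) ^ (-(n : ℤ)) := by
    rw [← hw]; linarith [hd.le, (sectorWidth_pos n).le]
  have hdnn : 0 ≤ |θs - θ₀| := abs_nonneg _
  have hθ₀K : θ₀ ∈ Icc (-π) (3 * π) := ⟨by linarith [pi_pos], by linarith [pi_pos]⟩
  have hθsK : θs ∈ Icc (-π) (3 * π) := by
    obtain ⟨h1, h2⟩ := abs_le.1 hdπ
    exact ⟨by linarith [pi_pos], by linarith [pi_pos]⟩
  -- the sector point in terms of `θs`
  have hp_eq : levelPoint u θ e = levelPoint u θs e := by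
    rw [levelPoint, levelPoint, hθs, (hD.periodic_u e).sub_int_mul_eq j, dir_sub_int_mul]
  -- the frame at `θ₀`
  have hu0 : 0 < u θ₀ 0 := lt_of_lt_of_le hcu (hu θ₀ 0 h0)
  have hs₀ : 0 < speed u θ₀ 0 := lt_of_lt_of_le hu0 (le_speed u θ₀ 0 hu0.le)
  have hs₀cu : cu ≤ speed u θ₀ 0 := (hu θ₀ 0 h0).trans (le_speed u θ₀ 0 hu0.le)
  have hn1 := norm_unitNormal_le hs₀
  have hτ1 := norm_unitTangent_le hs₀
  -- the two pieces of `p⃗ - p⃗_F(θ₀)`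
  set v := levelPoint u θs e - fermiPoint u θ₀ with hv
  have hsplit : v = (u θs e - u θs 0) • dir θs + (fermiPoint u θs - fermiPoint u θ₀) := by
    rw [hv, fermiPoint, fermiPoint, levelPoint, levelPoint, levelPoint, sub_smul]; abel
  have hradial : |u θs e - u θs 0| ≤ |e| / c₁ := radial_abs hD hc₁ hrad θs he'
  have hrad' : |u θs e - u θs 0| ≤ e₀ / c₁ * (4 : ℝ) ^ (-(n : ℤ)) := by
    refine hradial.trans ?_
    rw [div_mul_eq_mul_div]
    exact div_le_div_of_nonneg_right (by linarith) hc₁.le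
  obtain ⟨chord_t, -⟩ := fermi_chord_bounds hD hM₀ hM₁ hM₂ hM₀0 hM₁0 hM₂0 θ₀ hs₀ _ hτ1 θs
  obtain ⟨-, chord_n⟩ := fermi_chord_bounds hD hM₀ hM₁ hM₂ hM₀0 hM₁0 hM₂0 θ₀ hs₀ _ hn1 θs
  -- a pairing of `dir θs` with a unit-size vector is at most `2`
  have hpair : ∀ w : Fin 2 → ℝ, ‖w‖ ≤ 1 → |dir θs ⬝ᵥ w| ≤ 2 := fun w hw =>
    calc |dir θs ⬝ᵥ w| ≤ 2 * ‖dir θs‖ * ‖w‖ := abs_dotProduct_le _ _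
      _ ≤ 2 * 1 * 1 := by gcongr; exact norm_dir_le_one θs
      _ = 2 := by norm_num
  refine ⟨v ⬝ᵥ unitNormal u θ₀ 0, v ⬝ᵥ unitTangent u θ₀ 0, ?_, ?_, ?_, ?_⟩
  · -- (A1.13), the decomposition in the orthonormal frame
    rw [hp_eq, add_assoc, ← frame_decomp hs₀ v, hv]
    abel
  · -- |k₁| ≤ c γ^h
    have hk : v ⬝ᵥ unitNormal u θ₀ 0 = (u θs e - u θs 0) * (dir θs ⬝ᵥ unitNormal u θ₀ 0) +
        (fermiPoint u θs - fermiPoint u θ₀) ⬝ᵥ unitNormal u θ₀ 0 := by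
      rw [hsplit, add_dotProduct, smul_dotProduct, smul_eq_mul]
    rw [hk]
    have hA : |(u θs e - u θs 0) * (dir θs ⬝ᵥ unitNormal u θ₀ 0)| ≤ e₀ / c₁ * (4 : ℝ) ^ (-(n : ℤ)) * 2 := by
      rw [abs_mul]; exact mul_le_mul hrad' (hpair _ hn1) (abs_nonneg _) (by positivity)
    have hB : |(fermiPoint u θs - fermiPoint u θ₀) ⬝ᵥ unitNormal u θ₀ 0| ≤
        2 * (M₂ + 2 * M₁ + M₀) * (π ^ 2 * (4 : ℝ) ^ (-(n : ℤ))) := by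
      refine chord_n.trans (mul_le_mul_of_nonneg_left ?_ (by positivity))
      calc |θs - θ₀| ^ 2 ≤ (π * (2 : ℝ) ^ (-(n : ℤ))) ^ 2 := pow_le_pow_left₀ hdnn hd2 2
        _ = π ^ 2 * (4 : ℝ) ^ (-(n : ℤ)) := by rw [h42]; ring
    calc |(u θs e - u θs 0) * (dir θs ⬝ᵥ unitNormal u θ₀ 0) +
          (fermiPoint u θs - fermiPoint u θ₀) ⬝ᵥ unitNormal u θ₀ 0|
        ≤ e₀ / c₁ * (4 : ℝ) ^ (-(n : ℤ)) * 2 + 2 * (M₂ + 2 * M₁ + M₀) * (π ^ 2 * (4 : ℝ) ^ (-(n : ℤ))) :=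
          (abs_add_le _ _).trans (add_le_add hA hB)
      _ = (2 * e₀ / c₁ + 2 * (M₂ + 2 * M₁ + M₀) * π ^ 2) * (4 : ℝ) ^ (-(n : ℤ)) := by ring
      _ ≤ _ := mul_le_mul_of_nonneg_right (by linarith) h4pos.le
  · -- |k₂| ≤ c γ^{h/2}
    have hk : v ⬝ᵥ unitTangent u θ₀ 0 = (u θs e - u θs 0) * (dir θs ⬝ᵥ unitTangent u θ₀ 0) +
        (fermiPoint u θs - fermiPoint u θ₀) ⬝ᵥ unitTangent u θ₀ 0 := by
      rw [hsplit, add_dotProduct, smul_dotProduct, smul_eq_mul]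
    rw [hk]
    have hA : |(u θs e - u θs 0) * (dir θs ⬝ᵥ unitTangent u θ₀ 0)| ≤ e₀ / c₁ * (4 : ℝ) ^ (-(n : ℤ)) * 2 := by
      rw [abs_mul]; exact mul_le_mul hrad' (hpair _ hτ1) (abs_nonneg _) (by positivity)
    have hB : |(fermiPoint u θs - fermiPoint u θ₀) ⬝ᵥ unitTangent u θ₀ 0| ≤
        2 * (M₀ + M₁) * (π * (2 : ℝ) ^ (-(n : ℤ))) :=
      chord_t.trans (mul_le_mul_of_nonneg_left hd2 (by positivity))
    calc |(u θs e - u θs 0) * (dir θs ⬝ᵥ unitTangent u θ₀ 0) +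
          (fermiPoint u θs - fermiPoint u θ₀) ⬝ᵥ unitTangent u θ₀ 0|
        ≤ e₀ / c₁ * (4 : ℝ) ^ (-(n : ℤ)) * 2 + 2 * (M₀ + M₁) * (π * (2 : ℝ) ^ (-(n : ℤ))) :=
          (abs_add_le _ _).trans (add_le_add hA hB)
      _ ≤ e₀ / c₁ * (2 : ℝ) ^ (-(n : ℤ)) * 2 + 2 * (M₀ + M₁) * (π * (2 : ℝ) ^ (-(n : ℤ))) := by
          gcongr
      _ = (2 * e₀ / c₁ + 2 * (M₀ + M₁) * π) * (2 : ℝ) ^ (-(n : ℤ)) := by ring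
      _ ≤ _ := mul_le_mul_of_nonneg_right (by linarith) h2pos.le
  · -- (A1.14): the derivative along `τ⃗(θ₀)` at `p⃗`
    rw [hp_eq]
    have htan := fderiv_levelPoint_tangential hD he' θs
    set Dε := fderiv ℝ ε (levelPoint u θs e) with hDε
    set v₀ := radiusDeriv u θ₀ 0 • dir θ₀ + u θ₀ 0 • tdir θ₀ with hv₀
    set vs := radiusDeriv u θs e • dir θs + u θs e • tdir θs with hvs
    have hτ : unitTangent u θ₀ 0 = (speed u θ₀ 0)⁻¹ • v₀ := rfl
    have hlin : Dε (unitTangent u θ₀ 0) = (speed u θ₀ 0)⁻¹ * Dε (v₀ - vs) := by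
      rw [hτ, map_smul, map_sub, htan, sub_zero, smul_eq_mul]
    -- size of `v₀ - vs`
    have hdiff : v₀ - vs = (radiusDeriv u θ₀ 0 - radiusDeriv u θs e) • dir θ₀ +
        radiusDeriv u θs e • (dir θ₀ - dir θs) + (u θ₀ 0 - u θs e) • tdir θ₀ +
        u θs e • (tdir θ₀ - tdir θs) := by
      rw [hv₀, hvs]; simp only [sub_smul, smul_sub]; abel
    obtain ⟨huM, hu'M, hDM, -, -⟩ := hJ θs θs e e hθsK hθsK he' he'
    obtain ⟨-, -, -, hlipu, hlipu'⟩ := hJ θs θ₀ e 0 hθsK hθ₀K he' h0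
    have hde : |θ₀ - θs| + |0 - e| = |θs - θ₀| + |e| := by rw [abs_sub_comm, zero_sub, abs_neg]
    rw [hde] at hlipu hlipu'
    have hnorm : ‖v₀ - vs‖ ≤ 2 * (L + M) * (|θs - θ₀| + |e|) := by
      rw [hdiff]
      have t1 : ‖(radiusDeriv u θ₀ 0 - radiusDeriv u θs e) • dir θ₀‖ ≤ L * (|θs - θ₀| + |e|) := by
        rw [norm_smul, Real.norm_eq_abs]
        calc |radiusDeriv u θ₀ 0 - radiusDeriv u θs e| * ‖dir θ₀‖
            ≤ L * (|θs - θ₀| + |e|) * 1 := mul_le_mul hlipu' (norm_dir_le_one θ₀) (norm_nonneg _) (by positivity)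
          _ = L * (|θs - θ₀| + |e|) := mul_one _
      have t2 : ‖radiusDeriv u θs e • (dir θ₀ - dir θs)‖ ≤ M * |θs - θ₀| := by
        rw [norm_smul, Real.norm_eq_abs]
        calc |radiusDeriv u θs e| * ‖dir θ₀ - dir θs‖ ≤ M * |θ₀ - θs| :=
              mul_le_mul hu'M (norm_dir_sub_le θ₀ θs) (norm_nonneg _) hM0
          _ = M * |θs - θ₀| := by rw [abs_sub_comm]
      have t3 : ‖(u θ₀ 0 - u θs e) • tdir θ₀‖ ≤ L * (|θs - θ₀| + |e|) := by
        rw [norm_smul, Real.norm_eq_abs]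
        calc |u θ₀ 0 - u θs e| * ‖tdir θ₀‖
            ≤ L * (|θs - θ₀| + |e|) * 1 := mul_le_mul hlipu (norm_tdir_le_one θ₀) (norm_nonneg _) (by positivity)
          _ = L * (|θs - θ₀| + |e|) := mul_one _
      have t4 : ‖u θs e • (tdir θ₀ - tdir θs)‖ ≤ M * |θs - θ₀| := by
        rw [norm_smul, Real.norm_eq_abs]
        calc |u θs e| * ‖tdir θ₀ - tdir θs‖ ≤ M * |θ₀ - θs| :=
              mul_le_mul huM (norm_tdir_sub_le θ₀ θs) (norm_nonneg _) hM0
          _ = M * |θs - θ₀| := by rw [abs_sub_comm]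
      have he0 : 0 ≤ |e| := abs_nonneg e
      calc ‖(radiusDeriv u θ₀ 0 - radiusDeriv u θs e) • dir θ₀ + radiusDeriv u θs e • (dir θ₀ - dir θs) +
            (u θ₀ 0 - u θs e) • tdir θ₀ + u θs e • (tdir θ₀ - tdir θs)‖
          ≤ L * (|θs - θ₀| + |e|) + M * |θs - θ₀| + L * (|θs - θ₀| + |e|) + M * |θs - θ₀| :=
            norm_add_le_of_le (norm_add_le_of_le (norm_add_le_of_le t1 t2) t3) t4
        _ ≤ 2 * (L + M) * (|θs - θ₀| + |e|) := by linarith [mul_nonneg hM0 (abs_nonneg e)]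
    -- assemble
    have hsmall : |θs - θ₀| + |e| ≤ (π + e₀) * (2 : ℝ) ^ (-(n : ℤ)) := by
      have : |e| ≤ e₀ * (2 : ℝ) ^ (-(n : ℤ)) := he.trans (by rw [mul_comm]; exact mul_le_mul_of_nonneg_left h4le2 he₀.le)
      linarith [hd2, this]
    have hop : |Dε (v₀ - vs)| ≤ M * (2 * (L + M) * ((π + e₀) * (2 : ℝ) ^ (-(n : ℤ)))) := by
      calc |Dε (v₀ - vs)| = ‖Dε (v₀ - vs)‖ := (Real.norm_eq_abs _).symm
        _ ≤ ‖Dε‖ * ‖v₀ - vs‖ := Dε.le_opNorm _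
        _ ≤ M * (2 * (L + M) * (|θs - θ₀| + |e|)) := mul_le_mul hDM hnorm (norm_nonneg _) hM0
        _ ≤ M * (2 * (L + M) * ((π + e₀) * (2 : ℝ) ^ (-(n : ℤ)))) := by gcongr
    rw [hlin, abs_mul, abs_inv, abs_of_pos hs₀]
    calc (speed u θ₀ 0)⁻¹ * |Dε (v₀ - vs)|
        ≤ cu⁻¹ * (M * (2 * (L + M) * ((π + e₀) * (2 : ℝ) ^ (-(n : ℤ))))) :=
          mul_le_mul ((inv_le_inv₀ hs₀ hcu).2 hs₀cu) hop (abs_nonneg _) (by positivity)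
      _ = M * (2 * (L + M)) * (π + e₀) / cu * (2 : ℝ) ^ (-(n : ℤ)) := by ring
      _ ≤ _ := mul_le_mul_of_nonneg_right (by linarith) h2pos.le

end BGM2003

end Literature.MathematicalPhysics.QuantumLattice.FermiRG


/-! ### Lemma 7.1 discharged (proof of `lemma71_normalAngle`) -/

namespace Literature.MathematicalPhysics.QuantumLattice.FermiRG

namespace BGM2003

open Real Set

section NormalAngleProof

variable {ε : (Fin 2 → ℝ) → ℝ} {μ e₀ : ℝ} {u : ℝ → ℝ → ℝ}

/-! #### Torus-distance bookkeeping -/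

/-- `‖θ‖_{𝕋¹} ≤ π`. [folklore] -/
private theorem torusDist_le_pi (x : ℝ) : torusDist x ≤ π := by
  have h := AddCircle.norm_le_half_period (2 * π) (x := ((x : ℝ) : AddCircle (2 * π))) two_pi_pos.ne'
  rw [abs_of_pos two_pi_pos] at h
  unfold torusDist
  linarith

/-- `‖θ‖_{𝕋¹} = |θ|` when `|θ| ≤ π`. [folklore] -/
private theorem torusDist_eq_abs {x : ℝ} (hx : |x| ≤ π) : torusDist x = |x| := by
  rw [torusDist, AddCircle.norm_coe_eq_abs_iff (2 * π) two_pi_pos.ne', abs_of_pos two_pi_pos]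
  linarith

/-- `‖θ + 2πk‖_{𝕋¹} = ‖θ‖_{𝕋¹}`. [folklore] -/
private theorem torusDist_add_int_mul (x : ℝ) (k : ℤ) : torusDist (x + k * (2 * π)) = torusDist x := by
  unfold torusDist
  have h : ((x + k * (2 * π) : ℝ) : AddCircle (2 * π)) = ((x : ℝ) : AddCircle (2 * π)) := by
    rw [← sub_eq_zero, ← AddCircle.coe_sub, AddCircle.coe_eq_zero_iff]
    exact ⟨k, by rw [zsmul_eq_mul]; ring⟩
  rw [h]

/-- The representative of `θ` in `[-π, π]` modulo `2π`: `‖θ‖_{𝕋¹} = |θ - 2πk|` with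
`k = round(θ/2π)`. [folklore] -/
private theorem torusDist_eq_abs_sub_round (x : ℝ) :
    torusDist x = |x - round ((2 * π)⁻¹ * x) * (2 * π)| := by
  rw [torusDist, AddCircle.norm_eq]

/-- Reduction of an angle into `[0, 2π) ⊆ [-π, 3π]`. [folklore] -/
private theorem angle_reduce (θ : ℝ) : ∃ k : ℤ, θ - k * (2 * π) ∈ Icc (-π) (3 * π) := by
  refine ⟨toIcoDiv two_pi_pos 0 θ, ?_⟩
  have h := toIcoMod_mem_Ico two_pi_pos 0 θ
  rw [← self_sub_toIcoDiv_zsmul, zsmul_eq_mul, zero_add] at h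
  exact ⟨by linarith [h.1, pi_pos], by linarith [h.2, pi_pos]⟩

/-! #### A uniform bound on `u''` and uniform bounds for all angles -/

/-- On the compact box `[-π, 3π] × [-e₀, e₀]` the second `θ`-derivative `u''` of the smooth polar
radius is bounded (joint continuity of the second partial derivative). [folklore] -/
private theorem joint_bound_radiusDeriv₂ (hD : DispersionHyp ε μ e₀ u) :
    ∃ M₂ : ℝ, 0 ≤ M₂ ∧ ∀ θ e : ℝ, θ ∈ Icc (-π) (3 * π) → |e| ≤ e₀ → |radiusDeriv₂ u θ e| ≤ M₂ := by
  obtain ⟨e₁, he₁, hsm⟩ := hD.smooth_u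
  set O : Set (ℝ × ℝ) := univ ×ˢ Ioo (-e₁) e₁ with hO
  have hOo : IsOpen O := isOpen_univ.prod isOpen_Ioo
  set K : Set (ℝ × ℝ) := Icc (-π) (3 * π) ×ˢ Icc (-e₀) e₀ with hK
  have hKc : IsCompact K := isCompact_Icc.prod isCompact_Icc
  have hKO : K ⊆ O := fun q hq => ⟨mem_univ _, ⟨by linarith [hq.2.1], by linarith [hq.2.2]⟩⟩
  set Φ : ℝ × ℝ → ℝ := Function.uncurry u with hΦ
  set Φ₁ : ℝ × ℝ → ℝ := fun q => fderiv ℝ Φ q (1, 0) with hΦ₁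
  set Φ₂ : ℝ × ℝ → ℝ := fun q => fderiv ℝ Φ₁ q (1, 0) with hΦ₂
  have hΦ₁smooth : ContDiffOn ℝ ((⊤ : ℕ∞) : WithTop ℕ∞) Φ₁ O :=
    (hsm.fderiv_of_isOpen hOo (m := ((⊤ : ℕ∞) : WithTop ℕ∞)) (by simp)).clm_apply contDiffOn_const
  have hΦ₂smooth : ContDiffOn ℝ ((⊤ : ℕ∞) : WithTop ℕ∞) Φ₂ O :=
    (hΦ₁smooth.fderiv_of_isOpen hOo (m := ((⊤ : ℕ∞) : WithTop ℕ∞)) (by simp)).clm_apply contDiffOn_const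
  have hΦdiff : ∀ q ∈ O, DifferentiableAt ℝ Φ q := fun q hq =>
    (hsm.differentiableOn (by simp)).differentiableAt (hOo.mem_nhds hq)
  have hΦ₁diff : ∀ q ∈ O, DifferentiableAt ℝ Φ₁ q := fun q hq =>
    (hΦ₁smooth.differentiableOn (by simp)).differentiableAt (hOo.mem_nhds hq)
  -- `Φ₁` is the partial derivative `u'` on `O`
  have hΦ₁eq : ∀ q ∈ O, Φ₁ q = radiusDeriv u q.1 q.2 := by
    intro q hq
    have hline : HasDerivAt (fun ϑ : ℝ => (ϑ, q.2)) ((1 : ℝ), (0 : ℝ)) q.1 :=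
      (hasDerivAt_id q.1).prodMk (hasDerivAt_const q.1 q.2)
    have hcomp := (hΦdiff q hq).hasFDerivAt.comp_hasDerivAt q.1 hline
    change fderiv ℝ Φ q (1, 0) = deriv (fun ϑ => u ϑ q.2) q.1
    rw [← hcomp.deriv]
    rfl
  -- `Φ₂` is the second partial derivative `u''` on `O`
  have hΦ₂eq : ∀ q ∈ O, Φ₂ q = radiusDeriv₂ u q.1 q.2 := by
    intro q hq
    have hline : HasDerivAt (fun ϑ : ℝ => (ϑ, q.2)) ((1 : ℝ), (0 : ℝ)) q.1 :=
      (hasDerivAt_id q.1).prodMk (hasDerivAt_const q.1 q.2)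
    have hcomp := (hΦ₁diff q hq).hasFDerivAt.comp_hasDerivAt q.1 hline
    have hslice : (fun ϑ : ℝ => radiusDeriv u ϑ q.2) = fun ϑ => Φ₁ (ϑ, q.2) := by
      funext ϑ
      exact (hΦ₁eq (ϑ, q.2) ⟨mem_univ _, hq.2⟩).symm
    change fderiv ℝ Φ₁ q (1, 0) = deriv (fun ϑ => radiusDeriv u ϑ q.2) q.1
    rw [hslice, ← hcomp.deriv]
    rfl
  obtain ⟨M₂, hM₂⟩ := hKc.exists_bound_of_continuousOn (hΦ₂smooth.continuousOn.mono hKO)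
  refine ⟨max M₂ 0, le_max_right _ _, fun θ e hθ he => ?_⟩
  have hq : (θ, e) ∈ K := ⟨hθ, abs_le.1 he⟩
  have h := hM₂ _ hq
  rw [hΦ₂eq _ (hKO hq), Real.norm_eq_abs] at h
  exact h.trans (le_max_left _ _)

/-- Uniform bounds `|u|, |u'|, |u''| ≤ M` for ALL angles `θ` and `|e| ≤ e₀` (the box bounds transported
by `2π`-periodicity in `θ`). [folklore] -/
private theorem uniform_bounds (hD : DispersionHyp ε μ e₀ u) :
    ∃ M : ℝ, 0 ≤ M ∧ ∀ θ e : ℝ, |e| ≤ e₀ →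
      |u θ e| ≤ M ∧ |radiusDeriv u θ e| ≤ M ∧ |radiusDeriv₂ u θ e| ≤ M := by
  obtain ⟨M, L, hM0, -, hJ⟩ := joint_bounds hD
  obtain ⟨M₂, -, hJ₂⟩ := joint_bound_radiusDeriv₂ hD
  refine ⟨max M M₂, le_max_of_le_left hM0, fun θ e he => ?_⟩
  obtain ⟨k, hk⟩ := angle_reduce θ
  have hper0 : Function.Periodic (fun ϑ => u ϑ e) (2 * π) := hD.periodic_u e
  have hper1 : Function.Periodic (fun ϑ => radiusDeriv u ϑ e) (2 * π) := periodic_deriv hper0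
  have hper2 : Function.Periodic (fun ϑ => radiusDeriv₂ u ϑ e) (2 * π) := periodic_deriv hper1
  have e0 : u (θ - k * (2 * π)) e = u θ e := hper0.sub_int_mul_eq k
  have e1 : radiusDeriv u (θ - k * (2 * π)) e = radiusDeriv u θ e := hper1.sub_int_mul_eq k
  have e2 : radiusDeriv₂ u (θ - k * (2 * π)) e = radiusDeriv₂ u θ e := hper2.sub_int_mul_eq k
  obtain ⟨h0, h1, -, -, -⟩ := hJ _ _ e e hk hk he he
  have h2 := hJ₂ _ e hk he
  rw [e0] at h0
  rw [e1] at h1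
  rw [e2] at h2
  exact ⟨h0.trans (le_max_left _ _), h1.trans (le_max_left _ _), h2.trans (le_max_right _ _)⟩

/-! #### The derivative of the normal angle: `α' = s'/r` (A1.10) -/

/-- `u'(θ + π, e) = u'(θ, e)` (from (A1.4) `u(θ+π,e) = u(θ,e)`). [cite: BenfattoGiulianiMastropietro2003, §7.1 (A1.4) p.26 (L24–28)] -/
private theorem radiusDeriv_add_pi (hD : DispersionHyp ε μ e₀ u) {e : ℝ} (he : |e| ≤ e₀) (θ : ℝ) :
    radiusDeriv u (θ + π) e = radiusDeriv u θ e := by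
  have h : (fun ϑ => u (ϑ + π) e) = fun ϑ => u ϑ e := funext fun ϑ => hD.antipodal ϑ e he
  unfold radiusDeriv
  rw [← deriv_comp_add_const (fun ϑ => u ϑ e) π θ]
  show deriv (fun ϑ => u (ϑ + π) e) θ = deriv (fun ϑ => u ϑ e) θ
  rw [h]

/-- **(A1.10), the derivative of the normal angle**: `dα/dθ = 1 - (u''u - u'²)/(u² + u'²)
= (u² + 2u'² - u u'')/s'²` (`= s'(θ,e)/r(θ,e)`). [cite: BenfattoGiulianiMastropietro2003, §7.1 Lemma 7.1 proof (A1.10) p.26 (L64–70)] -/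
private theorem hasDerivAt_normalAngle (hD : DispersionHyp ε μ e₀ u) {e : ℝ} (he : |e| ≤ e₀) (θ : ℝ)
    (hu : 0 < u θ e) :
    HasDerivAt (fun ϑ => normalAngle u ϑ e)
      ((u θ e ^ 2 + 2 * radiusDeriv u θ e ^ 2 - u θ e * radiusDeriv₂ u θ e) /
        (radiusDeriv u θ e ^ 2 + u θ e ^ 2)) θ := by
  have hf : HasDerivAt (fun ϑ => radiusDeriv u ϑ e / u ϑ e)
      ((radiusDeriv₂ u θ e * u θ e - radiusDeriv u θ e * radiusDeriv u θ e) / u θ e ^ 2) θ :=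
    (hasDerivAt_radiusDeriv hD he θ).div (hasDerivAt_u hD he θ) hu.ne'
  have hα : HasDerivAt (fun ϑ => normalAngle u ϑ e)
      (1 - 1 / (1 + (radiusDeriv u θ e / u θ e) ^ 2) *
        ((radiusDeriv₂ u θ e * u θ e - radiusDeriv u θ e * radiusDeriv u θ e) / u θ e ^ 2)) θ := by
    unfold normalAngle
    exact (hasDerivAt_id θ).sub hf.arctan
  convert hα using 1
  have hu' : u θ e ≠ 0 := hu.ne'
  have h1 : radiusDeriv u θ e ^ 2 + u θ e ^ 2 ≠ 0 := by positivity
  field_simp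
  ring

/-- Two-sided slope bounds for the normal angle at fixed `e`: with `c₁ = c·c_u` (convexity constant
times the lower bound of `u`) and `c₂ = 2 + M²/c_u²`,
`c₁ (y - x) ≤ α(y,e) - α(x,e) ≤ c₂ (y - x)` for `x ≤ y` — the integrated form of
`c₁ ≤ α' = s'/r ≤ c₂`. [cite: BenfattoGiulianiMastropietro2003, §7.1 Lemma 7.1 proof (A1.10) p.26 (L64–74)] -/
private theorem normalAngle_slope (hD : DispersionHyp ε μ e₀ u) {cu cκ M : ℝ} (hcu : 0 < cu)
    (hu : ∀ θ e : ℝ, |e| ≤ e₀ → cu ≤ u θ e) (hcκ : 0 < cκ)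
    (hκ : ∀ θ e : ℝ, |e| ≤ e₀ → cκ ≤ curvature u θ e) (hM0 : 0 ≤ M)
    (hM : ∀ θ e : ℝ, |e| ≤ e₀ → |u θ e| ≤ M ∧ |radiusDeriv u θ e| ≤ M ∧ |radiusDeriv₂ u θ e| ≤ M)
    {e : ℝ} (he : |e| ≤ e₀) {x y : ℝ} (hxy : x ≤ y) :
    cκ * cu * (y - x) ≤ normalAngle u y e - normalAngle u x e ∧
      normalAngle u y e - normalAngle u x e ≤ (2 + M ^ 2 / cu ^ 2) * (y - x) := by
  set d : ℝ → ℝ := fun θ => (u θ e ^ 2 + 2 * radiusDeriv u θ e ^ 2 - u θ e * radiusDeriv₂ u θ e) /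
    (radiusDeriv u θ e ^ 2 + u θ e ^ 2) with hd
  have hder : ∀ θ, HasDerivAt (fun ϑ => normalAngle u ϑ e) (d θ) θ := fun θ =>
    hasDerivAt_normalAngle hD he θ (lt_of_lt_of_le hcu (hu θ e he))
  have hdiff : Differentiable ℝ (fun ϑ => normalAngle u ϑ e) := fun θ => (hder θ).differentiableAt
  have hderiv_eq : ∀ θ, deriv (fun ϑ => normalAngle u ϑ e) θ = d θ := fun θ => (hder θ).deriv
  have hlo : ∀ θ, cκ * cu ≤ d θ := by
    intro θ
    have hupos : 0 < u θ e := lt_of_lt_of_le hcu (hu θ e he)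
    have hs : 0 < speed u θ e := lt_of_lt_of_le hupos (le_speed u θ e hupos.le)
    have hs' : speed u θ e ≠ 0 := hs.ne'
    have hds : d θ = curvature u θ e * speed u θ e := by
      simp only [hd, curvature]
      rw [← speed_sq_sec]
      field_simp
    rw [hds]
    exact mul_le_mul (hκ θ e he) ((hu θ e he).trans (le_speed u θ e hupos.le)) hcu.le
      (hcκ.le.trans (hκ θ e he))
  have hhi : ∀ θ, d θ ≤ 2 + M ^ 2 / cu ^ 2 := by
    intro θ
    obtain ⟨h0, -, h2⟩ := hM θ e he
    have hs2 : cu ^ 2 ≤ radiusDeriv u θ e ^ 2 + u θ e ^ 2 := by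
      have : cu ^ 2 ≤ u θ e ^ 2 := pow_le_pow_left₀ hcu.le (hu θ e he) 2
      nlinarith
    have hs2pos : 0 < radiusDeriv u θ e ^ 2 + u θ e ^ 2 := lt_of_lt_of_le (by positivity) hs2
    have hprod : -(u θ e * radiusDeriv₂ u θ e) ≤ M ^ 2 := by
      have h3 : |u θ e * radiusDeriv₂ u θ e| ≤ M * M := by
        rw [abs_mul]; exact mul_le_mul h0 h2 (abs_nonneg _) hM0
      have h4 := neg_abs_le (u θ e * radiusDeriv₂ u θ e)
      nlinarith
    have hM2 : M ^ 2 ≤ M ^ 2 / cu ^ 2 * (radiusDeriv u θ e ^ 2 + u θ e ^ 2) := by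
      have hcu2 : 0 < cu ^ 2 := by positivity
      calc M ^ 2 = M ^ 2 / cu ^ 2 * cu ^ 2 := by field_simp
        _ ≤ M ^ 2 / cu ^ 2 * (radiusDeriv u θ e ^ 2 + u θ e ^ 2) := by gcongr
    simp only [hd]
    rw [div_le_iff₀ hs2pos]
    nlinarith [sq_nonneg (u θ e), sq_nonneg (radiusDeriv u θ e)]
  constructor
  · exact mul_sub_le_image_sub_of_le_deriv hdiff (fun θ => by rw [hderiv_eq]; exact hlo θ) hxy
  · exact image_sub_le_mul_sub_of_deriv_le hdiff (fun θ => by rw [hderiv_eq]; exact hhi θ) hxy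

end NormalAngleProof

/-- **BGM 2003 Lemma 7.1 [lmA1.1] (A1.9) — PROVED** (discharges the named fact `lemma71_normalAngle`),
following App. 7.1: by (A1.6)/(A1.7) the normal angle `α(θ,e) = θ - arctan(u'/u)` has
`dα/dθ = s'(θ,e)/r(θ,e)` (A1.10), which is `≥ c₁ := c·c_u > 0` by the convexity condition (2.8a)
and `u ≥ c_u`, and `≤ c₂` by the uniform bounds on `u, u', u''` over `𝕋¹ × [-e₀, e₀]`; hence `α` is
increasing with `c₁(θ₂ - θ₁) ≤ α₂ - α₁ ≤ c₂(θ₂ - θ₁)`. The identity `α(θ+π,e) - α(θ,e) = π` is (A1.4).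
For the distances on `𝕋¹`: reduce `θ₂ - θ₁` to its representative `d̃ ∈ [-π, π]` (`α(θ + 2πk) =
α(θ) + 2πk` by periodicity); then `|α(θ₁ + d̃) - α(θ₁)| ≤ α(θ₁ + π) - α(θ₁) = π` by monotonicity, so
its torus norm is its absolute value, which lies between `c₁|d̃|` and `c₂|d̃|`. [cite: BenfattoGiulianiMastropietro2003, §7.1 Lemma 7.1 (A1.9)–(A1.10) p.26 (L54–74)] -/
theorem lemma71_normalAngle_holds : lemma71_normalAngle := by
  intro ε μ e₀ u hD
  obtain ⟨cu, hcu, hu⟩ := hD.u_pos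
  obtain ⟨cκ, hcκ, hκ⟩ := hD.convex
  obtain ⟨M, hM0, hM⟩ := uniform_bounds hD
  refine ⟨cκ * cu, max (cκ * cu) (2 + M ^ 2 / cu ^ 2), by positivity, le_max_left _ _,
    fun e he => ?_⟩
  have slope : ∀ x y : ℝ, x ≤ y →
      cκ * cu * (y - x) ≤ normalAngle u y e - normalAngle u x e ∧
        normalAngle u y e - normalAngle u x e ≤ (2 + M ^ 2 / cu ^ 2) * (y - x) :=
    fun x y hxy => normalAngle_slope hD hcu hu hcκ hκ hM0 hM he hxy
  have hc₁ : 0 < cκ * cu := by positivity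
  have hmono : Monotone (fun θ => normalAngle u θ e) := by
    intro x y hxy
    have h := (slope x y hxy).1
    have h' : 0 ≤ cκ * cu * (y - x) := mul_nonneg hc₁.le (by linarith)
    show normalAngle u x e ≤ normalAngle u y e
    linarith
  have hpi : ∀ θ : ℝ, normalAngle u (θ + π) e - normalAngle u θ e = π := by
    intro θ
    unfold normalAngle
    rw [hD.antipodal θ e he, radiusDeriv_add_pi hD he θ]
    ring
  have h2pi : ∀ (θ : ℝ) (k : ℤ),
      normalAngle u (θ + k * (2 * π)) e = normalAngle u θ e + k * (2 * π) := by
    intro θ k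
    have h0 : u (θ + k * (2 * π)) e = u θ e := ((hD.periodic_u e).int_mul k) θ
    have h1 : radiusDeriv u (θ + k * (2 * π)) e = radiusDeriv u θ e :=
      ((periodic_deriv (hD.periodic_u e)).int_mul k) θ
    unfold normalAngle
    rw [h0, h1]
    ring
  refine ⟨hmono, fun θ₁ θ₂ => ?_, hpi⟩
  -- reduce `θ₂ - θ₁` to its representative `d̃ ∈ [-π, π]`
  obtain ⟨k, hk⟩ : ∃ k : ℤ, torusDist (θ₂ - θ₁) = |θ₂ - θ₁ - k * (2 * π)| :=
    ⟨round ((2 * π)⁻¹ * (θ₂ - θ₁)), torusDist_eq_abs_sub_round _⟩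
  set dt : ℝ := θ₂ - θ₁ - k * (2 * π) with hdt
  have hdtπ : |dt| ≤ π := by rw [← hk]; exact torusDist_le_pi _
  set θ₂' := θ₁ + dt with hθ₂'
  have hα₂' : normalAngle u θ₂' e = normalAngle u θ₂ e + ((-k : ℤ) : ℝ) * (2 * π) := by
    have hθ : θ₂' = θ₂ + ((-k : ℤ) : ℝ) * (2 * π) := by rw [hθ₂', hdt]; push_cast; ring
    rw [hθ]
    exact h2pi θ₂ (-k)
  have hTα : torusDist (normalAngle u θ₂ e - normalAngle u θ₁ e) =
      torusDist (normalAngle u θ₂' e - normalAngle u θ₁ e) := by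
    rw [hα₂']
    have : normalAngle u θ₂ e + ((-k : ℤ) : ℝ) * (2 * π) - normalAngle u θ₁ e =
        (normalAngle u θ₂ e - normalAngle u θ₁ e) + ((-k : ℤ) : ℝ) * (2 * π) := by ring
    rw [this, torusDist_add_int_mul]
  rw [hk, hTα]
  have hsub : θ₂' - θ₁ = dt := by rw [hθ₂']; ring
  rcases le_or_gt 0 dt with hnn | hneg
  · -- `0 ≤ d̃ ≤ π`
    have hxy : θ₁ ≤ θ₂' := by rw [hθ₂']; linarith
    obtain ⟨hlo, hhi⟩ := slope θ₁ θ₂' hxy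
    rw [hsub] at hlo hhi
    have hΔle : normalAngle u θ₂' e - normalAngle u θ₁ e ≤ π := by
      have hle : θ₂' ≤ θ₁ + π := by rw [hθ₂']; linarith [(abs_le.1 hdtπ).2]
      have hm : normalAngle u θ₂' e ≤ normalAngle u (θ₁ + π) e := hmono hle
      linarith [hpi θ₁]
    have hΔnn : 0 ≤ normalAngle u θ₂' e - normalAngle u θ₁ e := by
      have : 0 ≤ cκ * cu * dt := mul_nonneg hc₁.le hnn
      linarith
    have habs : |normalAngle u θ₂' e - normalAngle u θ₁ e| ≤ π := by
      rw [abs_of_nonneg hΔnn]; exact hΔle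
    rw [torusDist_eq_abs habs, abs_of_nonneg hΔnn, abs_of_nonneg hnn]
    exact ⟨hlo, hhi.trans (mul_le_mul_of_nonneg_right (le_max_right _ _) hnn)⟩
  · -- `-π ≤ d̃ < 0`
    have hxy : θ₂' ≤ θ₁ := by rw [hθ₂']; linarith
    obtain ⟨hlo, hhi⟩ := slope θ₂' θ₁ hxy
    have hsub' : θ₁ - θ₂' = -dt := by rw [hθ₂']; ring
    rw [hsub'] at hlo hhi
    have hΔle : normalAngle u θ₁ e - normalAngle u θ₂' e ≤ π := by
      have hle : θ₁ ≤ θ₂' + π := by rw [hθ₂']; linarith [(abs_le.1 hdtπ).1]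
      have hm : normalAngle u θ₁ e ≤ normalAngle u (θ₂' + π) e := hmono hle
      linarith [hpi θ₂']
    have hΔnn : 0 ≤ normalAngle u θ₁ e - normalAngle u θ₂' e := by
      have : 0 ≤ cκ * cu * (-dt) := mul_nonneg hc₁.le (by linarith)
      linarith
    have habs : |normalAngle u θ₂' e - normalAngle u θ₁ e| ≤ π := by
      rw [abs_sub_comm, abs_of_nonneg hΔnn]; exact hΔle
    rw [torusDist_eq_abs habs, abs_sub_comm (normalAngle u θ₂' e) (normalAngle u θ₁ e),
      abs_of_nonneg hΔnn, abs_of_neg hneg]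
    exact ⟨hlo, hhi.trans (mul_le_mul_of_nonneg_right (le_max_right _ _) (by linarith))⟩

end BGM2003

end Literature.MathematicalPhysics.QuantumLattice.FermiRG


/-! ### Lemma 7.4 discharged (proof of `lemma74_projection`) -/

namespace Literature.MathematicalPhysics.QuantumLattice.FermiRG

namespace BGM2003

open Real Set

section ProjectionProof

variable {ε : (Fin 2 → ℝ) → ℝ} {μ e₀ : ℝ} {u : ℝ → ℝ → ℝ}

/-! #### The frame in terms of the normal angle: `n⃗ = (cos α, sin α)`, `τ⃗ = (-sin α, cos α)` -/

/-- `cos(arctan(b/a)) = a/√(b² + a²)` and `sin(arctan(b/a)) = b/√(b² + a²)` for `a > 0`. [folklore] -/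
private theorem cos_sin_arctan_ratio {a b : ℝ} (ha : 0 < a) :
    Real.cos (Real.arctan (b / a)) = a / Real.sqrt (b ^ 2 + a ^ 2) ∧
      Real.sin (Real.arctan (b / a)) = b / Real.sqrt (b ^ 2 + a ^ 2) := by
  have hsq : Real.sqrt (1 + (b / a) ^ 2) = Real.sqrt (b ^ 2 + a ^ 2) / a := by
    rw [show 1 + (b / a) ^ 2 = (b ^ 2 + a ^ 2) / a ^ 2 by field_simp; ring,
      Real.sqrt_div (by positivity), Real.sqrt_sq ha.le]
  have hpos : 0 < Real.sqrt (b ^ 2 + a ^ 2) := Real.sqrt_pos.2 (by positivity)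
  rw [Real.cos_arctan, Real.sin_arctan, hsq]
  constructor
  · field_simp
  · field_simp

/-- `n⃗(θ,e) = (cos α(θ,e), sin α(θ,e))` (`u > 0`). [cite: BenfattoGiulianiMastropietro2003, §7.1 Lemma 7.1 p.26 (L54–58)] -/
private theorem unitNormal_angle {θ e : ℝ} (hu : 0 < u θ e) :
    unitNormal u θ e = ![Real.cos (normalAngle u θ e), Real.sin (normalAngle u θ e)] := by
  obtain ⟨hc, hs⟩ := cos_sin_arctan_ratio (b := radiusDeriv u θ e) hu
  rw [unitNormal_eq, normalAngle, Real.cos_sub, Real.sin_sub, hc, hs, speed]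
  ext i; fin_cases i <;> simp <;> ring

/-- `τ⃗(θ,e) = (-sin α(θ,e), cos α(θ,e))` (`u > 0`). [cite: BenfattoGiulianiMastropietro2003, §7.1 (A1.6)–(A1.7) p.26 (L35–52)] -/
private theorem unitTangent_angle {θ e : ℝ} (hu : 0 < u θ e) :
    unitTangent u θ e = ![-Real.sin (normalAngle u θ e), Real.cos (normalAngle u θ e)] := by
  obtain ⟨hc, hs⟩ := cos_sin_arctan_ratio (b := radiusDeriv u θ e) hu
  rw [unitTangent_eq, normalAngle, Real.cos_sub, Real.sin_sub, hc, hs, speed]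
  ext i; fin_cases i <;> simp <;> ring

/-- `τ⃗(t) · n⃗(θ') = -sin(α(t) - α(θ'))` (first line of (A1.10), at `e = 0`). [cite: BenfattoGiulianiMastropietro2003, §7.1 (A1.10) p.26 (L64–66)] -/
private theorem tangent_dot_normal {t θ' : ℝ} (ht : 0 < u t 0) (hθ' : 0 < u θ' 0) :
    unitTangent u t 0 ⬝ᵥ unitNormal u θ' 0 = -Real.sin (normalAngle u t 0 - normalAngle u θ' 0) := by
  rw [unitTangent_angle ht, unitNormal_angle hθ', Real.sin_sub]
  simp [dotProduct, Fin.sum_univ_two]; ring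

/-- `τ⃗(t) · τ⃗(θ') = cos(α(t) - α(θ'))`. [cite: BenfattoGiulianiMastropietro2003, §7.1 (A1.10) p.26 (L64–70)] -/
private theorem tangent_dot_tangent {t θ' : ℝ} (ht : 0 < u t 0) (hθ' : 0 < u θ' 0) :
    unitTangent u t 0 ⬝ᵥ unitTangent u θ' 0 = Real.cos (normalAngle u t 0 - normalAngle u θ' 0) := by
  rw [unitTangent_angle ht, unitTangent_angle hθ', Real.cos_sub]
  simp [dotProduct, Fin.sum_univ_two]; ring

/-- `n⃗ · n⃗ = 1`. [folklore] -/
private theorem normal_dot_normal {θ : ℝ} (hθ : 0 < u θ 0) :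
    unitNormal u θ 0 ⬝ᵥ unitNormal u θ 0 = 1 := by
  rw [unitNormal_angle hθ]
  simp [dotProduct, Fin.sum_univ_two]
  nlinarith [Real.sin_sq_add_cos_sq (normalAngle u θ 0)]

/-- `n⃗ · τ⃗ = 0`. [folklore] -/
private theorem normal_dot_tangent {θ : ℝ} (hθ : 0 < u θ 0) :
    unitNormal u θ 0 ⬝ᵥ unitTangent u θ 0 = 0 := by
  rw [unitNormal_angle hθ, unitTangent_angle hθ]
  simp [dotProduct, Fin.sum_univ_two]; ring

/-! #### The chord `p⃗_F(t) - p⃗_F(θ')` paired with a fixed vector: derivative `s'(t) τ⃗(t)·w` -/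

/-- `d/dt [p⃗_F(t) · w] = s'(t) τ⃗(t) · w` ((A1.6): `dp⃗_F/dθ = s'τ⃗`). [cite: BenfattoGiulianiMastropietro2003, §7.1 (A1.6) p.26 (L35–41)] -/
private theorem hasDerivAt_chord (hD : DispersionHyp ε μ e₀ u) (θ' : ℝ) (w : Fin 2 → ℝ) (t : ℝ) :
    HasDerivAt (fun s => (fermiPoint u s - fermiPoint u θ') ⬝ᵥ w)
      (speed u t 0 * (unitTangent u t 0 ⬝ᵥ w)) t := by
  have h0 : |(0 : ℝ)| ≤ e₀ := by rw [abs_zero]; exact hD.e₀_pos.le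
  obtain ⟨cu, hcu, hu⟩ := hD.u_pos
  have hupos : 0 < u t 0 := lt_of_lt_of_le hcu (hu t 0 h0)
  have hs : speed u t 0 ≠ 0 := (lt_of_lt_of_le hupos (le_speed u t 0 hupos.le)).ne'
  have h1 : (fun s => (fermiPoint u s - fermiPoint u θ') ⬝ᵥ w) =
      fun s => u s 0 * (dir s ⬝ᵥ w) - fermiPoint u θ' ⬝ᵥ w := by
    funext s; simp [fermiPoint, levelPoint, sub_dotProduct, smul_dotProduct]
  have h2 : speed u t 0 * (unitTangent u t 0 ⬝ᵥ w) =
      radiusDeriv u t 0 * (dir t ⬝ᵥ w) + u t 0 * (tdir t ⬝ᵥ w) := by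
    rw [unitTangent, smul_dotProduct, smul_eq_mul, add_dotProduct, smul_dotProduct, smul_dotProduct,
      smul_eq_mul, smul_eq_mul, ← mul_assoc, mul_inv_cancel₀ hs, one_mul]
  rw [h1, h2]
  exact ((hasDerivAt_u hD h0 t).mul (hasDerivAt_dir_dot w t)).sub_const _

/-- `α(θ + π, e) = α(θ, e) + π` ((A1.4)). [cite: BenfattoGiulianiMastropietro2003, §7.1 Lemma 7.1 p.26 (L62–63)] -/
private theorem normalAngle_add_pi (hD : DispersionHyp ε μ e₀ u) {e : ℝ} (he : |e| ≤ e₀) (θ : ℝ) :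
    normalAngle u (θ + π) e = normalAngle u θ e + π := by
  unfold normalAngle
  rw [hD.antipodal θ e he, radiusDeriv_add_pi hD he θ]
  ring

/-! #### Global convexity along the Fermi curve: the support gap `[p⃗_F(θ') - p⃗_F(t)]·n⃗(θ')` -/

/-- **The far regime.** With `α` bi-Lipschitz (`a₁(y-x) ≤ α(y)-α(x) ≤ a₂(y-x)`, Lemma 7.1) the height
`F(t) = [p⃗_F(t) - p⃗_F(θ')]·n⃗(θ')` has `F' = -s'(t) sin(α(t) - α(θ'))`, so `F` decreases on
`[θ', θ'+π]`, increases on `[θ'-π, θ']`, and on `[θ' + t₀/2, θ' + t₀]` (`t₀ = (π/3)/a₂`) it decreases at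
rate at least `m = c_u a₁ t₀/π` (Jordan's inequality); hence `F(t) ≤ -m t₀/2` once
`t₀ ≤ |t - θ'| ≤ π`: a strictly convex curve stays a definite distance below its tangent line away from
the tangency point. [cite: BenfattoGiulianiMastropietro2003, §7.1 Lemma 7.1 (A1.9)–(A1.10) p.26 (L54–74)] -/
private theorem support_gap_far (hD : DispersionHyp ε μ e₀ u) {cu a₁ a₂ : ℝ} (hcu : 0 < cu)
    (hu : ∀ θ e : ℝ, |e| ≤ e₀ → cu ≤ u θ e) (ha₁ : 0 < a₁) (ha₂ : 1 ≤ a₂)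
    (hslope : ∀ x y : ℝ, x ≤ y → a₁ * (y - x) ≤ normalAngle u y 0 - normalAngle u x 0 ∧
        normalAngle u y 0 - normalAngle u x 0 ≤ a₂ * (y - x))
    (θ' t : ℝ) (ht₀ : π / 3 / a₂ ≤ |t - θ'|) (hπ : |t - θ'| ≤ π) :
    (fermiPoint u t - fermiPoint u θ') ⬝ᵥ unitNormal u θ' 0 ≤
      -(cu * a₁ * (π / 3 / a₂) / π * (π / 3 / a₂ / 2)) := by
  have h0 : |(0 : ℝ)| ≤ e₀ := by rw [abs_zero]; exact hD.e₀_pos.le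
  have hupos : ∀ s, 0 < u s 0 := fun s => lt_of_lt_of_le hcu (hu s 0 h0)
  set t₀ := π / 3 / a₂ with ht₀def
  have ha₂pos : 0 < a₂ := lt_of_lt_of_le one_pos ha₂
  have ht₀pos : 0 < t₀ := by positivity
  have ht₀le : t₀ ≤ π / 3 := by
    rw [ht₀def, div_le_iff₀ ha₂pos]; nlinarith [pi_pos]
  have ha₂t₀ : a₂ * t₀ = π / 3 := by rw [ht₀def]; field_simp
  set m := cu * a₁ * t₀ / π with hmdef
  have hmpos : 0 < m := by positivity
  -- the height function and its derivative
  set F : ℝ → ℝ := fun s => (fermiPoint u s - fermiPoint u θ') ⬝ᵥ unitNormal u θ' 0 with hFdef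
  have hF0 : F θ' = 0 := by simp [hFdef]
  have hFder : ∀ s, HasDerivAt F
      (-(speed u s 0 * Real.sin (normalAngle u s 0 - normalAngle u θ' 0))) s := by
    intro s
    have h := hasDerivAt_chord hD θ' (unitNormal u θ' 0) s
    rw [tangent_dot_normal (hupos s) (hupos θ'), mul_neg] at h
    exact h
  have hFdiff : Differentiable ℝ F := fun s => (hFder s).differentiableAt
  have hFderiv : ∀ s, deriv F s = -(speed u s 0 * Real.sin (normalAngle u s 0 - normalAngle u θ' 0)) :=
    fun s => (hFder s).deriv
  have hspeed : ∀ s, cu ≤ speed u s 0 := fun s => (hu s 0 h0).trans (le_speed u s 0 (hupos s).le)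
  have hspeed0 : ∀ s, 0 ≤ speed u s 0 := fun s => hcu.le.trans (hspeed s)
  -- the angle increment `Δα(s) = α(s) - α(θ')`
  have hΔup : ∀ s, θ' ≤ s → a₁ * (s - θ') ≤ normalAngle u s 0 - normalAngle u θ' 0 ∧
      normalAngle u s 0 - normalAngle u θ' 0 ≤ a₂ * (s - θ') := fun s hs => hslope θ' s hs
  have hΔdown : ∀ s, s ≤ θ' → a₁ * (θ' - s) ≤ normalAngle u θ' 0 - normalAngle u s 0 ∧
      normalAngle u θ' 0 - normalAngle u s 0 ≤ a₂ * (θ' - s) := fun s hs => hslope s θ' hs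
  have hαpi := normalAngle_add_pi hD h0
  -- (i) `F` is antitone on `[θ', θ' + π]` and monotone on `[θ' - π, θ']`
  have hanti : AntitoneOn F (Icc θ' (θ' + π)) := by
    refine antitoneOn_of_deriv_nonpos (convex_Icc _ _) hFdiff.continuous.continuousOn
      (hFdiff.differentiableOn) fun s hs => ?_
    rw [interior_Icc] at hs
    rw [hFderiv]
    have h1 : 0 ≤ normalAngle u s 0 - normalAngle u θ' 0 := by
      have := (hΔup s hs.1.le).1; nlinarith [hs.1]
    have h2 : normalAngle u s 0 - normalAngle u θ' 0 ≤ π := by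
      have := (hslope s (θ' + π) hs.2.le).1
      have hpi' := hαpi θ'
      nlinarith [hs.2]
    have := Real.sin_nonneg_of_nonneg_of_le_pi h1 h2
    nlinarith [hspeed0 s]
  have hmonoL : MonotoneOn F (Icc (θ' - π) θ') := by
    refine monotoneOn_of_deriv_nonneg (convex_Icc _ _) hFdiff.continuous.continuousOn
      (hFdiff.differentiableOn) fun s hs => ?_
    rw [interior_Icc] at hs
    rw [hFderiv]
    have h1 : normalAngle u s 0 - normalAngle u θ' 0 ≤ 0 := by
      have := (hΔdown s hs.2.le).1; nlinarith [hs.2]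
    have h2 : -π ≤ normalAngle u s 0 - normalAngle u θ' 0 := by
      have := (hslope (θ' - π) s hs.1.le).1
      have hpi' := hαpi (θ' - π)
      rw [sub_add_cancel] at hpi'
      nlinarith [hs.1]
    have := Real.sin_nonpos_of_nonpos_of_neg_pi_le h1 h2
    nlinarith [hspeed0 s]
  -- (ii) quantitative decrease on `[θ' + t₀/2, θ' + t₀]`, increase on `[θ' - t₀, θ' - t₀/2]`
  have hsteepR : ∀ s ∈ interior (Icc (θ' + t₀ / 2) (θ' + t₀)), deriv F s ≤ -m := by
    intro s hs
    rw [interior_Icc] at hs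
    rw [hFderiv]
    obtain ⟨hlo, hhi⟩ := hΔup s (by linarith [hs.1])
    have hΔ0 : 0 ≤ normalAngle u s 0 - normalAngle u θ' 0 := by nlinarith [hs.1]
    have hΔ1 : normalAngle u s 0 - normalAngle u θ' 0 ≤ π / 2 := by
      have : a₂ * (s - θ') ≤ a₂ * t₀ := mul_le_mul_of_nonneg_left (by linarith [hs.2]) ha₂pos.le
      linarith [pi_pos]
    have hsin := Real.mul_le_sin hΔ0 hΔ1
    have hΔlo : a₁ * (t₀ / 2) ≤ normalAngle u s 0 - normalAngle u θ' 0 :=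
      (mul_le_mul_of_nonneg_left (by linarith [hs.1]) ha₁.le).trans hlo
    have hsinlo : a₁ * t₀ / π ≤ Real.sin (normalAngle u s 0 - normalAngle u θ' 0) := by
      have h2π : 0 < 2 / π := by positivity
      calc a₁ * t₀ / π = 2 / π * (a₁ * (t₀ / 2)) := by ring
        _ ≤ 2 / π * (normalAngle u s 0 - normalAngle u θ' 0) := mul_le_mul_of_nonneg_left hΔlo h2π.le
        _ ≤ _ := hsin
    have hprod : cu * (a₁ * t₀ / π) ≤ speed u s 0 * Real.sin (normalAngle u s 0 - normalAngle u θ' 0) :=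
      mul_le_mul (hspeed s) hsinlo (by positivity) (hspeed0 s)
    have hm : m = cu * (a₁ * t₀ / π) := by rw [hmdef]; ring
    linarith
  have hsteepL : ∀ s ∈ interior (Icc (θ' - t₀) (θ' - t₀ / 2)), m ≤ deriv F s := by
    intro s hs
    rw [interior_Icc] at hs
    rw [hFderiv]
    obtain ⟨hlo, hhi⟩ := hΔdown s (by linarith [hs.2])
    have hΔ0 : 0 ≤ normalAngle u θ' 0 - normalAngle u s 0 := by nlinarith [hs.2]
    have hΔ1 : normalAngle u θ' 0 - normalAngle u s 0 ≤ π / 2 := by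
      have : a₂ * (θ' - s) ≤ a₂ * t₀ := mul_le_mul_of_nonneg_left (by linarith [hs.1]) ha₂pos.le
      linarith [pi_pos]
    have hsin := Real.mul_le_sin hΔ0 hΔ1
    have hΔlo : a₁ * (t₀ / 2) ≤ normalAngle u θ' 0 - normalAngle u s 0 :=
      (mul_le_mul_of_nonneg_left (by linarith [hs.2]) ha₁.le).trans hlo
    have hsinlo : a₁ * t₀ / π ≤ Real.sin (normalAngle u θ' 0 - normalAngle u s 0) := by
      have h2π : 0 < 2 / π := by positivity
      calc a₁ * t₀ / π = 2 / π * (a₁ * (t₀ / 2)) := by ring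
        _ ≤ 2 / π * (normalAngle u θ' 0 - normalAngle u s 0) := mul_le_mul_of_nonneg_left hΔlo h2π.le
        _ ≤ _ := hsin
    have hprod : cu * (a₁ * t₀ / π) ≤ speed u s 0 * Real.sin (normalAngle u θ' 0 - normalAngle u s 0) :=
      mul_le_mul (hspeed s) hsinlo (by positivity) (hspeed0 s)
    have hm : m = cu * (a₁ * t₀ / π) := by rw [hmdef]; ring
    have hodd : Real.sin (normalAngle u s 0 - normalAngle u θ' 0) =
        -Real.sin (normalAngle u θ' 0 - normalAngle u s 0) := by rw [← Real.sin_neg, neg_sub]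
    rw [hodd]
    linarith
  -- (iii) assemble on each side
  have hgoal : F t ≤ -(m * (t₀ / 2)) := by
    rcases le_or_gt θ' t with hle | hlt
    · -- right side: `θ' + t₀ ≤ t ≤ θ' + π`
      have hd : t - θ' = |t - θ'| := (abs_of_nonneg (by linarith)).symm
      have ht1 : θ' + t₀ ≤ t := by linarith [hd.symm ▸ ht₀]
      have ht2 : t ≤ θ' + π := by linarith [hd.symm ▸ hπ]
      have hA : F t ≤ F (θ' + t₀) :=
        hanti ⟨by linarith, by linarith⟩ ⟨by linarith, ht2⟩ ht1
      have hB : F (θ' + t₀) - F (θ' + t₀ / 2) ≤ -m * (θ' + t₀ - (θ' + t₀ / 2)) :=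
        (convex_Icc _ _).image_sub_le_mul_sub_of_deriv_le hFdiff.continuous.continuousOn
          hFdiff.differentiableOn hsteepR _ ⟨le_rfl, by linarith⟩ _ ⟨by linarith, le_rfl⟩ (by linarith)
      have hC : F (θ' + t₀ / 2) ≤ F θ' :=
        hanti ⟨le_rfl, by linarith [pi_pos]⟩ ⟨by linarith, by linarith⟩ (by linarith)
      rw [hF0] at hC
      have : -m * (θ' + t₀ - (θ' + t₀ / 2)) = -(m * (t₀ / 2)) := by ring
      linarith
    · -- left side: `θ' - π ≤ t ≤ θ' - t₀`
      have hd : θ' - t = |t - θ'| := by rw [abs_sub_comm]; exact (abs_of_nonneg (by linarith)).symm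
      have ht1 : t ≤ θ' - t₀ := by linarith [hd.symm ▸ ht₀]
      have ht2 : θ' - π ≤ t := by linarith [hd.symm ▸ hπ]
      have hA : F t ≤ F (θ' - t₀) :=
        hmonoL ⟨ht2, by linarith⟩ ⟨by linarith, by linarith⟩ ht1
      have hB : m * (θ' - t₀ / 2 - (θ' - t₀)) ≤ F (θ' - t₀ / 2) - F (θ' - t₀) :=
        (convex_Icc _ _).mul_sub_le_image_sub_of_le_deriv hFdiff.continuous.continuousOn
          hFdiff.differentiableOn hsteepL _ ⟨le_rfl, by linarith⟩ _ ⟨by linarith, le_rfl⟩ (by linarith)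
      have hC : F (θ' - t₀ / 2) ≤ F θ' :=
        hmonoL ⟨by linarith [pi_pos], by linarith⟩ ⟨by linarith [pi_pos], le_rfl⟩ (by linarith)
      rw [hF0] at hC
      have : m * (θ' - t₀ / 2 - (θ' - t₀)) = m * (t₀ / 2) := by ring
      linarith
  have hm' : cu * a₁ * (π / 3 / a₂) / π * (π / 3 / a₂ / 2) = m * (t₀ / 2) := by
    rw [hmdef, ht₀def]
  rw [hm']
  exact hgoal

/-- **The local regime, tangential part.** For `|t - θ'| ≤ t₀ = (π/3)/a₂` the angle increment is at
most `π/3`, so `T(t) = [p⃗_F(t) - p⃗_F(θ')]·τ⃗(θ')` has `T' = s' cos(α(t) - α(θ')) ≥ c_u/2` and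
`|T(t)| ≥ (c_u/2)|t - θ'|` ((A1.16) from below). [cite: BenfattoGiulianiMastropietro2003, §7.1 (A1.16) and (A1.10) p.26 (L64–70, L139–141)] -/
private theorem tangent_chord_local (hD : DispersionHyp ε μ e₀ u) {cu a₁ a₂ : ℝ} (hcu : 0 < cu)
    (hu : ∀ θ e : ℝ, |e| ≤ e₀ → cu ≤ u θ e) (ha₁ : 0 < a₁) (ha₂ : 1 ≤ a₂)
    (hslope : ∀ x y : ℝ, x ≤ y → a₁ * (y - x) ≤ normalAngle u y 0 - normalAngle u x 0 ∧
        normalAngle u y 0 - normalAngle u x 0 ≤ a₂ * (y - x))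
    (θ' t : ℝ) (ht : |t - θ'| ≤ π / 3 / a₂) :
    cu / 2 * |t - θ'| ≤ |(fermiPoint u t - fermiPoint u θ') ⬝ᵥ unitTangent u θ' 0| := by
  have h0 : |(0 : ℝ)| ≤ e₀ := by rw [abs_zero]; exact hD.e₀_pos.le
  have hupos : ∀ s, 0 < u s 0 := fun s => lt_of_lt_of_le hcu (hu s 0 h0)
  set t₀ := π / 3 / a₂ with ht₀def
  have ha₂pos : 0 < a₂ := lt_of_lt_of_le one_pos ha₂
  have ha₂t₀ : a₂ * t₀ = π / 3 := by rw [ht₀def]; field_simp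
  set T : ℝ → ℝ := fun s => (fermiPoint u s - fermiPoint u θ') ⬝ᵥ unitTangent u θ' 0 with hTdef
  have hT0 : T θ' = 0 := by simp [hTdef]
  have hTder : ∀ s, HasDerivAt T
      (speed u s 0 * Real.cos (normalAngle u s 0 - normalAngle u θ' 0)) s := by
    intro s
    have h := hasDerivAt_chord hD θ' (unitTangent u θ' 0) s
    rw [tangent_dot_tangent (hupos s) (hupos θ')] at h
    exact h
  have hTdiff : Differentiable ℝ T := fun s => (hTder s).differentiableAt
  have hspeed : ∀ s, cu ≤ speed u s 0 := fun s => (hu s 0 h0).trans (le_speed u s 0 (hupos s).le)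
  -- on `[θ' - t₀, θ' + t₀]` the derivative is at least `cu/2`
  have hderiv : ∀ s ∈ interior (Icc (θ' - t₀) (θ' + t₀)), cu / 2 ≤ deriv T s := by
    intro s hs
    rw [interior_Icc] at hs
    rw [(hTder s).deriv]
    have habsΔ : |normalAngle u s 0 - normalAngle u θ' 0| ≤ π / 3 := by
      rcases le_or_gt θ' s with hle | hlt
      · obtain ⟨hlo, hhi⟩ := hslope θ' s hle
        rw [abs_of_nonneg (by nlinarith)]
        have : a₂ * (s - θ') ≤ a₂ * t₀ := mul_le_mul_of_nonneg_left (by linarith [hs.2]) ha₂pos.le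
        linarith
      · obtain ⟨hlo, hhi⟩ := hslope s θ' hlt.le
        rw [abs_of_nonpos (by nlinarith)]
        have : a₂ * (θ' - s) ≤ a₂ * t₀ := mul_le_mul_of_nonneg_left (by linarith [hs.1]) ha₂pos.le
        linarith
    have hcos : 1 / 2 ≤ Real.cos (normalAngle u s 0 - normalAngle u θ' 0) := by
      rw [← Real.cos_abs, ← Real.cos_pi_div_three]
      exact Real.cos_le_cos_of_nonneg_of_le_pi (abs_nonneg _) (by linarith [pi_pos]) habsΔ
    calc cu / 2 = cu * (1 / 2) := by ring
      _ ≤ speed u s 0 * Real.cos (normalAngle u s 0 - normalAngle u θ' 0) :=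
          mul_le_mul (hspeed s) hcos (by norm_num) (hcu.le.trans (hspeed s))
  have hmvt := (convex_Icc (θ' - t₀) (θ' + t₀)).mul_sub_le_image_sub_of_le_deriv
    hTdiff.continuous.continuousOn hTdiff.differentiableOn hderiv
  have ht' : θ' - t₀ ≤ t ∧ t ≤ θ' + t₀ := by
    constructor <;> linarith [(abs_le.1 ht).1, (abs_le.1 ht).2]
  have ht₀pos : 0 < t₀ := by positivity
  rcases le_or_gt θ' t with hle | hlt
  · have h := hmvt θ' ⟨by linarith, by linarith⟩ t ⟨ht'.1, ht'.2⟩ hle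
    rw [hT0, sub_zero] at h
    rw [abs_of_nonneg (sub_nonneg.2 hle)]
    show cu / 2 * (t - θ') ≤ |T t|
    exact h.trans (le_abs_self _)
  · have h := hmvt t ⟨ht'.1, ht'.2⟩ θ' ⟨by linarith, by linarith⟩ hlt.le
    rw [hT0, zero_sub] at h
    rw [abs_sub_comm, abs_of_pos (by linarith : (0:ℝ) < θ' - t)]
    show cu / 2 * (θ' - t) ≤ |T t|
    exact h.trans (neg_le_abs _)

end ProjectionProof

end BGM2003

end Literature.MathematicalPhysics.QuantumLattice.FermiRG


namespace Literature.MathematicalPhysics.QuantumLattice.FermiRG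

namespace BGM2003

open Real Set

section ProjectionMain

/-- `‖a + b‖_{𝕋¹} ≤ ‖a‖_{𝕋¹} + ‖b‖_{𝕋¹}`. [folklore] -/
private theorem torusDist_add_le (a b : ℝ) : torusDist (a + b) ≤ torusDist a + torusDist b := by
  unfold torusDist
  rw [AddCircle.coe_add]
  exact norm_add_le _ _

/-- `‖θ‖_{𝕋¹} ≤ |θ|`. [folklore] -/
private theorem torusDist_le_abs (x : ℝ) : torusDist x ≤ |x| := by
  unfold torusDist
  exact QuotientAddGroup.norm_mk_le_norm.trans (le_of_eq (Real.norm_eq_abs _))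

end ProjectionMain

/-- **BGM 2003 Lemma 7.4 [lmA1.2] — PROVED** (discharges the named fact `lemma74_projection`),
following App. 7.1: write `p⃗ = u(θ,e)e⃗_r(θ) ∈ S_{h,ω}` with `θ` the representative near `θ_{h,ω}`,
`p⃗ - p⃗_F(θ) = r e⃗_r(θ)` with `|r| ≤ |e|/c₁ ≤ cγ^h` (Lemma 7.2 / (A1.10b)); if `p⃗ = p⃗_F(θ_⊥) + x n⃗(θ_⊥)`
then, pairing `x n⃗(θ_⊥) = r e⃗_r(θ) + [p⃗_F(θ) - p⃗_F(θ_⊥)]` with `n⃗(θ_⊥)` and `τ⃗(θ_⊥)` ((s1.12)/(s1.13)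
with the roles of `θ_{h,ω}` and `θ_⊥` exchanged):
`x = r e⃗_r·n⃗(θ_⊥) + [p⃗_F(θ) - p⃗_F(θ_⊥)]·n⃗(θ_⊥)` and `0 = r e⃗_r·τ⃗(θ_⊥) + [p⃗_F(θ) - p⃗_F(θ_⊥)]·τ⃗(θ_⊥)`.
GLOBAL STEP (where `|x| ≤ δ` enters): by Lemma 7.1 the height `[p⃗_F(t) - p⃗_F(θ_⊥)]·n⃗(θ_⊥)` is
`≤ -g₀ < 0` once `‖t - θ_⊥‖ ≥ t₀` (strict convexity, `support_gap_far`), while here it equals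
`x - r e⃗_r·n⃗ ≥ -δ - 2cγ^h > -g₀` for `δ = g₀/3` and `γ^h` small; so `‖θ - θ_⊥‖ < t₀`, and at the
finitely many large scales the bounds hold with a large constant. LOCAL STEP ((A1.15)/(A1.16)):
`(c_u/2)‖θ - θ_⊥‖ ≤ |[p⃗_F(θ) - p⃗_F(θ_⊥)]·τ⃗(θ_⊥)| ≤ 2|r| = O(γ^h)` and then
`|x| ≤ 2|r| + B₂‖θ - θ_⊥‖² = O(γ^h)`, `‖θ_⊥ - θ_{h,ω}‖ ≤ ‖θ_⊥ - θ‖ + ‖θ - θ_{h,ω}‖ = O(γ^{h/2})`.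
[cite: BenfattoGiulianiMastropietro2003, §7.1 Lemma 7.4 with (A1.11), (s1.12)–(s1.13), (A1.15)–(A1.16) p.26 (L165) – p.27 (L20)] -/
theorem lemma74_projection_holds : lemma74_projection := by
  intro ε μ e₀ u hD
  obtain ⟨c₁, c₂, hc₁, -, hrad⟩ := hD.radial
  obtain ⟨cu, hcu, hu⟩ := hD.u_pos
  obtain ⟨cκ, hcκ, hκ⟩ := hD.convex
  obtain ⟨M, hM0, hM⟩ := uniform_bounds hD
  have he₀ := hD.e₀_pos
  have h0 : |(0 : ℝ)| ≤ e₀ := by rw [abs_zero]; exact he₀.le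
  -- Lemma 7.1's slope constants at `e = 0`
  set a₁ := cκ * cu with ha₁def
  set a₂ := 2 + M ^ 2 / cu ^ 2 with ha₂def
  have ha₁ : 0 < a₁ := by positivity
  have ha₂ : 1 ≤ a₂ := by
    have : 0 ≤ M ^ 2 / cu ^ 2 := by positivity
    linarith
  have hslope : ∀ x y : ℝ, x ≤ y → a₁ * (y - x) ≤ normalAngle u y 0 - normalAngle u x 0 ∧
      normalAngle u y 0 - normalAngle u x 0 ≤ a₂ * (y - x) :=
    fun x y hxy => normalAngle_slope hD hcu hu hcκ hκ hM0 hM h0 hxy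
  -- the scales of the argument
  set t₀ := π / 3 / a₂ with ht₀def
  have ht₀pos : 0 < t₀ := by positivity
  set g₀ := cu * a₁ * t₀ / π * (t₀ / 2) with hg₀def
  have hg₀pos : 0 < g₀ := by positivity
  set ρ₀ := e₀ / c₁ with hρ₀def
  have hρ₀pos : 0 < ρ₀ := by positivity
  set B₂ := 2 * (M + 2 * M + M) with hB₂def
  have hB₂0 : 0 ≤ B₂ := by positivity
  -- the constants of the lemma
  set δ := g₀ / 3 with hδdef
  set c := 2 * ρ₀ + 16 * B₂ * ρ₀ ^ 2 / cu ^ 2 + (4 * ρ₀ / cu + π) + 6 * π * ρ₀ / g₀ + 1 with hcdef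
  have hnn₁ : 0 ≤ 16 * B₂ * ρ₀ ^ 2 / cu ^ 2 := by positivity
  have hnn₂ : 0 ≤ 4 * ρ₀ / cu + π := by positivity
  have hnn₃ : 0 ≤ 6 * π * ρ₀ / g₀ := by positivity
  have hc_x : 2 * ρ₀ + 16 * B₂ * ρ₀ ^ 2 / cu ^ 2 ≤ c := by
    rw [hcdef]; linarith only [hnn₂, hnn₃]
  have hc_θ : 4 * ρ₀ / cu + π ≤ c := by
    rw [hcdef]; linarith only [hnn₁, hnn₃, hρ₀pos]
  have hc_q : 6 * π * ρ₀ / g₀ ≤ c := by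
    rw [hcdef]; linarith only [hnn₁, hnn₂, hρ₀pos]
  have hc_ρ : 2 * ρ₀ ≤ c := by linarith only [hc_x, hnn₁]
  refine ⟨c, δ, by positivity, by positivity, ?_⟩
  intro n ω hω p hp x θ' hxδ hpx
  obtain ⟨θ, e, he, hζ, rfl⟩ := hp
  -- scales
  have h4pos : 0 < (4 : ℝ) ^ (-(n : ℤ)) := zpow_pos (by norm_num) _
  have h2pos : 0 < (2 : ℝ) ^ (-(n : ℤ)) := zpow_pos (by norm_num) _
  have h4le : (4 : ℝ) ^ (-(n : ℤ)) ≤ 1 := zpow_le_one_of_nonpos₀ (by norm_num) (by simp)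
  have h42 : (4 : ℝ) ^ (-(n : ℤ)) = ((2 : ℝ) ^ (-(n : ℤ))) ^ 2 := by
    rw [← zpow_natCast, ← zpow_mul, show (4 : ℝ) = 2 ^ (2 : ℤ) by norm_num, ← zpow_mul]
    congr 1; ring
  have h2le : (2 : ℝ) ^ (-(n : ℤ)) ≤ 1 := zpow_le_one_of_nonpos₀ (by norm_num) (by simp)
  have h4le2 : (4 : ℝ) ^ (-(n : ℤ)) ≤ (2 : ℝ) ^ (-(n : ℤ)) := by
    rw [h42]; exact pow_le_of_le_one h2pos.le h2le two_ne_zero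
  have h44 : ((4 : ℝ) ^ (-(n : ℤ))) ^ 2 ≤ (4 : ℝ) ^ (-(n : ℤ)) :=
    pow_le_of_le_one h4pos.le h4le two_ne_zero
  have he' : |e| ≤ e₀ := he.trans (mul_le_of_le_one_left he₀.le h4le)
  have hw : sectorWidth n = π * (2 : ℝ) ^ (-(n : ℤ)) := by
    rw [sectorWidth, zpow_neg, zpow_natCast, div_eq_mul_inv]
  -- the centre `θ₀` and the representative angle `θs` of `p`
  set θ₀ := sectorCenter n ω with hθ₀
  obtain ⟨j, hj⟩ : ∃ j : ℤ, |θ - (((ω : ℤ) : ℝ) + 1 / 2) * sectorWidth n - 2 * π * j| <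
      3 * sectorWidth n / 4 := by
    by_contra hcon
    exact hζ (sectorWeightCirc_eq_zero fun j => not_lt.1 fun h => hcon ⟨j, h⟩)
  have hcast : (((ω : ℤ) : ℝ) + 1 / 2) * sectorWidth n = θ₀ := by
    rw [hθ₀, sectorCenter, Int.cast_natCast]
  rw [hcast] at hj
  set θs := θ - j * (2 * π) with hθs
  have hd : |θs - θ₀| < 3 * sectorWidth n / 4 := by
    have : θs - θ₀ = θ - θ₀ - 2 * π * j := by rw [hθs]; ring
    rw [this]; exact hj
  have hd2 : |θs - θ₀| ≤ π * (2 : ℝ) ^ (-(n : ℤ)) := by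
    rw [← hw]; linarith only [hd.le, sectorWidth_pos n]
  have hp_eq : levelPoint u θ e = levelPoint u θs e := by
    rw [levelPoint, levelPoint, hθs, (hD.periodic_u e).sub_int_mul_eq j, dir_sub_int_mul]
  -- the representative `d̃ ∈ [-π, π]` of `θs - θ'`; `ts = θ' + d̃` has `p_F(ts) = p_F(θs)`
  obtain ⟨j', hj'⟩ : ∃ j' : ℤ, torusDist (θs - θ') = |θs - θ' - j' * (2 * π)| :=
    ⟨_, torusDist_eq_abs_sub_round _⟩
  set dt := θs - θ' - j' * (2 * π) with hdt
  have hdtπ : |dt| ≤ π := by rw [← hj']; exact torusDist_le_pi _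
  set ts := θ' + dt with hts
  have hts' : ts - θ' = dt := by rw [hts]; ring
  have hpF : fermiPoint u ts = fermiPoint u θs := by
    have h1 : ts = θs - j' * (2 * π) := by rw [hts, hdt]; ring
    rw [h1, fermiPoint, fermiPoint, levelPoint, levelPoint, (hD.periodic_u 0).sub_int_mul_eq j',
      dir_sub_int_mul]
  -- positivity of `u` and the frame at `θ'`
  have hupos : ∀ s, 0 < u s 0 := fun s => lt_of_lt_of_le hcu (hu s 0 h0)
  have hsθ' : 0 < speed u θ' 0 := lt_of_lt_of_le (hupos θ') (le_speed u θ' 0 (hupos θ').le)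
  have hn1 := norm_unitNormal_le hsθ'
  have hτ1 := norm_unitTangent_le hsθ'
  -- the vector identity `x n⃗(θ') = r e⃗_r(θs) + [p⃗_F(ts) - p⃗_F(θ')]`, `r = u(θs,e) - u(θs,0)`
  set r := u θs e - u θs 0 with hr
  have hv : x • unitNormal u θ' 0 = r • dir θs + (fermiPoint u ts - fermiPoint u θ') := by
    have h1 : x • unitNormal u θ' 0 = levelPoint u θs e - fermiPoint u θ' := by
      rw [← hp_eq, hpx]; abel
    rw [h1, hpF, hr, fermiPoint, fermiPoint, levelPoint, levelPoint, levelPoint, sub_smul]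
    abel
  have hrabs : |r| ≤ ρ₀ * (4 : ℝ) ^ (-(n : ℤ)) := by
    have h1 : |r| ≤ |e| / c₁ := radial_abs hD hc₁ hrad θs he'
    refine h1.trans ?_
    rw [hρ₀def, div_mul_eq_mul_div]
    exact div_le_div_of_nonneg_right (by linarith) hc₁.le
  have hpair : ∀ w : Fin 2 → ℝ, ‖w‖ ≤ 1 → |dir θs ⬝ᵥ w| ≤ 2 := fun w hw =>
    calc |dir θs ⬝ᵥ w| ≤ 2 * ‖dir θs‖ * ‖w‖ := abs_dotProduct_le _ _
      _ ≤ 2 * 1 * 1 := by gcongr; exact norm_dir_le_one θs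
      _ = 2 := by norm_num
  -- (s1.12): `x = r e⃗_r·n⃗' + F`;  (s1.13): `0 = r e⃗_r·τ⃗' + T`
  set F := (fermiPoint u ts - fermiPoint u θ') ⬝ᵥ unitNormal u θ' 0 with hFdef
  set T := (fermiPoint u ts - fermiPoint u θ') ⬝ᵥ unitTangent u θ' 0 with hTdef
  have hx_eq : x = r * (dir θs ⬝ᵥ unitNormal u θ' 0) + F := by
    have h1 := congrArg (fun v => v ⬝ᵥ unitNormal u θ' 0) hv
    simp only [smul_dotProduct, add_dotProduct, smul_eq_mul] at h1
    rw [normal_dot_normal (hupos θ'), mul_one] at h1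
    exact h1
  have hT_eq : 0 = r * (dir θs ⬝ᵥ unitTangent u θ' 0) + T := by
    have h1 := congrArg (fun v => v ⬝ᵥ unitTangent u θ' 0) hv
    simp only [smul_dotProduct, add_dotProduct, smul_eq_mul] at h1
    rw [normal_dot_tangent (hupos θ'), mul_zero] at h1
    exact h1
  have hTabs : |T| ≤ 2 * (ρ₀ * (4 : ℝ) ^ (-(n : ℤ))) := by
    have h1 : T = -(r * (dir θs ⬝ᵥ unitTangent u θ' 0)) :=
      eq_neg_iff_add_eq_zero.2 (by rw [add_comm]; exact hT_eq.symm)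
    rw [h1, abs_neg, abs_mul]
    calc |r| * |dir θs ⬝ᵥ unitTangent u θ' 0| ≤ ρ₀ * (4 : ℝ) ^ (-(n : ℤ)) * 2 :=
        mul_le_mul hrabs (hpair _ hτ1) (abs_nonneg _) (by positivity)
      _ = _ := by ring
  have hrn : |r * (dir θs ⬝ᵥ unitNormal u θ' 0)| ≤ ρ₀ * (4 : ℝ) ^ (-(n : ℤ)) * 2 := by
    rw [abs_mul]; exact mul_le_mul hrabs (hpair _ hn1) (abs_nonneg _) (by positivity)
  have hFlo : -δ - 2 * (ρ₀ * (4 : ℝ) ^ (-(n : ℤ))) ≤ F := by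
    have h2 := (abs_le.1 hrn).2
    have h3 := (abs_le.1 hxδ).1
    linarith only [h2, h3, hx_eq]
  -- split by scale: at the (finitely many) shallow scales the bounds are trivial
  by_cases hscale : g₀ / (6 * ρ₀) < (4 : ℝ) ^ (-(n : ℤ))
  · have h6 : (0 : ℝ) < 6 * ρ₀ := by positivity
    have hg3 : g₀ / 3 < 2 * ρ₀ * (4 : ℝ) ^ (-(n : ℤ)) := by
      have h7 := (div_lt_iff₀ h6).1 hscale
      linarith only [h7]
    constructor
    · calc |x| ≤ δ := hxδ
        _ ≤ 2 * ρ₀ * (4 : ℝ) ^ (-(n : ℤ)) := hg3.le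
        _ ≤ c * (4 : ℝ) ^ (-(n : ℤ)) := mul_le_mul_of_nonneg_right hc_ρ h4pos.le
    · have h1 : π ≤ 6 * π * ρ₀ / g₀ * (4 : ℝ) ^ (-(n : ℤ)) := by
        have hq : g₀ / (6 * ρ₀) ≤ (4 : ℝ) ^ (-(n : ℤ)) := hscale.le
        have hid : 6 * π * ρ₀ / g₀ * (g₀ / (6 * ρ₀)) = π := by
          calc 6 * π * ρ₀ / g₀ * (g₀ / (6 * ρ₀)) = π * (ρ₀ / ρ₀) * (g₀ / g₀) := by ring
            _ = π := by rw [div_self hρ₀pos.ne', div_self hg₀pos.ne', mul_one, mul_one]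
        calc π = 6 * π * ρ₀ / g₀ * (g₀ / (6 * ρ₀)) := hid.symm
          _ ≤ 6 * π * ρ₀ / g₀ * (4 : ℝ) ^ (-(n : ℤ)) := mul_le_mul_of_nonneg_left hq (by positivity)
      calc torusDist (θ' - θ₀) ≤ π := torusDist_le_pi _
        _ ≤ 6 * π * ρ₀ / g₀ * (4 : ℝ) ^ (-(n : ℤ)) := h1
        _ ≤ 6 * π * ρ₀ / g₀ * (2 : ℝ) ^ (-(n : ℤ)) := mul_le_mul_of_nonneg_left h4le2 (by positivity)
        _ ≤ c * (2 : ℝ) ^ (-(n : ℤ)) := mul_le_mul_of_nonneg_right hc_q h2pos.le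
  · -- deep scales: `2ρ₀γ^h ≤ g₀/3`, so the far regime is excluded
    have hq : (4 : ℝ) ^ (-(n : ℤ)) ≤ g₀ / (6 * ρ₀) := not_lt.1 hscale
    have h2ρ : 2 * (ρ₀ * (4 : ℝ) ^ (-(n : ℤ))) ≤ g₀ / 3 := by
      have h1 := mul_le_mul_of_nonneg_left hq (by positivity : (0 : ℝ) ≤ 2 * ρ₀)
      have h3 : 2 * ρ₀ * (g₀ / (6 * ρ₀)) = g₀ / 3 := by
        calc 2 * ρ₀ * (g₀ / (6 * ρ₀)) = g₀ / 3 * (ρ₀ / ρ₀) := by ring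
          _ = g₀ / 3 := by rw [div_self hρ₀pos.ne', mul_one]
      linarith only [h1, h3]
    have hFgt : -g₀ < F := by
      rw [hδdef] at hFlo
      linarith only [hFlo, h2ρ, hg₀pos]
    have hlocal : |dt| < t₀ := by
      by_contra hcon
      have hfar := support_gap_far hD hcu hu ha₁ ha₂ hslope θ' ts
        (by rw [hts']; exact not_lt.1 hcon) (by rw [hts']; exact hdtπ)
      have hfar' : F ≤ -g₀ := by rw [hg₀def, ht₀def]; exact hfar
      linarith only [hfar', hFgt]
    -- tangential part: `(c_u/2)|d̃| ≤ |T| ≤ 2ρ₀γ^h`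
    have hdt_le : |dt| ≤ 4 / cu * (ρ₀ * (4 : ℝ) ^ (-(n : ℤ))) := by
      have h1 := tangent_chord_local hD hcu hu ha₁ ha₂ hslope θ' ts (by rw [hts']; exact hlocal.le)
      rw [hts'] at h1
      have h2 : cu / 2 * |dt| ≤ 2 * (ρ₀ * (4 : ℝ) ^ (-(n : ℤ))) := h1.trans hTabs
      rw [div_mul_eq_mul_div, le_div_iff₀ hcu]
      linarith only [h2]
    -- normal part: `|F| ≤ B₂ d̃²` (A1.15)
    have hFabs : |F| ≤ B₂ * |dt| ^ 2 := by
      obtain ⟨-, h⟩ := fermi_chord_bounds hD (fun θ => (hM θ 0 h0).1) (fun θ => (hM θ 0 h0).2.1)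
        (fun θ => (hM θ 0 h0).2.2) hM0 hM0 hM0 θ' hsθ' _ hn1 ts
      rw [hts'] at h
      exact h
    constructor
    · -- `|x| ≤ 2ρ₀γ^h + B₂ d̃² ≤ (2ρ₀ + 16 B₂ ρ₀²/c_u²) γ^h`
      have hdt0 : 0 ≤ |dt| := abs_nonneg _
      calc |x| = |r * (dir θs ⬝ᵥ unitNormal u θ' 0) + F| := by rw [hx_eq]
        _ ≤ |r * (dir θs ⬝ᵥ unitNormal u θ' 0)| + |F| := abs_add_le _ _
        _ ≤ ρ₀ * (4 : ℝ) ^ (-(n : ℤ)) * 2 + B₂ * |dt| ^ 2 := add_le_add hrn hFabs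
        _ ≤ ρ₀ * (4 : ℝ) ^ (-(n : ℤ)) * 2 + B₂ * (4 / cu * (ρ₀ * (4 : ℝ) ^ (-(n : ℤ)))) ^ 2 := by
            gcongr
        _ = 2 * ρ₀ * (4 : ℝ) ^ (-(n : ℤ)) + 16 * B₂ * ρ₀ ^ 2 / cu ^ 2 * ((4 : ℝ) ^ (-(n : ℤ))) ^ 2 := by
            ring
        _ ≤ 2 * ρ₀ * (4 : ℝ) ^ (-(n : ℤ)) + 16 * B₂ * ρ₀ ^ 2 / cu ^ 2 * (4 : ℝ) ^ (-(n : ℤ)) := by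
            gcongr
        _ = (2 * ρ₀ + 16 * B₂ * ρ₀ ^ 2 / cu ^ 2) * (4 : ℝ) ^ (-(n : ℤ)) := by ring
        _ ≤ c * (4 : ℝ) ^ (-(n : ℤ)) := mul_le_mul_of_nonneg_right hc_x h4pos.le
    · -- `‖θ' - θ₀‖ ≤ ‖θ' - θs‖ + ‖θs - θ₀‖ ≤ |d̃| + |θs - θ₀|`
      have hsplit : θ' - θ₀ = (-dt + ((-j' : ℤ) : ℝ) * (2 * π)) + (θs - θ₀) := by
        rw [hdt]; push_cast; ring
      have h1 : torusDist (θ' - θ₀) ≤ |dt| + |θs - θ₀| := by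
        rw [hsplit]
        refine (torusDist_add_le _ _).trans (add_le_add ?_ (torusDist_le_abs _))
        rw [torusDist_add_int_mul]
        exact (torusDist_le_abs _).trans (le_of_eq (abs_neg _))
      calc torusDist (θ' - θ₀) ≤ |dt| + |θs - θ₀| := h1
        _ ≤ 4 / cu * (ρ₀ * (4 : ℝ) ^ (-(n : ℤ))) + π * (2 : ℝ) ^ (-(n : ℤ)) := add_le_add hdt_le hd2
        _ ≤ 4 / cu * (ρ₀ * (2 : ℝ) ^ (-(n : ℤ))) + π * (2 : ℝ) ^ (-(n : ℤ)) := by gcongr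
        _ = (4 * ρ₀ / cu + π) * (2 : ℝ) ^ (-(n : ℤ)) := by ring
        _ ≤ c * (2 : ℝ) ^ (-(n : ℤ)) := mul_le_mul_of_nonneg_right hc_θ h2pos.le

end BGM2003

end Literature.MathematicalPhysics.QuantumLattice.FermiRG


/-! ### Lemma 7.5 discharged (proof of `lemma75_parallelogram`) -/

namespace Literature.MathematicalPhysics.QuantumLattice.FermiRG

namespace BGM2003

open Real Set Metric

section ParallelogramProof

variable {ε : (Fin 2 → ℝ) → ℝ} {μ e₀ : ℝ} {u : ℝ → ℝ → ℝ}

/-! #### More on the normal angle: shifts by `2πk`, Jordan's inequality on `[0, π]` -/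

/-- Jordan's inequality in the symmetric form `sin x ≥ (2/π) min(x, π - x)` on `[0, π]`. [folklore] -/
private theorem sin_ge_min {x : ℝ} (h0 : 0 ≤ x) (hπ : x ≤ π) :
    2 / π * min x (π - x) ≤ Real.sin x := by
  rcases le_or_gt x (π / 2) with h | h
  · calc 2 / π * min x (π - x) ≤ 2 / π * x :=
        mul_le_mul_of_nonneg_left (min_le_left _ _) (by positivity)
      _ ≤ Real.sin x := Real.mul_le_sin h0 h
  · have h1 : 0 ≤ π - x := by linarith
    have h2 : π - x ≤ π / 2 := by linarith
    calc 2 / π * min x (π - x) ≤ 2 / π * (π - x) :=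
        mul_le_mul_of_nonneg_left (min_le_right _ _) (by positivity)
      _ ≤ Real.sin (π - x) := Real.mul_le_sin h1 h2
      _ = Real.sin x := Real.sin_pi_sub x

/-- `α(θ + 2πk, e) = α(θ, e) + 2πk`. [folklore] -/
private theorem normalAngle_add_int_mul (hD : DispersionHyp ε μ e₀ u) (e θ : ℝ) (k : ℤ) :
    normalAngle u (θ + k * (2 * π)) e = normalAngle u θ e + k * (2 * π) := by
  have h0 : u (θ + k * (2 * π)) e = u θ e := ((hD.periodic_u e).int_mul k) θ
  have h1 : radiusDeriv u (θ + k * (2 * π)) e = radiusDeriv u θ e :=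
    ((periodic_deriv (hD.periodic_u e)).int_mul k) θ
  unfold normalAngle
  rw [h0, h1]
  ring

/-- `p⃗_F(θ + 2πk) = p⃗_F(θ)`. [folklore] -/
private theorem fermiPoint_add_int_mul (hD : DispersionHyp ε μ e₀ u) (θ : ℝ) (k : ℤ) :
    fermiPoint u (θ + k * (2 * π)) = fermiPoint u θ := by
  have h0 : u (θ + k * (2 * π)) 0 = u θ 0 := ((hD.periodic_u 0).int_mul k) θ
  have h1 : dir (θ + k * (2 * π)) = dir θ := by
    have := dir_sub_int_mul (θ + k * (2 * π)) k
    rw [add_sub_cancel_right] at this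
    exact this.symm
  rw [fermiPoint, fermiPoint, levelPoint, levelPoint, h0, h1]

/-- **The Jacobian does not degenerate faster than `φ`**: with `α` bi-Lipschitz (Lemma 7.1),
`|sin(α(θ₁) - α(θ₂))| ≥ (2/π) a₁ φ(θ₁, θ₂)`, `φ = min{‖θ₁-θ₂‖, π-‖θ₁-θ₂‖}` — the determinant
`s'(θ₁)s'(θ₂) sin(α₁ - α₂)` of `J` (§7.3) is comparable to `φ`. [cite: BenfattoGiulianiMastropietro2003, §7.3 (A1.19)–(A1.20) and Lemma 7.1 p.27 (L68–80)] -/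
private theorem sin_normalAngle_sub_ge (hD : DispersionHyp ε μ e₀ u) {a₁ a₂ : ℝ} (ha₁ : 0 < a₁)
    (hslope : ∀ x y : ℝ, x ≤ y → a₁ * (y - x) ≤ normalAngle u y 0 - normalAngle u x 0 ∧
        normalAngle u y 0 - normalAngle u x 0 ≤ a₂ * (y - x))
    (θ₁ θ₂ : ℝ) :
    2 / π * a₁ * pairAngle θ₁ θ₂ ≤ |Real.sin (normalAngle u θ₁ 0 - normalAngle u θ₂ 0)| := by
  have h0 : |(0 : ℝ)| ≤ e₀ := by rw [abs_zero]; exact hD.e₀_pos.le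
  obtain ⟨k, hk⟩ : ∃ k : ℤ, torusDist (θ₁ - θ₂) = |θ₁ - θ₂ - k * (2 * π)| :=
    ⟨_, torusDist_eq_abs_sub_round _⟩
  set dt := θ₁ - θ₂ - k * (2 * π) with hdt
  have hdtπ : |dt| ≤ π := by rw [← hk]; exact torusDist_le_pi _
  have hφ : pairAngle θ₁ θ₂ = min |dt| (π - |dt|) := by rw [pairAngle, hk]
  have hθ₁ : θ₁ = θ₂ + dt + k * (2 * π) := by rw [hdt]; ring
  have hΔ : normalAngle u θ₁ 0 - normalAngle u θ₂ 0 =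
      (normalAngle u (θ₂ + dt) 0 - normalAngle u θ₂ 0) + k * (2 * π) := by
    rw [hθ₁, normalAngle_add_int_mul hD 0 (θ₂ + dt) k]; ring
  rw [hΔ, Real.sin_add_int_mul_two_pi, hφ]
  have hpi := normalAngle_add_pi hD h0
  rcases le_or_gt 0 dt with hnn | hneg
  · -- `0 ≤ d̃ ≤ π`: `D̃ ∈ [a₁ d̃, π - a₁(π - d̃)]`
    rw [abs_of_nonneg hnn]
    obtain ⟨hlo, -⟩ := hslope θ₂ (θ₂ + dt) (by linarith)
    obtain ⟨hlo', -⟩ := hslope (θ₂ + dt) (θ₂ + π) (by linarith [(abs_le.1 hdtπ).2])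
    rw [hpi θ₂] at hlo'
    set D := normalAngle u (θ₂ + dt) 0 - normalAngle u θ₂ 0 with hD'
    have hD0 : 0 ≤ D := by nlinarith
    have hDπ : D ≤ π := by nlinarith [(abs_le.1 hdtπ).2]
    have hmin : a₁ * min dt (π - dt) ≤ min D (π - D) := by
      rw [le_min_iff]
      constructor
      · calc a₁ * min dt (π - dt) ≤ a₁ * dt := mul_le_mul_of_nonneg_left (min_le_left _ _) ha₁.le
          _ = a₁ * (θ₂ + dt - θ₂) := by ring
          _ ≤ D := hlo
      · calc a₁ * min dt (π - dt) ≤ a₁ * (π - dt) :=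
            mul_le_mul_of_nonneg_left (min_le_right _ _) ha₁.le
          _ = a₁ * (θ₂ + π - (θ₂ + dt)) := by ring
          _ ≤ π - D := by linarith
    calc 2 / π * a₁ * min dt (π - dt) = 2 / π * (a₁ * min dt (π - dt)) := by ring
      _ ≤ 2 / π * min D (π - D) := mul_le_mul_of_nonneg_left hmin (by positivity)
      _ ≤ Real.sin D := sin_ge_min hD0 hDπ
      _ ≤ |Real.sin D| := le_abs_self _
  · -- `-π ≤ d̃ < 0`: `-D̃ ∈ [a₁ |d̃|, π - a₁(π - |d̃|)]`
    rw [abs_of_neg hneg]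
    obtain ⟨hlo, -⟩ := hslope (θ₂ + dt) θ₂ (by linarith)
    obtain ⟨hlo', -⟩ := hslope (θ₂ - π) (θ₂ + dt) (by linarith [(abs_le.1 hdtπ).1])
    have hpi' := hpi (θ₂ - π)
    rw [sub_add_cancel] at hpi'
    set D := normalAngle u (θ₂ + dt) 0 - normalAngle u θ₂ 0 with hD'
    have hD0 : 0 ≤ -D := by nlinarith
    have hDπ : -D ≤ π := by nlinarith [(abs_le.1 hdtπ).1]
    have hmin : a₁ * min (-dt) (π - -dt) ≤ min (-D) (π - -D) := by
      rw [le_min_iff]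
      constructor
      · calc a₁ * min (-dt) (π - -dt) ≤ a₁ * (-dt) := mul_le_mul_of_nonneg_left (min_le_left _ _) ha₁.le
          _ = a₁ * (θ₂ - (θ₂ + dt)) := by ring
          _ ≤ -D := by linarith
      · calc a₁ * min (-dt) (π - -dt) ≤ a₁ * (π - -dt) :=
            mul_le_mul_of_nonneg_left (min_le_right _ _) ha₁.le
          _ = a₁ * (θ₂ + dt - (θ₂ - π)) := by ring
          _ ≤ π - -D := by linarith
    calc 2 / π * a₁ * min (-dt) (π - -dt) = 2 / π * (a₁ * min (-dt) (π - -dt)) := by ring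
      _ ≤ 2 / π * min (-D) (π - -D) := mul_le_mul_of_nonneg_left hmin (by positivity)
      _ ≤ Real.sin (-D) := sin_ge_min hD0 hDπ
      _ ≤ |Real.sin D| := by rw [Real.sin_neg]; exact neg_le_abs _

/-- **The local regime, normal part, quantitatively**: for `|t - θ'| ≤ t₀ = (π/3)/a₂` the height
`F(t) = [p⃗_F(t) - p⃗_F(θ')]·n⃗(θ')` satisfies `F(t) ≤ -(c_u a₁/π)(t - θ')²` — the curve leaves its
tangent line quadratically ((A1.15) from below, via (A1.10) and Jordan's inequality). [cite: BenfattoGiulianiMastropietro2003, §7.1 (A1.10), (A1.15) p.26 (L64–70, L134–137)] -/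
private theorem support_gap_local (hD : DispersionHyp ε μ e₀ u) {cu a₁ a₂ : ℝ} (hcu : 0 < cu)
    (hu : ∀ θ e : ℝ, |e| ≤ e₀ → cu ≤ u θ e) (ha₁ : 0 < a₁) (ha₂ : 1 ≤ a₂)
    (hslope : ∀ x y : ℝ, x ≤ y → a₁ * (y - x) ≤ normalAngle u y 0 - normalAngle u x 0 ∧
        normalAngle u y 0 - normalAngle u x 0 ≤ a₂ * (y - x))
    (θ' t : ℝ) (ht : |t - θ'| ≤ π / 3 / a₂) :
    (fermiPoint u t - fermiPoint u θ') ⬝ᵥ unitNormal u θ' 0 ≤ -(cu * a₁ / π * (t - θ') ^ 2) := by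
  have h0 : |(0 : ℝ)| ≤ e₀ := by rw [abs_zero]; exact hD.e₀_pos.le
  have hupos : ∀ s, 0 < u s 0 := fun s => lt_of_lt_of_le hcu (hu s 0 h0)
  set t₀ := π / 3 / a₂ with ht₀def
  have ha₂pos : 0 < a₂ := lt_of_lt_of_le one_pos ha₂
  have ha₂t₀ : a₂ * t₀ = π / 3 := by rw [ht₀def]; field_simp
  have ht₀pos : 0 < t₀ := by positivity
  set F : ℝ → ℝ := fun s => (fermiPoint u s - fermiPoint u θ') ⬝ᵥ unitNormal u θ' 0 with hFdef
  have hF0 : F θ' = 0 := by simp [hFdef]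
  have hFder : ∀ s, HasDerivAt F
      (-(speed u s 0 * Real.sin (normalAngle u s 0 - normalAngle u θ' 0))) s := by
    intro s
    have h := hasDerivAt_chord hD θ' (unitNormal u θ' 0) s
    rw [tangent_dot_normal (hupos s) (hupos θ'), mul_neg] at h
    exact h
  have hspeed : ∀ s, cu ≤ speed u s 0 := fun s => (hu s 0 h0).trans (le_speed u s 0 (hupos s).le)
  -- `H(s) = F(s) + (c_u a₁/π)(s - θ')²`
  set m := cu * a₁ / π with hmdef
  have hmpos : 0 < m := by positivity
  set H : ℝ → ℝ := fun s => F s + m * (s - θ') ^ 2 with hHdef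
  have hHder : ∀ s, HasDerivAt H
      (-(speed u s 0 * Real.sin (normalAngle u s 0 - normalAngle u θ' 0)) + m * (2 * (s - θ'))) s := by
    intro s
    have h2 : HasDerivAt (fun s => m * (s - θ') ^ 2) (m * (2 * (s - θ'))) s := by
      have := (((hasDerivAt_id s).sub_const θ').pow 2).const_mul m
      simpa using this
    exact (hFder s).add h2
  have hHdiff : Differentiable ℝ H := fun s => (hHder s).differentiableAt
  have hH0 : H θ' = 0 := by simp [hHdef, hF0]
  have hgoal : H t ≤ 0 := by
    rcases le_or_gt θ' t with hle | hlt
    · -- `H` is antitone on `[θ', θ' + t₀]`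
      have hanti : AntitoneOn H (Icc θ' (θ' + t₀)) := by
        refine antitoneOn_of_deriv_nonpos (convex_Icc _ _) hHdiff.continuous.continuousOn
          hHdiff.differentiableOn fun s hs => ?_
        rw [interior_Icc] at hs
        rw [(hHder s).deriv]
        obtain ⟨hlo, hhi⟩ := hslope θ' s hs.1.le
        have hΔ0 : 0 ≤ normalAngle u s 0 - normalAngle u θ' 0 := by nlinarith [hs.1]
        have hΔ1 : normalAngle u s 0 - normalAngle u θ' 0 ≤ π / 2 := by
          have : a₂ * (s - θ') ≤ a₂ * t₀ := mul_le_mul_of_nonneg_left (by linarith [hs.2]) ha₂pos.le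
          linarith [pi_pos]
        have hsin := Real.mul_le_sin hΔ0 hΔ1
        have h1 : 2 / π * (a₁ * (s - θ')) ≤ Real.sin (normalAngle u s 0 - normalAngle u θ' 0) :=
          (mul_le_mul_of_nonneg_left hlo (by positivity)).trans hsin
        have h2 : cu * (2 / π * (a₁ * (s - θ'))) ≤
            speed u s 0 * Real.sin (normalAngle u s 0 - normalAngle u θ' 0) :=
          mul_le_mul (hspeed s) h1 (by have := hs.1; positivity) (hcu.le.trans (hspeed s))
        have h3 : m * (2 * (s - θ')) = cu * (2 / π * (a₁ * (s - θ'))) := by rw [hmdef]; ring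
        linarith
      have h := hanti ⟨le_rfl, by linarith⟩ ⟨hle, by linarith [(abs_le.1 ht).2]⟩ hle
      rwa [hH0] at h
    · -- `H` is monotone on `[θ' - t₀, θ']`
      have hmono : MonotoneOn H (Icc (θ' - t₀) θ') := by
        refine monotoneOn_of_deriv_nonneg (convex_Icc _ _) hHdiff.continuous.continuousOn
          hHdiff.differentiableOn fun s hs => ?_
        rw [interior_Icc] at hs
        rw [(hHder s).deriv]
        obtain ⟨hlo, hhi⟩ := hslope s θ' hs.2.le
        have hΔ0 : 0 ≤ normalAngle u θ' 0 - normalAngle u s 0 := by nlinarith [hs.2]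
        have hΔ1 : normalAngle u θ' 0 - normalAngle u s 0 ≤ π / 2 := by
          have : a₂ * (θ' - s) ≤ a₂ * t₀ := mul_le_mul_of_nonneg_left (by linarith [hs.1]) ha₂pos.le
          linarith [pi_pos]
        have hsin := Real.mul_le_sin hΔ0 hΔ1
        have h1 : 2 / π * (a₁ * (θ' - s)) ≤ Real.sin (normalAngle u θ' 0 - normalAngle u s 0) :=
          (mul_le_mul_of_nonneg_left hlo (by positivity)).trans hsin
        have h2 : cu * (2 / π * (a₁ * (θ' - s))) ≤
            speed u s 0 * Real.sin (normalAngle u θ' 0 - normalAngle u s 0) :=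
          mul_le_mul (hspeed s) h1 (by have := hs.2; positivity) (hcu.le.trans (hspeed s))
        have h3 : m * (2 * (s - θ')) = -(cu * (2 / π * (a₁ * (θ' - s)))) := by rw [hmdef]; ring
        have hodd : Real.sin (normalAngle u s 0 - normalAngle u θ' 0) =
            -Real.sin (normalAngle u θ' 0 - normalAngle u s 0) := by rw [← Real.sin_neg, neg_sub]
        rw [hodd]
        linarith
      have h := hmono ⟨by linarith [(abs_le.1 ht).1], hlt.le⟩ ⟨by linarith, le_rfl⟩ hlt.le
      rwa [hH0] at h
  have : F t = (fermiPoint u t - fermiPoint u θ') ⬝ᵥ unitNormal u θ' 0 := rfl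
  simp only [hHdef] at hgoal
  linarith

/-- **Strict convexity, both regimes**: the height `[p⃗_F(t) - p⃗_F(ψ)]·n⃗(ψ)` is `≤ 0` everywhere and
`< 0` unless `t ≡ ψ (mod 2π)` — every point of the Fermi curve other than the tangency point lies
strictly below the tangent line. [cite: BenfattoGiulianiMastropietro2003, §7.1 Lemma 7.1 and §7.3 p.27 (L81–89)] -/
private theorem support_gap_neg (hD : DispersionHyp ε μ e₀ u) {cu a₁ a₂ : ℝ} (hcu : 0 < cu)
    (hu : ∀ θ e : ℝ, |e| ≤ e₀ → cu ≤ u θ e) (ha₁ : 0 < a₁) (ha₂ : 1 ≤ a₂)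
    (hslope : ∀ x y : ℝ, x ≤ y → a₁ * (y - x) ≤ normalAngle u y 0 - normalAngle u x 0 ∧
        normalAngle u y 0 - normalAngle u x 0 ≤ a₂ * (y - x))
    (ψ t : ℝ) :
    (fermiPoint u t - fermiPoint u ψ) ⬝ᵥ unitNormal u ψ 0 ≤ 0 ∧
      (0 < torusDist (t - ψ) → (fermiPoint u t - fermiPoint u ψ) ⬝ᵥ unitNormal u ψ 0 < 0) := by
  obtain ⟨k, hk⟩ : ∃ k : ℤ, torusDist (t - ψ) = |t - ψ - k * (2 * π)| :=
    ⟨_, torusDist_eq_abs_sub_round _⟩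
  set dt := t - ψ - k * (2 * π) with hdt
  have hdtπ : |dt| ≤ π := by rw [← hk]; exact torusDist_le_pi _
  set ts := ψ + dt with hts
  have hts' : ts - ψ = dt := by rw [hts]; ring
  have hpF : fermiPoint u t = fermiPoint u ts := by
    have h1 : t = ts + k * (2 * π) := by rw [hts, hdt]; ring
    rw [h1, fermiPoint_add_int_mul hD]
  rw [hpF, hk]
  have ha₂pos : 0 < a₂ := lt_of_lt_of_le one_pos ha₂
  have ht₀pos : 0 < π / 3 / a₂ := by positivity
  rcases le_or_gt (π / 3 / a₂) |dt| with hfar | hloc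
  · have h := support_gap_far hD hcu hu ha₁ ha₂ hslope ψ ts (by rw [hts']; exact hfar)
      (by rw [hts']; exact hdtπ)
    have hg : 0 < cu * a₁ * (π / 3 / a₂) / π * (π / 3 / a₂ / 2) := by positivity
    exact ⟨by linarith, fun _ => by linarith⟩
  · have h := support_gap_local hD hcu hu ha₁ ha₂ hslope ψ ts (by rw [hts']; exact hloc.le)
    rw [hts'] at h
    have hsq : 0 ≤ cu * a₁ / π * dt ^ 2 := by positivity
    refine ⟨by linarith, fun hpos => ?_⟩
    have hdt0 : dt ≠ 0 := fun h0 => by rw [h0, abs_zero] at hpos; exact lt_irrefl _ hpos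
    have hsq' : 0 < cu * a₁ / π * dt ^ 2 := by positivity
    linarith

end ParallelogramProof

end BGM2003

end Literature.MathematicalPhysics.QuantumLattice.FermiRG


namespace Literature.MathematicalPhysics.QuantumLattice.FermiRG

namespace BGM2003

open Real Set Metric

section ParallelogramAnalysis

variable {ε : (Fin 2 → ℝ) → ℝ} {μ e₀ : ℝ} {u : ℝ → ℝ → ℝ}

/-! #### The map `(θ₁, θ₂) ↦ p⃗_F(θ₁) + p⃗_F(θ₂)` (A1.19): derivative and its Lipschitz bound -/

/-- `d/dt [p⃗_F(t) · w] = [u'(t) e⃗_r(t) + u(t) e⃗_t(t)] · w` ((A1.6): `dp⃗_F/dθ = s'τ⃗`). [cite: BenfattoGiulianiMastropietro2003, §7.1 (A1.6) p.26 (L35–41)] -/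
private theorem hasDerivAt_fermi_dot (hD : DispersionHyp ε μ e₀ u) (w : Fin 2 → ℝ) (t : ℝ) :
    HasDerivAt (fun s => fermiPoint u s ⬝ᵥ w)
      ((radiusDeriv u t 0 • dir t + u t 0 • tdir t) ⬝ᵥ w) t := by
  have h0 : |(0 : ℝ)| ≤ e₀ := by rw [abs_zero]; exact hD.e₀_pos.le
  have h1 : (fun s => fermiPoint u s ⬝ᵥ w) = fun s => u s 0 * (dir s ⬝ᵥ w) := by
    funext s; simp [fermiPoint, levelPoint, smul_dotProduct]
  have h2 : (radiusDeriv u t 0 • dir t + u t 0 • tdir t) ⬝ᵥ w =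
      radiusDeriv u t 0 * (dir t ⬝ᵥ w) + u t 0 * (tdir t ⬝ᵥ w) := by
    rw [add_dotProduct, smul_dotProduct, smul_dotProduct, smul_eq_mul, smul_eq_mul]
  rw [h1, h2]
  exact (hasDerivAt_u hD h0 t).mul (hasDerivAt_dir_dot w t)

/-- `u' e⃗_r + u e⃗_t = s' τ⃗`. [cite: BenfattoGiulianiMastropietro2003, §7.1 (A1.6) p.26 (L35–41)] -/
private theorem velocity_eq {t : ℝ} (hs : 0 < speed u t 0) :
    radiusDeriv u t 0 • dir t + u t 0 • tdir t = speed u t 0 • unitTangent u t 0 := by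
  rw [unitTangent, smul_smul, mul_inv_cancel₀ hs.ne', one_smul]

/-- The velocity `u'(t)e⃗_r(t) + u(t)e⃗_t(t)` is `4M`-Lipschitz (sup norm), `M` a bound for
`|u|, |u'|, |u''|` at `e = 0`. [folklore] -/
private theorem velocity_lipschitz (hD : DispersionHyp ε μ e₀ u) {M : ℝ} (hM0 : 0 ≤ M)
    (hM : ∀ θ e : ℝ, |e| ≤ e₀ → |u θ e| ≤ M ∧ |radiusDeriv u θ e| ≤ M ∧ |radiusDeriv₂ u θ e| ≤ M)
    (t t' : ℝ) :
    ‖(radiusDeriv u t 0 • dir t + u t 0 • tdir t) - (radiusDeriv u t' 0 • dir t' + u t' 0 • tdir t')‖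
      ≤ 4 * M * |t - t'| := by
  have h0 : |(0 : ℝ)| ≤ e₀ := by rw [abs_zero]; exact hD.e₀_pos.le
  have hlipu : |u t 0 - u t' 0| ≤ M * |t - t'| := by
    have h := (convex_univ).norm_image_sub_le_of_norm_deriv_le (f := fun s => u s 0) (𝕜 := ℝ)
      (fun s _ => (hasDerivAt_u hD h0 s).differentiableAt)
      (fun s _ => by rw [(hasDerivAt_u hD h0 s).deriv, Real.norm_eq_abs]; exact (hM s 0 h0).2.1)
      (mem_univ t') (mem_univ t)
    rw [Real.norm_eq_abs, Real.norm_eq_abs] at h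
    exact h
  have hlipu' : |radiusDeriv u t 0 - radiusDeriv u t' 0| ≤ M * |t - t'| := by
    have h := (convex_univ).norm_image_sub_le_of_norm_deriv_le (f := fun s => radiusDeriv u s 0)
      (𝕜 := ℝ) (fun s _ => (hasDerivAt_radiusDeriv hD h0 s).differentiableAt)
      (fun s _ => by
        rw [(hasDerivAt_radiusDeriv hD h0 s).deriv, Real.norm_eq_abs]; exact (hM s 0 h0).2.2)
      (mem_univ t') (mem_univ t)
    rw [Real.norm_eq_abs, Real.norm_eq_abs] at h
    exact h
  obtain ⟨huM, hu'M, -⟩ := hM t 0 h0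
  have hdiff : (radiusDeriv u t 0 • dir t + u t 0 • tdir t) -
      (radiusDeriv u t' 0 • dir t' + u t' 0 • tdir t') =
      (radiusDeriv u t 0 - radiusDeriv u t' 0) • dir t' + radiusDeriv u t 0 • (dir t - dir t') +
      (u t 0 - u t' 0) • tdir t' + u t 0 • (tdir t - tdir t') := by
    simp only [sub_smul, smul_sub]; abel
  rw [hdiff]
  have t1 : ‖(radiusDeriv u t 0 - radiusDeriv u t' 0) • dir t'‖ ≤ M * |t - t'| := by
    rw [norm_smul, Real.norm_eq_abs]
    calc |radiusDeriv u t 0 - radiusDeriv u t' 0| * ‖dir t'‖ ≤ M * |t - t'| * 1 :=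
        mul_le_mul hlipu' (norm_dir_le_one t') (norm_nonneg _) (by positivity)
      _ = M * |t - t'| := mul_one _
  have t2 : ‖radiusDeriv u t 0 • (dir t - dir t')‖ ≤ M * |t - t'| := by
    rw [norm_smul, Real.norm_eq_abs]
    exact mul_le_mul hu'M (norm_dir_sub_le t t') (norm_nonneg _) hM0
  have t3 : ‖(u t 0 - u t' 0) • tdir t'‖ ≤ M * |t - t'| := by
    rw [norm_smul, Real.norm_eq_abs]
    calc |u t 0 - u t' 0| * ‖tdir t'‖ ≤ M * |t - t'| * 1 :=
        mul_le_mul hlipu (norm_tdir_le_one t') (norm_nonneg _) (by positivity)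
      _ = M * |t - t'| := mul_one _
  have t4 : ‖u t 0 • (tdir t - tdir t')‖ ≤ M * |t - t'| := by
    rw [norm_smul, Real.norm_eq_abs]
    exact mul_le_mul huM (norm_tdir_sub_le t t') (norm_nonneg _) hM0
  calc ‖(radiusDeriv u t 0 - radiusDeriv u t' 0) • dir t' + radiusDeriv u t 0 • (dir t - dir t') +
        (u t 0 - u t' 0) • tdir t' + u t 0 • (tdir t - tdir t')‖
      ≤ M * |t - t'| + M * |t - t'| + M * |t - t'| + M * |t - t'| :=
        norm_add_le_of_le (norm_add_le_of_le (norm_add_le_of_le t1 t2) t3) t4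
    _ = 4 * M * |t - t'| := by ring

/-- Entries of the Jacobian move by at most `8M|t - t'|` against a vector of norm `≤ 1`. [folklore] -/
private theorem entry_lipschitz (hD : DispersionHyp ε μ e₀ u) {M : ℝ} (hM0 : 0 ≤ M)
    (hM : ∀ θ e : ℝ, |e| ≤ e₀ → |u θ e| ≤ M ∧ |radiusDeriv u θ e| ≤ M ∧ |radiusDeriv₂ u θ e| ≤ M)
    {w : Fin 2 → ℝ} (hw : ‖w‖ ≤ 1) (t t' : ℝ) :
    |(radiusDeriv u t 0 • dir t + u t 0 • tdir t) ⬝ᵥ w -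
        (radiusDeriv u t' 0 • dir t' + u t' 0 • tdir t') ⬝ᵥ w| ≤ 8 * M * |t - t'| := by
  rw [← sub_dotProduct]
  calc _ ≤ 2 * ‖(radiusDeriv u t 0 • dir t + u t 0 • tdir t) -
        (radiusDeriv u t' 0 • dir t' + u t' 0 • tdir t')‖ * ‖w‖ := abs_dotProduct_le _ _
    _ ≤ 2 * (4 * M * |t - t'|) * 1 := by
        gcongr
        exact velocity_lipschitz hD hM0 hM t t'
    _ = 8 * M * |t - t'| := by ring

/-- The derivative of the (rescaled, framed) parallelogram map
`(θ₁,θ₂) ↦ ((p⃗_F(θ₁)+p⃗_F(θ₂))·w₁, (p⃗_F(θ₁)+p⃗_F(θ₂))·w₂/φ)`: columns = the velocities paired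
with `w₁`, `w₂/φ` (the matrix `J(θ₁,θ₂)` of §7.3 in the frame `(w₁, w₂)`). [cite: BenfattoGiulianiMastropietro2003, §7.3 (A1.19) p.27 (L68–74)] -/
private theorem hasFDerivAt_pairMap (hD : DispersionHyp ε μ e₀ u) (w₁ w₂ : Fin 2 → ℝ) (φ : ℝ)
    (θ : ℝ × ℝ) :
    HasFDerivAt (fun θ : ℝ × ℝ => ((fermiPoint u θ.1 + fermiPoint u θ.2) ⬝ᵥ w₁,
        ((fermiPoint u θ.1 + fermiPoint u θ.2) ⬝ᵥ w₂) / φ))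
      ((((radiusDeriv u θ.1 0 • dir θ.1 + u θ.1 0 • tdir θ.1) ⬝ᵥ w₁) •
            ContinuousLinearMap.fst ℝ ℝ ℝ +
          ((radiusDeriv u θ.2 0 • dir θ.2 + u θ.2 0 • tdir θ.2) ⬝ᵥ w₁) •
            ContinuousLinearMap.snd ℝ ℝ ℝ).prod
        ((((radiusDeriv u θ.1 0 • dir θ.1 + u θ.1 0 • tdir θ.1) ⬝ᵥ w₂) / φ) •
            ContinuousLinearMap.fst ℝ ℝ ℝ +
          (((radiusDeriv u θ.2 0 • dir θ.2 + u θ.2 0 • tdir θ.2) ⬝ᵥ w₂) / φ) •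
            ContinuousLinearMap.snd ℝ ℝ ℝ)) θ := by
  have hrow : ∀ w : Fin 2 → ℝ,
      HasFDerivAt (fun θ : ℝ × ℝ => (fermiPoint u θ.1 + fermiPoint u θ.2) ⬝ᵥ w)
        (((radiusDeriv u θ.1 0 • dir θ.1 + u θ.1 0 • tdir θ.1) ⬝ᵥ w) •
            ContinuousLinearMap.fst ℝ ℝ ℝ +
          ((radiusDeriv u θ.2 0 • dir θ.2 + u θ.2 0 • tdir θ.2) ⬝ᵥ w) •
            ContinuousLinearMap.snd ℝ ℝ ℝ) θ := by
    intro w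
    have hf1 : HasFDerivAt (fun θ : ℝ × ℝ => θ.1) (ContinuousLinearMap.fst ℝ ℝ ℝ) θ :=
      hasFDerivAt_fst
    have hf2 : HasFDerivAt (fun θ : ℝ × ℝ => θ.2) (ContinuousLinearMap.snd ℝ ℝ ℝ) θ :=
      hasFDerivAt_snd
    have h1 := (hasDerivAt_fermi_dot hD w θ.1).comp_hasFDerivAt θ hf1
    have h2 := (hasDerivAt_fermi_dot hD w θ.2).comp_hasFDerivAt θ hf2
    have h := h1.add h2
    have hfun : (fun θ : ℝ × ℝ => (fermiPoint u θ.1 + fermiPoint u θ.2) ⬝ᵥ w) =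
        fun θ : ℝ × ℝ => ((fun s => fermiPoint u s ⬝ᵥ w) ∘ fun θ : ℝ × ℝ => θ.1) θ +
          ((fun s => fermiPoint u s ⬝ᵥ w) ∘ fun θ : ℝ × ℝ => θ.2) θ := by
      funext θ'
      simp only [Function.comp, add_dotProduct]
    rw [hfun]
    exact h
  have hrow2 : HasFDerivAt (fun θ : ℝ × ℝ => ((fermiPoint u θ.1 + fermiPoint u θ.2) ⬝ᵥ w₂) / φ)
      ((((radiusDeriv u θ.1 0 • dir θ.1 + u θ.1 0 • tdir θ.1) ⬝ᵥ w₂) / φ) •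
            ContinuousLinearMap.fst ℝ ℝ ℝ +
          (((radiusDeriv u θ.2 0 • dir θ.2 + u θ.2 0 • tdir θ.2) ⬝ᵥ w₂) / φ) •
            ContinuousLinearMap.snd ℝ ℝ ℝ) θ := by
    have h := (hrow w₂).mul_const φ⁻¹
    have hfun : (fun θ : ℝ × ℝ => ((fermiPoint u θ.1 + fermiPoint u θ.2) ⬝ᵥ w₂) / φ) =
        fun θ : ℝ × ℝ => ((fermiPoint u θ.1 + fermiPoint u θ.2) ⬝ᵥ w₂) * φ⁻¹ := by
      funext θ'; rw [div_eq_mul_inv]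
    rw [hfun]
    refine h.congr_fderiv ?_
    refine ContinuousLinearMap.ext fun v => ?_
    simp
    ring
  exact (hrow w₁).prodMk hrow2

/-- **A triangular `2 × 2` system** (the shape of `J` in the frame `(τ⃗(θ̄₁), n⃗(θ̄₁)/φ)`): for
`a, d ≠ 0` the matrix `[[a, b], [0, d]]` is a continuous linear equivalence of `ℝ × ℝ` whose inverse
has (sup-)norm at most `|a|⁻¹ + |b|/(|a||d|) + |d|⁻¹` and positive. [folklore] -/
private theorem triangular_equiv {a b d : ℝ} (ha : a ≠ 0) (hd : d ≠ 0) :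
    ∃ e : (ℝ × ℝ) ≃L[ℝ] (ℝ × ℝ),
      (e : (ℝ × ℝ) →L[ℝ] (ℝ × ℝ)) =
          (a • ContinuousLinearMap.fst ℝ ℝ ℝ + b • ContinuousLinearMap.snd ℝ ℝ ℝ).prod
            (d • ContinuousLinearMap.snd ℝ ℝ ℝ) ∧
        0 < ‖(e.symm : (ℝ × ℝ) →L[ℝ] (ℝ × ℝ))‖ ∧
        ‖(e.symm : (ℝ × ℝ) →L[ℝ] (ℝ × ℝ))‖ ≤ |a|⁻¹ + |b| / (|a| * |d|) + |d|⁻¹ := by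
  set f₁ : (ℝ × ℝ) →L[ℝ] (ℝ × ℝ) :=
    (a • ContinuousLinearMap.fst ℝ ℝ ℝ + b • ContinuousLinearMap.snd ℝ ℝ ℝ).prod
      (d • ContinuousLinearMap.snd ℝ ℝ ℝ) with hf₁
  set g : (ℝ × ℝ) →L[ℝ] (ℝ × ℝ) :=
    (a⁻¹ • ContinuousLinearMap.fst ℝ ℝ ℝ + (-(b / (a * d))) • ContinuousLinearMap.snd ℝ ℝ ℝ).prod
      (d⁻¹ • ContinuousLinearMap.snd ℝ ℝ ℝ) with hg
  have hf₁v : ∀ v : ℝ × ℝ, f₁ v = (a * v.1 + b * v.2, d * v.2) := fun v => by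
    simp [hf₁]
  have hgv : ∀ v : ℝ × ℝ, g v = (a⁻¹ * v.1 + -(b / (a * d)) * v.2, d⁻¹ * v.2) := fun v => by
    simp [hg]
  have h₁ : Function.LeftInverse g f₁ := by
    intro v
    rw [hf₁v, hgv]
    ext
    · simp only
      field_simp
      ring
    · simp only
      field_simp
  have h₂ : Function.RightInverse g f₁ := by
    intro v
    rw [hgv, hf₁v]
    ext
    · simp only
      field_simp
      ring
    · simp only
      field_simp
  have hsymm : ((ContinuousLinearEquiv.equivOfInverse f₁ g h₁ h₂).symm :
      (ℝ × ℝ) →L[ℝ] (ℝ × ℝ)) = g := rfl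
  refine ⟨ContinuousLinearEquiv.equivOfInverse f₁ g h₁ h₂, rfl, ?_, ?_⟩
  · rw [hsymm]
    have h := g.le_opNorm (a, 0)
    rw [hgv] at h
    have hn1 : ‖((a⁻¹ * (a, (0:ℝ)).1 + -(b / (a * d)) * (a, (0:ℝ)).2, d⁻¹ * (a, (0:ℝ)).2) : ℝ × ℝ)‖ = 1 := by
      simp [Prod.norm_def, ha]
    have hn2 : ‖((a, 0) : ℝ × ℝ)‖ = |a| := by simp [Prod.norm_def]
    rw [hn1, hn2] at h
    have hapos : 0 < |a| := abs_pos.2 ha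
    by_contra hcon
    have : ‖g‖ = 0 := le_antisymm (not_lt.1 hcon) (norm_nonneg _)
    rw [this, zero_mul] at h
    linarith
  · rw [hsymm]
    have hK : 0 ≤ |a|⁻¹ + |b| / (|a| * |d|) + |d|⁻¹ := by positivity
    refine ContinuousLinearMap.opNorm_le_bound g hK fun v => ?_
    rw [hgv, Prod.norm_def]
    have hv1 : |v.1| ≤ ‖v‖ := by have := norm_fst_le v; rwa [Real.norm_eq_abs] at this
    have hv2 : |v.2| ≤ ‖v‖ := by have := norm_snd_le v; rwa [Real.norm_eq_abs] at this
    have hvn : 0 ≤ ‖v‖ := norm_nonneg _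
    refine max_le ?_ ?_
    · rw [Real.norm_eq_abs]
      calc |a⁻¹ * v.1 + -(b / (a * d)) * v.2| ≤ |a⁻¹ * v.1| + |-(b / (a * d)) * v.2| := abs_add_le _ _
        _ = |a|⁻¹ * |v.1| + |b| / (|a| * |d|) * |v.2| := by
            rw [abs_mul, abs_mul, abs_neg, abs_inv, abs_div, abs_mul]
        _ ≤ |a|⁻¹ * ‖v‖ + |b| / (|a| * |d|) * ‖v‖ := by gcongr
        _ ≤ (|a|⁻¹ + |b| / (|a| * |d|) + |d|⁻¹) * ‖v‖ := by
            have : 0 ≤ |d|⁻¹ * ‖v‖ := by positivity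
            nlinarith
    · rw [Real.norm_eq_abs, abs_mul, abs_inv]
      calc |d|⁻¹ * |v.2| ≤ |d|⁻¹ * ‖v‖ := by gcongr
        _ ≤ (|a|⁻¹ + |b| / (|a| * |d|) + |d|⁻¹) * ‖v‖ := by
            have : 0 ≤ (|a|⁻¹ + |b| / (|a| * |d|)) * ‖v‖ := by positivity
            nlinarith

end ParallelogramAnalysis

end BGM2003

end Literature.MathematicalPhysics.QuantumLattice.FermiRG


namespace Literature.MathematicalPhysics.QuantumLattice.FermiRG

namespace BGM2003

open Real Set Metric

section ParallelogramMain

variable {ε : (Fin 2 → ℝ) → ℝ} {μ e₀ : ℝ} {u : ℝ → ℝ → ℝ}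

/-- `‖-θ‖_{𝕋¹} = ‖θ‖_{𝕋¹}`. [folklore] -/
private theorem torusDist_neg (x : ℝ) : torusDist (-x) = torusDist x := by
  unfold torusDist
  rw [AddCircle.coe_neg, norm_neg]

/-- `φ(θ₁,θ₂) = φ(θ₂,θ₁)`. [folklore] -/
private theorem pairAngle_comm (θ₁ θ₂ : ℝ) : pairAngle θ₁ θ₂ = pairAngle θ₂ θ₁ := by
  rw [pairAngle, pairAngle, ← torusDist_neg (θ₁ - θ₂), neg_sub]

/-- `φ ≤ π/2` and `φ ≤ ‖θ₁ - θ₂‖ ≤ π - φ`. [folklore] -/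
private theorem pairAngle_le (θ₁ θ₂ : ℝ) :
    pairAngle θ₁ θ₂ ≤ π / 2 ∧ pairAngle θ₁ θ₂ ≤ torusDist (θ₁ - θ₂) ∧
      torusDist (θ₁ - θ₂) ≤ π - pairAngle θ₁ θ₂ := by
  refine ⟨?_, min_le_left _ _, ?_⟩
  · rw [pairAngle]
    rcases le_or_gt (torusDist (θ₁ - θ₂)) (π / 2) with h | h
    · exact (min_le_left _ _).trans h
    · exact (min_le_right _ _).trans (by linarith)
  · have := min_le_right (torusDist (θ₁ - θ₂)) (π - torusDist (θ₁ - θ₂))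
    rw [pairAngle]; linarith

/-- On `𝒯 = {sin(θ₁ - θ₂) ≠ 0}` the angle `φ` is positive. [cite: BenfattoGiulianiMastropietro2003, §7.3 (A1.20), (s1.16) p.27 (L78–97)] -/
private theorem pairAngle_pos {θ₁ θ₂ : ℝ} (h : (θ₁, θ₂) ∈ pairChartDomain) : 0 < pairAngle θ₁ θ₂ := by
  have hsin : Real.sin (θ₁ - θ₂) ≠ 0 := h
  obtain ⟨k, hk⟩ : ∃ k : ℤ, torusDist (θ₁ - θ₂) = |θ₁ - θ₂ - k * (2 * π)| :=
    ⟨_, torusDist_eq_abs_sub_round _⟩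
  set dt := θ₁ - θ₂ - k * (2 * π) with hdt
  have hdtπ : |dt| ≤ π := by rw [← hk]; exact torusDist_le_pi _
  have hsin' : Real.sin dt ≠ 0 := by
    have : θ₁ - θ₂ = dt + k * (2 * π) := by rw [hdt]; ring
    rwa [this, Real.sin_add_int_mul_two_pi] at hsin
  rw [pairAngle, hk]
  refine lt_min ?_ ?_
  · rcases (abs_nonneg dt).lt_or_eq with hpos | hzero
    · exact hpos
    · exfalso; apply hsin'
      rw [abs_eq_zero.1 hzero.symm, Real.sin_zero]
  · rcases hdtπ.lt_or_eq with hlt | heq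
    · linarith
    · exfalso; apply hsin'
      rcases le_or_gt 0 dt with hnn | hneg
      · rw [abs_of_nonneg hnn] at heq; rw [heq, Real.sin_pi]
      · rw [abs_of_neg hneg] at heq
        rw [show dt = -π by linarith, Real.sin_neg, Real.sin_pi, neg_zero]

/-! #### (i): a chord sum `p⃗_F(θ₁) + p⃗_F(θ₂)`, `θ₁ ≢ θ₂, θ₂ + π`, lies in `𝒟` -/

/-- **`F` maps `𝒯` into `𝒟`** (§7.3, p.27 L81–89): for `θ₁ ≢ θ₂` and `θ₁ ≢ θ₂ + π (mod 2π)`,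
`p⃗_F(θ₁) + p⃗_F(θ₂) = ρe⃗_r(ψ)` with `0 < ρ < 2u(ψ)` — the midpoint of a proper chord of the strictly
convex curve `Σ_F` is an interior point (support-function gap), and the sum vanishes only for
antipodal pairs ((A1.4)). [cite: BenfattoGiulianiMastropietro2003, §7.3 (A1.19)–(A1.21) p.27 (L68–89)] -/
private theorem chord_sum_mem_pairRange (hD : DispersionHyp ε μ e₀ u) {cu a₁ a₂ : ℝ} (hcu : 0 < cu)
    (hu : ∀ θ e : ℝ, |e| ≤ e₀ → cu ≤ u θ e) (ha₁ : 0 < a₁) (ha₂ : 1 ≤ a₂)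
    (hslope : ∀ x y : ℝ, x ≤ y → a₁ * (y - x) ≤ normalAngle u y 0 - normalAngle u x 0 ∧
        normalAngle u y 0 - normalAngle u x 0 ≤ a₂ * (y - x))
    (θ₁ θ₂ : ℝ) (hne : 0 < torusDist (θ₁ - θ₂)) (hne' : torusDist (θ₁ - θ₂) < π) :
    fermiPoint u θ₁ + fermiPoint u θ₂ ∈ pairRange u := by
  have h0 : |(0 : ℝ)| ≤ e₀ := by rw [abs_zero]; exact hD.e₀_pos.le
  have hupos : ∀ s, 0 < u s 0 := fun s => lt_of_lt_of_le hcu (hu s 0 h0)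
  set m := fermiPoint u θ₁ + fermiPoint u θ₂ with hm
  -- (α) `m ≠ 0`: otherwise `p⃗_F(θ₁) = -p⃗_F(θ₂) = p⃗_F(θ₂ + π)`, so `θ₁ ≡ θ₂ + π`
  have hm0 : m ≠ 0 := by
    intro hzero
    have h1 : u θ₁ 0 • dir θ₁ = u (θ₂ + π) 0 • dir (θ₂ + π) := by
      have hanti : dir (θ₂ + π) = -dir θ₂ := by
        ext i; fin_cases i <;> simp [dir, Real.cos_add_pi, Real.sin_add_pi]
      rw [hD.antipodal θ₂ 0 h0, hanti, smul_neg]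
      have : fermiPoint u θ₁ = -fermiPoint u θ₂ := eq_neg_of_add_eq_zero_left hzero
      simpa [fermiPoint, levelPoint] using this
    obtain ⟨-, k, hk⟩ := polar_unique (hupos θ₁) (hupos (θ₂ + π)) h1
    have : torusDist (θ₁ - θ₂) = π := by
      have h2 : θ₁ - θ₂ = π + k * (2 * π) := by linarith
      rw [h2, torusDist_add_int_mul, torusDist_eq_abs (by rw [abs_of_pos pi_pos]), abs_of_pos pi_pos]
    linarith
  -- (β) polar form of `m`
  set z : ℂ := ⟨m 0, m 1⟩ with hz
  have hz0 : z ≠ 0 := by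
    intro hz'
    apply hm0
    ext i; fin_cases i
    · simpa [hz] using congrArg Complex.re hz'
    · simpa [hz] using congrArg Complex.im hz'
  set ρ' := ‖z‖ with hρ'
  set ψ := Complex.arg z with hψ
  have hρ'pos : 0 < ρ' := norm_pos_iff.2 hz0
  have hmeq : m = ρ' • dir ψ := by
    have hre : ρ' * Real.cos ψ = m 0 := Complex.norm_mul_cos_arg z
    have him : ρ' * Real.sin ψ = m 1 := Complex.norm_mul_sin_arg z
    ext i; fin_cases i
    · exact hre.symm.trans (smul_dir_apply_zero ρ' ψ).symm
    · exact him.symm.trans (smul_dir_apply_one ρ' ψ).symm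
  -- (γ) `ρ' < 2u(ψ)` from the support gap in direction `n⃗(ψ)`
  have hsψ : 0 < speed u ψ 0 := lt_of_lt_of_le (hupos ψ) (le_speed u ψ 0 (hupos ψ).le)
  obtain ⟨hdn, -⟩ := dir_dot_unitNormal u ψ 0
  have hκ : 0 < (speed u ψ 0)⁻¹ * u ψ 0 := mul_pos (inv_pos.2 hsψ) (hupos ψ)
  have hF₁ := support_gap_neg hD hcu hu ha₁ ha₂ hslope ψ θ₁
  have hF₂ := support_gap_neg hD hcu hu ha₁ ha₂ hslope ψ θ₂
  have hsum : (fermiPoint u θ₁ - fermiPoint u ψ) ⬝ᵥ unitNormal u ψ 0 +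
      (fermiPoint u θ₂ - fermiPoint u ψ) ⬝ᵥ unitNormal u ψ 0 < 0 := by
    have hn₁ : 0 ≤ torusDist (θ₁ - ψ) := norm_nonneg _
    have hn₂ : 0 ≤ torusDist (θ₂ - ψ) := norm_nonneg _
    rcases hn₁.lt_or_eq with h1 | h1
    · linarith [hF₁.2 h1, hF₂.1]
    · rcases hn₂.lt_or_eq with h2 | h2
      · linarith [hF₂.2 h2, hF₁.1]
      · exfalso
        have htri : torusDist (θ₁ - θ₂) ≤ torusDist (θ₁ - ψ) + torusDist (-(θ₂ - ψ)) := by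
          have : θ₁ - θ₂ = (θ₁ - ψ) + (-(θ₂ - ψ)) := by ring
          rw [this]; exact torusDist_add_le _ _
        rw [torusDist_neg, ← h1, ← h2, add_zero] at htri
        linarith
  have hmn : m ⬝ᵥ unitNormal u ψ 0 = ρ' * ((speed u ψ 0)⁻¹ * u ψ 0) := by
    rw [hmeq, smul_dotProduct, smul_eq_mul, hdn]
  have hpn : fermiPoint u ψ ⬝ᵥ unitNormal u ψ 0 = u ψ 0 * ((speed u ψ 0)⁻¹ * u ψ 0) := by
    rw [fermiPoint, levelPoint, smul_dotProduct, smul_eq_mul, hdn]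
  have hexp : m ⬝ᵥ unitNormal u ψ 0 = 2 * (fermiPoint u ψ ⬝ᵥ unitNormal u ψ 0) +
      ((fermiPoint u θ₁ - fermiPoint u ψ) ⬝ᵥ unitNormal u ψ 0 +
        (fermiPoint u θ₂ - fermiPoint u ψ) ⬝ᵥ unitNormal u ψ 0) := by
    rw [hm, add_dotProduct, sub_dotProduct, sub_dotProduct]; ring
  have hlt : ρ' < 2 * u ψ 0 := by
    have h1 : ρ' * ((speed u ψ 0)⁻¹ * u ψ 0) < 2 * u ψ 0 * ((speed u ψ 0)⁻¹ * u ψ 0) := by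
      rw [← hmn, hexp, hpn]; nlinarith
    exact lt_of_mul_lt_mul_right h1 hκ.le
  exact ⟨ρ', ψ, hρ'pos, hlt, hmeq⟩

/-! #### (ii): the quantitative inverse function theorem in the frame `(τ⃗(θ̄₁), n⃗(θ̄₁)/φ)` -/

/-- **Dini step, quantitative and uniform in `φ`** (proof of Lemma 7.5): in the frame
`(τ⃗(θ̄₁), n⃗(θ̄₁)/φ)` the Jacobian of `(θ₁,θ₂) ↦ p⃗_F(θ₁) + p⃗_F(θ₂)` at `θ̄` is triangular
`[[s'₁, s'₂cos(α₂-α₁)], [0, -s'₂ sin(α₂-α₁)/φ]]` with `|s'₂ sin(α₂-α₁)|/φ ≥ c_u (2/π) a₁` (Lemma 7.1),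
hence boundedly invertible UNIFORMLY in `φ`, while on the ball of radius `ρ` about `θ̄` it moves by at
most `16M(1 + 1/φ)ρ`; so if `16M(1+1/φ)ρ ≤ K⁻¹/2` every target within `K⁻¹ρ/2` of the image of `θ̄` is
attained in the ball (Mathlib's `ApproximatesLinearOn.surjOn_closedBall_of_nonlinearRightInverse`).
[cite: BenfattoGiulianiMastropietro2003, §7.3 Lemma 7.5 proof (s1.19)–(s1.19a) p.27 (L110–143)] -/
private theorem pair_surj (hD : DispersionHyp ε μ e₀ u) {cu M a₁ a₂ : ℝ} (hcu : 0 < cu)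
    (hu : ∀ θ e : ℝ, |e| ≤ e₀ → cu ≤ u θ e) (hM0 : 0 ≤ M)
    (hM : ∀ θ e : ℝ, |e| ≤ e₀ → |u θ e| ≤ M ∧ |radiusDeriv u θ e| ≤ M ∧ |radiusDeriv₂ u θ e| ≤ M)
    (ha₁ : 0 < a₁)
    (hslope : ∀ x y : ℝ, x ≤ y → a₁ * (y - x) ≤ normalAngle u y 0 - normalAngle u x 0 ∧
        normalAngle u y 0 - normalAngle u x 0 ≤ a₂ * (y - x))
    (θb : ℝ × ℝ) (hφ : 0 < pairAngle θb.1 θb.2) {ρ : ℝ} (hρ : 0 ≤ ρ)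
    (hsmall : 16 * M * (1 + (pairAngle θb.1 θb.2)⁻¹) * ρ ≤
      (cu⁻¹ + 4 * M / (cu * (cu * (2 / π * a₁))) + (cu * (2 / π * a₁))⁻¹)⁻¹ / 2)
    (y : ℝ × ℝ)
    (hy : dist y (((fermiPoint u θb.1 + fermiPoint u θb.2) ⬝ᵥ unitTangent u θb.1 0,
        ((fermiPoint u θb.1 + fermiPoint u θb.2) ⬝ᵥ unitNormal u θb.1 0) / pairAngle θb.1 θb.2)) ≤
      (cu⁻¹ + 4 * M / (cu * (cu * (2 / π * a₁))) + (cu * (2 / π * a₁))⁻¹)⁻¹ / 2 * ρ) :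
    ∃ θ : ℝ × ℝ, dist θ θb ≤ ρ ∧
      (fermiPoint u θ.1 + fermiPoint u θ.2) ⬝ᵥ unitTangent u θb.1 0 = y.1 ∧
        ((fermiPoint u θ.1 + fermiPoint u θ.2) ⬝ᵥ unitNormal u θb.1 0) / pairAngle θb.1 θb.2 =
          y.2 := by
  have h0 : |(0 : ℝ)| ≤ e₀ := by rw [abs_zero]; exact hD.e₀_pos.le
  have hupos : ∀ s, 0 < u s 0 := fun s => lt_of_lt_of_le hcu (hu s 0 h0)
  set φ := pairAngle θb.1 θb.2 with hφdef
  set τb := unitTangent u θb.1 0 with hτb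
  set nb := unitNormal u θb.1 0 with hnb
  set d₀ := cu * (2 / π * a₁) with hd₀
  have hd₀pos : 0 < d₀ := by positivity
  set K := cu⁻¹ + 4 * M / (cu * d₀) + d₀⁻¹ with hKdef
  have hKpos : 0 < K := by positivity
  have hsθb : 0 < speed u θb.1 0 := lt_of_lt_of_le (hupos θb.1) (le_speed u θb.1 0 (hupos θb.1).le)
  have hτ1 : ‖τb‖ ≤ 1 := norm_unitTangent_le hsθb
  have hn1 : ‖nb‖ ≤ 1 := norm_unitNormal_le hsθb
  -- the map, its derivative and the entries of the Jacobian
  set f : ℝ × ℝ → ℝ × ℝ := fun θ => ((fermiPoint u θ.1 + fermiPoint u θ.2) ⬝ᵥ τb,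
    ((fermiPoint u θ.1 + fermiPoint u θ.2) ⬝ᵥ nb) / φ) with hfdef
  set A : ℝ → ℝ := fun t => (radiusDeriv u t 0 • dir t + u t 0 • tdir t) ⬝ᵥ τb with hAdef
  set C : ℝ → ℝ := fun t => (radiusDeriv u t 0 • dir t + u t 0 • tdir t) ⬝ᵥ nb with hCdef
  set Df : ℝ × ℝ → ((ℝ × ℝ) →L[ℝ] (ℝ × ℝ)) := fun θ =>
    (A θ.1 • ContinuousLinearMap.fst ℝ ℝ ℝ + A θ.2 • ContinuousLinearMap.snd ℝ ℝ ℝ).prod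
      ((C θ.1 / φ) • ContinuousLinearMap.fst ℝ ℝ ℝ + (C θ.2 / φ) • ContinuousLinearMap.snd ℝ ℝ ℝ)
    with hDfdef
  have hfder : ∀ θ : ℝ × ℝ, HasFDerivAt f (Df θ) θ := fun θ => hasFDerivAt_pairMap hD τb nb φ θ
  have hDfv : ∀ (θ : ℝ × ℝ) (v : ℝ × ℝ),
      Df θ v = (A θ.1 * v.1 + A θ.2 * v.2, C θ.1 / φ * v.1 + C θ.2 / φ * v.2) := fun θ v => by
    simp [hDfdef]
  -- the Jacobian at `θb`: `a = s'₁`, `c = 0`, `|b| ≤ 4M`, `|d| ≥ d₀`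
  have hvel₁ := velocity_eq hsθb
  have ha : A θb.1 = speed u θb.1 0 := by
    simp only [hAdef]
    rw [hvel₁, smul_dotProduct, smul_eq_mul, hτb, tangent_dot_tangent (hupos θb.1) (hupos θb.1),
      sub_self, Real.cos_zero, mul_one]
  have hc : C θb.1 = 0 := by
    simp only [hCdef]
    rw [hvel₁, smul_dotProduct, smul_eq_mul, hnb, tangent_dot_normal (hupos θb.1) (hupos θb.1),
      sub_self, Real.sin_zero, neg_zero, mul_zero]
  have hb : |A θb.2| ≤ 4 * M := by
    simp only [hAdef]
    obtain ⟨huM, hu'M, -⟩ := hM θb.2 0 h0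
    have hv : ‖radiusDeriv u θb.2 0 • dir θb.2 + u θb.2 0 • tdir θb.2‖ ≤ 2 * M := by
      refine (norm_add_le _ _).trans ?_
      rw [norm_smul, norm_smul, Real.norm_eq_abs, Real.norm_eq_abs]
      calc |radiusDeriv u θb.2 0| * ‖dir θb.2‖ + |u θb.2 0| * ‖tdir θb.2‖ ≤ M * 1 + M * 1 :=
          add_le_add (mul_le_mul hu'M (norm_dir_le_one _) (norm_nonneg _) hM0)
            (mul_le_mul huM (norm_tdir_le_one _) (norm_nonneg _) hM0)
        _ = 2 * M := by ring
    calc _ ≤ 2 * ‖radiusDeriv u θb.2 0 • dir θb.2 + u θb.2 0 • tdir θb.2‖ * ‖τb‖ := abs_dotProduct_le _ _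
      _ ≤ 2 * (2 * M) * 1 := by gcongr
      _ = 4 * M := by ring
  have hsθb2 : 0 < speed u θb.2 0 := lt_of_lt_of_le (hupos θb.2) (le_speed u θb.2 0 (hupos θb.2).le)
  have hd : d₀ ≤ |C θb.2 / φ| := by
    simp only [hCdef]
    rw [velocity_eq hsθb2, smul_dotProduct, smul_eq_mul, hnb,
      tangent_dot_normal (hupos θb.2) (hupos θb.1), mul_neg, abs_div, abs_neg, abs_mul,
      abs_of_pos hsθb2, abs_of_pos hφ]
    have hsin := sin_normalAngle_sub_ge hD ha₁ hslope θb.2 θb.1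
    rw [pairAngle_comm] at hsin
    rw [le_div_iff₀ hφ, hd₀]
    calc cu * (2 / π * a₁) * φ = cu * (2 / π * a₁ * φ) := by ring
      _ ≤ speed u θb.2 0 * |Real.sin (normalAngle u θb.2 0 - normalAngle u θb.1 0)| :=
          mul_le_mul ((hu θb.2 0 h0).trans (le_speed u θb.2 0 (hupos θb.2).le)) hsin
            (by positivity) hsθb2.le
  have ha0 : A θb.1 ≠ 0 := by rw [ha]; exact hsθb.ne'
  have hdne : C θb.2 / φ ≠ 0 := fun h => by rw [h, abs_zero] at hd; linarith
  -- the linear equivalence and the norm of its inverse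
  obtain ⟨e, he, hepos, hele⟩ := triangular_equiv (b := A θb.2) ha0 hdne
  have hK' : |A θb.1|⁻¹ + |A θb.2| / (|A θb.1| * |C θb.2 / φ|) + |C θb.2 / φ|⁻¹ ≤ K := by
    have h1 : cu ≤ |A θb.1| := by
      rw [ha, abs_of_pos hsθb]; exact (hu θb.1 0 h0).trans (le_speed u θb.1 0 (hupos θb.1).le)
    have h2 : |A θb.1|⁻¹ ≤ cu⁻¹ := inv_anti₀ hcu h1
    have h3 : |C θb.2 / φ|⁻¹ ≤ d₀⁻¹ := inv_anti₀ hd₀pos hd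
    have h4 : |A θb.2| / (|A θb.1| * |C θb.2 / φ|) ≤ 4 * M / (cu * d₀) := by
      have hden : 0 < cu * d₀ := by positivity
      calc |A θb.2| / (|A θb.1| * |C θb.2 / φ|) ≤ |A θb.2| / (cu * d₀) := by
            apply div_le_div_of_nonneg_left (abs_nonneg _) hden
            exact mul_le_mul h1 hd hd₀pos.le (abs_nonneg _)
        _ ≤ 4 * M / (cu * d₀) := div_le_div_of_nonneg_right hb hden.le
    rw [hKdef]; linarith
  have hnn : ((e.toNonlinearRightInverse).nnnorm : ℝ) = ‖(e.symm : (ℝ × ℝ) →L[ℝ] (ℝ × ℝ))‖ := rfl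
  have hnnpos : 0 < ((e.toNonlinearRightInverse).nnnorm : ℝ) := by rw [hnn]; exact hepos
  have hnnK : ((e.toNonlinearRightInverse).nnnorm : ℝ) ≤ K := by rw [hnn]; exact hele.trans hK'
  have hinvK : K⁻¹ ≤ ((e.toNonlinearRightInverse).nnnorm : ℝ)⁻¹ := inv_anti₀ hnnpos hnnK
  -- the Jacobian at `θb` IS `e`
  have hDfb : Df θb = (e : (ℝ × ℝ) →L[ℝ] (ℝ × ℝ)) := by
    rw [he]
    simp only [hDfdef]
    rw [hc, zero_div, zero_smul, zero_add]
  -- Lipschitz bound of the Jacobian on the ball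
  set cst : ℝ := 16 * M * (1 + φ⁻¹) * ρ with hcst
  have hcst0 : 0 ≤ cst := by positivity
  have hbound : ∀ z ∈ closedBall θb ρ, ‖Df z - Df θb‖ ≤ cst := by
    intro z hz
    rw [mem_closedBall, Prod.dist_eq] at hz
    have hz1 : |z.1 - θb.1| ≤ ρ := by have := (le_max_left _ _).trans hz; rwa [Real.dist_eq] at this
    have hz2 : |z.2 - θb.2| ≤ ρ := by have := (le_max_right _ _).trans hz; rwa [Real.dist_eq] at this
    have eA1 : |A z.1 - A θb.1| ≤ 8 * M * ρ :=
      (entry_lipschitz hD hM0 hM hτ1 z.1 θb.1).trans (by gcongr)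
    have eA2 : |A z.2 - A θb.2| ≤ 8 * M * ρ :=
      (entry_lipschitz hD hM0 hM hτ1 z.2 θb.2).trans (by gcongr)
    have eC1 : |C z.1 / φ - C θb.1 / φ| ≤ 8 * M * ρ * φ⁻¹ := by
      rw [← sub_div, abs_div, abs_of_pos hφ, div_eq_mul_inv]
      exact mul_le_mul_of_nonneg_right ((entry_lipschitz hD hM0 hM hn1 z.1 θb.1).trans (by gcongr))
        (by positivity)
    have eC2 : |C z.2 / φ - C θb.2 / φ| ≤ 8 * M * ρ * φ⁻¹ := by
      rw [← sub_div, abs_div, abs_of_pos hφ, div_eq_mul_inv]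
      exact mul_le_mul_of_nonneg_right ((entry_lipschitz hD hM0 hM hn1 z.2 θb.2).trans (by gcongr))
        (by positivity)
    refine ContinuousLinearMap.opNorm_le_bound _ hcst0 fun v => ?_
    rw [show (Df z - Df θb) v = Df z v - Df θb v from rfl, hDfv, hDfv, Prod.mk_sub_mk,
      Prod.norm_def]
    have hv1 : |v.1| ≤ ‖v‖ := by have := norm_fst_le v; rwa [Real.norm_eq_abs] at this
    have hv2 : |v.2| ≤ ‖v‖ := by have := norm_snd_le v; rwa [Real.norm_eq_abs] at this
    have hvn : 0 ≤ ‖v‖ := norm_nonneg _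
    have hφinv : 0 ≤ φ⁻¹ := by positivity
    refine max_le ?_ ?_
    · rw [Real.norm_eq_abs]
      have : A z.1 * v.1 + A z.2 * v.2 - (A θb.1 * v.1 + A θb.2 * v.2) =
          (A z.1 - A θb.1) * v.1 + (A z.2 - A θb.2) * v.2 := by ring
      rw [this]
      calc |(A z.1 - A θb.1) * v.1 + (A z.2 - A θb.2) * v.2|
          ≤ |A z.1 - A θb.1| * |v.1| + |A z.2 - A θb.2| * |v.2| := by
            rw [← abs_mul, ← abs_mul]; exact abs_add_le _ _
        _ ≤ 8 * M * ρ * ‖v‖ + 8 * M * ρ * ‖v‖ := by gcongr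
        _ ≤ cst * ‖v‖ := by
            rw [hcst]
            have h' : 0 ≤ 16 * M * φ⁻¹ * ρ * ‖v‖ := by positivity
            linarith only [h']
    · rw [Real.norm_eq_abs]
      have : C z.1 / φ * v.1 + C z.2 / φ * v.2 - (C θb.1 / φ * v.1 + C θb.2 / φ * v.2) =
          (C z.1 / φ - C θb.1 / φ) * v.1 + (C z.2 / φ - C θb.2 / φ) * v.2 := by ring
      rw [this]
      calc |(C z.1 / φ - C θb.1 / φ) * v.1 + (C z.2 / φ - C θb.2 / φ) * v.2|
          ≤ |C z.1 / φ - C θb.1 / φ| * |v.1| + |C z.2 / φ - C θb.2 / φ| * |v.2| := by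
            rw [← abs_mul, ← abs_mul]; exact abs_add_le _ _
        _ ≤ 8 * M * ρ * φ⁻¹ * ‖v‖ + 8 * M * ρ * φ⁻¹ * ‖v‖ := by gcongr
        _ ≤ cst * ‖v‖ := by
            rw [hcst]
            have h' : 0 ≤ 16 * M * ρ * ‖v‖ := by positivity
            linarith only [h']
  -- `f` is approximated by `e` on the ball
  have happrox : ApproximatesLinearOn f (e : (ℝ × ℝ) →L[ℝ] (ℝ × ℝ)) (closedBall θb ρ)
      ⟨cst, hcst0⟩ := by
    intro x hx y' hy'
    rw [← hDfb]
    exact (convex_closedBall θb ρ).norm_image_sub_le_of_norm_hasFDerivWithin_le'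
      (fun z _ => (hfder z).hasFDerivWithinAt) hbound hy' hx
  have hsurj := happrox.surjOn_closedBall_of_nonlinearRightInverse e.toNonlinearRightInverse hρ
    (Subset.refl _)
  -- the target lies in the guaranteed ball
  have hrad : K⁻¹ / 2 * ρ ≤ (((e.toNonlinearRightInverse).nnnorm : ℝ)⁻¹ - (⟨cst, hcst0⟩ : NNReal)) * ρ := by
    apply mul_le_mul_of_nonneg_right _ hρ
    have hc : cst ≤ K⁻¹ / 2 := by rw [hcst, hKdef, hd₀]; exact hsmall
    show K⁻¹ / 2 ≤ ((e.toNonlinearRightInverse).nnnorm : ℝ)⁻¹ - cst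
    linarith
  have hy' : y ∈ closedBall (f θb) ((((e.toNonlinearRightInverse).nnnorm : ℝ)⁻¹ -
      (⟨cst, hcst0⟩ : NNReal)) * ρ) := by
    rw [mem_closedBall]
    refine le_trans ?_ hrad
    have hKe : K = cu⁻¹ + 4 * M / (cu * (cu * (2 / π * a₁))) + (cu * (2 / π * a₁))⁻¹ := by
      rw [hKdef, hd₀]
    rw [hKe]
    exact hy
  obtain ⟨θ, hθ, hfθ⟩ := hsurj hy'
  exact ⟨θ, mem_closedBall.1 hθ, congrArg Prod.fst hfθ, congrArg Prod.snd hfθ⟩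

end ParallelogramMain

end BGM2003

end Literature.MathematicalPhysics.QuantumLattice.FermiRG


namespace Literature.MathematicalPhysics.QuantumLattice.FermiRG

namespace BGM2003

open Real Set Metric

/-- **BGM 2003 Lemma 7.5 [lms1.5] — the parallelogram lemma (s1.16)–(s1.18), PROVED** (discharges
the named fact `lemma75_parallelogram`), following §7.3: the map `F(θ₁,θ₂) = p⃗_F(θ₁) + p⃗_F(θ₂)`
(A1.19) has Jacobian columns `s'(θᵢ)τ⃗(θᵢ)` whose determinant is `∝ sin(α₁ - α₂) ≍ φ` (Lemma 7.1,
`sin_normalAngle_sub_ge`); in the rescaled frame `(τ⃗(θ̄₁), n⃗(θ̄₁)/φ)` — the printed substitution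
`r₁ = ηφ r̃₁, r₂ = η r̃₂, δᵢ = η xᵢ` of (s1.19a) — the system is triangular and boundedly invertible
uniformly in `φ`, the second-order terms are `O(c₂)` (`16M(1+1/φ)ρ` with `ρ = c₀η ≤ c₀c₂φ`), and
the Dini/implicit-function step is Mathlib's quantitative surjectivity for maps approximating an
invertible linear map (`pair_surj`); this yields `θᵢ` with `|θᵢ - θ̄ᵢ| ≤ c₀η`, `c₀ = 2(1+c₁)K`, for
`η ≤ c₂φ`. The membership `b⃗ + r⃗ = p⃗_F(θ₁) + p⃗_F(θ₂) ∈ 𝒟` is the chord-midpoint property of the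
strictly convex curve (`chord_sum_mem_pairRange`), `θ₁ ≢ θ₂, θ₂+π` because `|θᵢ - θ̄ᵢ| ≤ φ/4`. As typed,
`η₀` is not needed beyond `η ≤ c₂φ` (we take `η₀ = 1`). [cite: BenfattoGiulianiMastropietro2003, §7.3 Lemma 7.5 (s1.16)–(s1.19a) p.27 (L68–143)] -/
theorem lemma75_parallelogram_holds : lemma75_parallelogram := by
  intro ε μ e₀ u hD cr hcr
  obtain ⟨cu, hcu, hu⟩ := hD.u_pos
  obtain ⟨cκ, hcκ, hκ⟩ := hD.convex
  obtain ⟨M, hM0, hM⟩ := uniform_bounds hD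
  have h0 : |(0 : ℝ)| ≤ e₀ := by rw [abs_zero]; exact hD.e₀_pos.le
  have hupos : ∀ s, 0 < u s 0 := fun s => lt_of_lt_of_le hcu (hu s 0 h0)
  -- Lemma 7.1's slope constants at `e = 0`
  set a₁ := cκ * cu with ha₁def
  set a₂ := 2 + M ^ 2 / cu ^ 2 with ha₂def
  have ha₁ : 0 < a₁ := by positivity
  have ha₂ : 1 ≤ a₂ := by
    have : 0 ≤ M ^ 2 / cu ^ 2 := by positivity
    linarith
  have hslope : ∀ x y : ℝ, x ≤ y → a₁ * (y - x) ≤ normalAngle u y 0 - normalAngle u x 0 ∧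
      normalAngle u y 0 - normalAngle u x 0 ≤ a₂ * (y - x) :=
    fun x y hxy => normalAngle_slope hD hcu hu hcκ hκ hM0 hM h0 hxy
  -- the constants
  set K := cu⁻¹ + 4 * M / (cu * (cu * (2 / π * a₁))) + (cu * (2 / π * a₁))⁻¹ with hKdef
  have hKpos : 0 < K := by positivity
  have hK0 : K ≠ 0 := hKpos.ne'
  set c₀ := 2 * (1 + cr) * K with hc₀def
  have hc₀pos : 0 < c₀ := by positivity
  set D := 4 * c₀ + 64 * M * (π + 1) * c₀ * K + 1 with hDdef
  have hDpos : 0 < D := by positivity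
  set c₂ := 1 / D with hc₂def
  have hc₂pos : 0 < c₂ := by positivity
  refine ⟨c₀, c₂, 1, hc₀pos, hc₂pos, one_pos, ?_⟩
  intro θ₁' θ₂' η r₁ r₂ hT hr₁ hr₂ hηφ _hη1
  -- the angle `φ`
  set φ := pairAngle θ₁' θ₂' with hφdef
  have hφpos : 0 < φ := pairAngle_pos hT
  obtain ⟨hφle2, hφleT, hTleφ⟩ := pairAngle_le θ₁' θ₂'
  have hη0 : 0 ≤ η := (abs_nonneg r₂).trans hr₂
  -- `ρ = c₀ η` and the two smallness facts `ρ ≤ φ/4`, `16M(1 + φ⁻¹)ρ ≤ K⁻¹/2`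
  set ρ := c₀ * η with hρdef
  have hρ0 : 0 ≤ ρ := by positivity
  have hρφ : ρ ≤ c₀ * c₂ * φ :=
    calc ρ = c₀ * η := hρdef
      _ ≤ c₀ * (c₂ * φ) := mul_le_mul_of_nonneg_left hηφ hc₀pos.le
      _ = c₀ * c₂ * φ := (mul_assoc _ _ _).symm
  have hc₂4 : c₀ * c₂ * 4 ≤ 1 := by
    have h1 : c₀ * c₂ * 4 = (4 * c₀) / D := by rw [hc₂def]; ring
    rw [h1, div_le_one hDpos, hDdef]
    have : 0 ≤ 64 * M * (π + 1) * c₀ * K := by positivity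
    linarith
  have hρφ4 : ρ ≤ φ / 4 := by
    have h1 := mul_le_mul_of_nonneg_right hc₂4 hφpos.le
    have : c₀ * c₂ * φ ≤ φ / 4 := by linarith
    exact hρφ.trans this
  have hsmall : 16 * M * (1 + φ⁻¹) * ρ ≤ K⁻¹ / 2 := by
    have h1 : 16 * M * (1 + φ⁻¹) * ρ ≤ 16 * M * (1 + φ⁻¹) * (c₀ * c₂ * φ) :=
      mul_le_mul_of_nonneg_left hρφ (by positivity)
    have hφ1 : (1 + φ⁻¹) * φ = φ + 1 := by rw [add_mul, one_mul, inv_mul_cancel₀ hφpos.ne']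
    have h2 : 16 * M * (1 + φ⁻¹) * (c₀ * c₂ * φ) = 16 * M * c₀ * c₂ * (φ + 1) := by
      rw [← hφ1]; ring
    have h3 : 16 * M * c₀ * c₂ * (φ + 1) ≤ 16 * M * c₀ * c₂ * (π + 1) := by
      have : φ ≤ π := by linarith [pi_pos]
      gcongr
    have h4 : 16 * M * c₀ * c₂ * (π + 1) ≤ K⁻¹ / 4 := by
      have e1 : 16 * M * c₀ * c₂ * (π + 1) = (16 * M * c₀ * (π + 1)) / D := by rw [hc₂def]; ring
      rw [e1, div_le_iff₀ hDpos, hDdef]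
      have e2 : K⁻¹ / 4 * (4 * c₀ + 64 * M * (π + 1) * c₀ * K + 1) =
          K⁻¹ / 4 * (4 * c₀ + 1) + 16 * M * c₀ * (π + 1) * (K⁻¹ * K) := by ring
      rw [e2, inv_mul_cancel₀ hK0, mul_one]
      have : 0 ≤ K⁻¹ / 4 * (4 * c₀ + 1) := by positivity
      linarith
    have hK4 : K⁻¹ / 4 ≤ K⁻¹ / 2 := by
      have : 0 ≤ K⁻¹ := by positivity
      linarith
    linarith
  -- the frame at `θ̄₁`
  have hs₁ : 0 < speed u θ₁' 0 := lt_of_lt_of_le (hupos θ₁') (le_speed u θ₁' 0 (hupos θ₁').le)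
  set τb := unitTangent u θ₁' 0 with hτb
  set nb := unitNormal u θ₁' 0 with hnb
  have hnn : nb ⬝ᵥ nb = 1 := normal_dot_normal (hupos θ₁')
  have hττ : τb ⬝ᵥ τb = 1 := by
    rw [hτb, tangent_dot_tangent (hupos θ₁') (hupos θ₁'), sub_self, Real.cos_zero]
  have hnτ : nb ⬝ᵥ τb = 0 := normal_dot_tangent (hupos θ₁')
  have hτn : τb ⬝ᵥ nb = 0 := by rw [dotProduct_comm]; exact hnτ
  -- the data `b⃗`, `r⃗` and the target `y`
  set b := fermiPoint u θ₁' + fermiPoint u θ₂' with hbdef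
  set r := r₁ • nb + r₂ • τb with hrdef
  have hrτ : r ⬝ᵥ τb = r₂ := by
    rw [hrdef, add_dotProduct, smul_dotProduct, smul_dotProduct, hnτ, hττ, smul_eq_mul, smul_eq_mul]
    ring
  have hrn : r ⬝ᵥ nb = r₁ := by
    rw [hrdef, add_dotProduct, smul_dotProduct, smul_dotProduct, hnn, hτn, smul_eq_mul, smul_eq_mul]
    ring
  set y : ℝ × ℝ := ((b + r) ⬝ᵥ τb, ((b + r) ⬝ᵥ nb) / φ) with hydef
  have hKρ : K⁻¹ / 2 * ρ = (1 + cr) * η := by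
    calc K⁻¹ / 2 * ρ = (1 + cr) * η * (K⁻¹ * K) := by rw [hρdef, hc₀def]; ring
      _ = (1 + cr) * η := by rw [inv_mul_cancel₀ hK0, mul_one]
  have hy1 : y.1 = b ⬝ᵥ τb + r₂ := by
    show (b + r) ⬝ᵥ τb = _
    rw [add_dotProduct b r τb, hrτ]
  have hy2 : y.2 = (b ⬝ᵥ nb + r₁) / φ := by
    show (b + r) ⬝ᵥ nb / φ = _
    rw [add_dotProduct b r nb, hrn]
  have hy : dist y (b ⬝ᵥ τb, (b ⬝ᵥ nb) / φ) ≤ K⁻¹ / 2 * ρ := by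
    rw [Prod.dist_eq, hKρ]
    show max (dist y.1 (b ⬝ᵥ τb)) (dist y.2 (b ⬝ᵥ nb / φ)) ≤ (1 + cr) * η
    rw [hy1, hy2, Real.dist_eq, Real.dist_eq]
    have e1 : b ⬝ᵥ τb + r₂ - b ⬝ᵥ τb = r₂ := by ring
    have e2 : (b ⬝ᵥ nb + r₁) / φ - b ⬝ᵥ nb / φ = r₁ / φ := by ring
    rw [e1, e2, abs_div, abs_of_pos hφpos]
    have hcrη : 0 ≤ cr * η := mul_nonneg hcr.le hη0
    have hηφ0 : 0 ≤ η * φ := mul_nonneg hη0 hφpos.le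
    refine max_le ?_ ?_
    · calc |r₂| ≤ η := hr₂
        _ ≤ (1 + cr) * η := by linarith
    · rw [div_le_iff₀ hφpos]
      calc |r₁| ≤ cr * η * φ := hr₁
        _ ≤ (1 + cr) * η * φ := by linarith
  -- the quantitative inverse function theorem
  obtain ⟨θ, hθ, h1, h2⟩ :=
    pair_surj hD hcu hu hM0 hM ha₁ hslope (θ₁', θ₂') hφpos hρ0 hsmall y hy
  have hG : fermiPoint u θ.1 + fermiPoint u θ.2 = b + r := by
    have hτ' : (fermiPoint u θ.1 + fermiPoint u θ.2) ⬝ᵥ τb = (b + r) ⬝ᵥ τb := h1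
    have hn' : (fermiPoint u θ.1 + fermiPoint u θ.2) ⬝ᵥ nb = (b + r) ⬝ᵥ nb := by
      have h2' : (fermiPoint u θ.1 + fermiPoint u θ.2) ⬝ᵥ nb / φ = (b + r) ⬝ᵥ nb / φ := h2
      exact (div_left_inj' hφpos.ne').1 h2'
    calc fermiPoint u θ.1 + fermiPoint u θ.2
        = ((fermiPoint u θ.1 + fermiPoint u θ.2) ⬝ᵥ nb) • nb +
            ((fermiPoint u θ.1 + fermiPoint u θ.2) ⬝ᵥ τb) • τb := frame_decomp hs₁ _
      _ = ((b + r) ⬝ᵥ nb) • nb + ((b + r) ⬝ᵥ τb) • τb := by rw [hn', hτ']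
      _ = b + r := (frame_decomp hs₁ _).symm
  -- `|θᵢ - θ̄ᵢ| ≤ ρ = c₀ η ≤ φ/4`
  rw [Prod.dist_eq] at hθ
  have hθ1 : |θ.1 - θ₁'| ≤ ρ := by
    have := (le_max_left _ _).trans hθ; rwa [Real.dist_eq] at this
  have hθ2 : |θ.2 - θ₂'| ≤ ρ := by
    have := (le_max_right _ _).trans hθ; rwa [Real.dist_eq] at this
  -- the new pair is still a proper, non-antipodal pair
  have hdev : torusDist ((θ.1 - θ.2) - (θ₁' - θ₂')) ≤ φ / 2 := by
    calc torusDist ((θ.1 - θ.2) - (θ₁' - θ₂')) ≤ |(θ.1 - θ.2) - (θ₁' - θ₂')| := torusDist_le_abs _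
      _ = |(θ.1 - θ₁') + (-(θ.2 - θ₂'))| := by ring_nf
      _ ≤ |θ.1 - θ₁'| + |-(θ.2 - θ₂')| := abs_add_le _ _
      _ ≤ ρ + ρ := by rw [abs_neg]; exact add_le_add hθ1 hθ2
      _ ≤ φ / 2 := by linarith
  have hpos : 0 < torusDist (θ.1 - θ.2) := by
    have htri := torusDist_add_le (θ.1 - θ.2) (-((θ.1 - θ.2) - (θ₁' - θ₂')))
    have e : (θ.1 - θ.2) + -((θ.1 - θ.2) - (θ₁' - θ₂')) = θ₁' - θ₂' := by ring
    rw [e, torusDist_neg] at htri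
    linarith
  have hltπ : torusDist (θ.1 - θ.2) < π := by
    have htri := torusDist_add_le (θ₁' - θ₂') ((θ.1 - θ.2) - (θ₁' - θ₂'))
    have e : (θ₁' - θ₂') + ((θ.1 - θ.2) - (θ₁' - θ₂')) = θ.1 - θ.2 := by ring
    rw [e] at htri
    linarith
  have hmem := chord_sum_mem_pairRange hD hcu hu ha₁ ha₂ hslope θ.1 θ.2 hpos hltπ
  rw [hG] at hmem
  exact ⟨hmem, θ.1, θ.2, hG.symm, hθ1, hθ2⟩


/-- **BGM 2003 Lemma 7.5 with the constants EXPLICIT IN THE GEOMETRIC DATA** (uniform form of `lemma75_parallelogram_holds`, for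
families of dispersions along which the data are uniform — e.g. the admissible frames of cell gate-hubbard-kl): given the radius lower bound
`c_u`, the curvature lower bound `c_κ` and the bound `M` on `|u|, |u′|, |u″|` on the shell, the parallelogram lemma holds with
`c₀ = 2(1 + c₁)K`, `c₂ = 1/(4c₀ + 64M(π+1)c₀K + 1)`, `η₀ = 1`, where `K = c_u⁻¹ + 4M/(c_u²(2/π)a₁) + (c_u(2/π)a₁)⁻¹`, `a₁ = c_κ c_u` —
the constants of the proof above, read off. [cite: BenfattoGiulianiMastropietro2003, §7.3 Lemma 7.5 (s1.16)–(s1.19a) p.27 (L68–143)] -/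
theorem lemma75_parallelogram_of_bounds {ε : (Fin 2 → ℝ) → ℝ} {μ e₀ : ℝ} {u : ℝ → ℝ → ℝ}
    (hD : DispersionHyp ε μ e₀ u) {cu cκ M : ℝ} (hcu : 0 < cu) (hu : ∀ θ e : ℝ, |e| ≤ e₀ → cu ≤ u θ e)
    (hcκ : 0 < cκ) (hκ : ∀ θ e : ℝ, |e| ≤ e₀ → cκ ≤ curvature u θ e) (hM0 : 0 ≤ M)
    (hM : ∀ θ e : ℝ, |e| ≤ e₀ → |u θ e| ≤ M ∧ |radiusDeriv u θ e| ≤ M ∧ |radiusDeriv₂ u θ e| ≤ M)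
    {cr : ℝ} (hcr : 0 < cr) :
    ∀ θ₁' θ₂' η r₁ r₂ : ℝ, (θ₁', θ₂') ∈ pairChartDomain →
      |r₁| ≤ cr * η * pairAngle θ₁' θ₂' → |r₂| ≤ η →
      η ≤ (1 / (4 * (2 * (1 + cr) * (cu⁻¹ + 4 * M / (cu * (cu * (2 / π * (cκ * cu)))) + (cu * (2 / π * (cκ * cu)))⁻¹)) +
        64 * M * (π + 1) * (2 * (1 + cr) * (cu⁻¹ + 4 * M / (cu * (cu * (2 / π * (cκ * cu)))) + (cu * (2 / π * (cκ * cu)))⁻¹)) *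
          (cu⁻¹ + 4 * M / (cu * (cu * (2 / π * (cκ * cu)))) + (cu * (2 / π * (cκ * cu)))⁻¹) + 1)) * pairAngle θ₁' θ₂' → η ≤ 1 →
        fermiPoint u θ₁' + fermiPoint u θ₂' + (r₁ • unitNormal u θ₁' 0 + r₂ • unitTangent u θ₁' 0)
            ∈ pairRange u ∧
        ∃ θ₁ θ₂ : ℝ,
          fermiPoint u θ₁' + fermiPoint u θ₂' + (r₁ • unitNormal u θ₁' 0 + r₂ • unitTangent u θ₁' 0) =
            fermiPoint u θ₁ + fermiPoint u θ₂ ∧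
          |θ₁ - θ₁'| ≤ 2 * (1 + cr) * (cu⁻¹ + 4 * M / (cu * (cu * (2 / π * (cκ * cu)))) + (cu * (2 / π * (cκ * cu)))⁻¹) * η ∧
          |θ₂ - θ₂'| ≤ 2 * (1 + cr) * (cu⁻¹ + 4 * M / (cu * (cu * (2 / π * (cκ * cu)))) + (cu * (2 / π * (cκ * cu)))⁻¹) * η := by
  have h0 : |(0 : ℝ)| ≤ e₀ := by rw [abs_zero]; exact hD.e₀_pos.le
  have hupos : ∀ s, 0 < u s 0 := fun s => lt_of_lt_of_le hcu (hu s 0 h0)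
  -- Lemma 7.1's slope constants at `e = 0`
  set a₁ := cκ * cu with ha₁def
  set a₂ := 2 + M ^ 2 / cu ^ 2 with ha₂def
  have ha₁ : 0 < a₁ := by positivity
  have ha₂ : 1 ≤ a₂ := by
    have : 0 ≤ M ^ 2 / cu ^ 2 := by positivity
    linarith
  have hslope : ∀ x y : ℝ, x ≤ y → a₁ * (y - x) ≤ normalAngle u y 0 - normalAngle u x 0 ∧
      normalAngle u y 0 - normalAngle u x 0 ≤ a₂ * (y - x) :=
    fun x y hxy => normalAngle_slope hD hcu hu hcκ hκ hM0 hM h0 hxy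
  -- the constants
  set K := cu⁻¹ + 4 * M / (cu * (cu * (2 / π * a₁))) + (cu * (2 / π * a₁))⁻¹ with hKdef
  have hKpos : 0 < K := by positivity
  have hK0 : K ≠ 0 := hKpos.ne'
  set c₀ := 2 * (1 + cr) * K with hc₀def
  have hc₀pos : 0 < c₀ := by positivity
  set D := 4 * c₀ + 64 * M * (π + 1) * c₀ * K + 1 with hDdef
  have hDpos : 0 < D := by positivity
  set c₂ := 1 / D with hc₂def
  have hc₂pos : 0 < c₂ := by positivity
  intro θ₁' θ₂' η r₁ r₂ hT hr₁ hr₂ hηφ' _hη1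
  have hηφ : η ≤ c₂ * pairAngle θ₁' θ₂' := by rw [hc₂def, hDdef, hc₀def, hKdef, ha₁def]; exact hηφ'
  show _ ∧ ∃ θ₁ θ₂ : ℝ, _ ∧ |θ₁ - θ₁'| ≤ c₀ * η ∧ |θ₂ - θ₂'| ≤ c₀ * η
  -- the angle `φ`
  set φ := pairAngle θ₁' θ₂' with hφdef
  have hφpos : 0 < φ := pairAngle_pos hT
  obtain ⟨hφle2, hφleT, hTleφ⟩ := pairAngle_le θ₁' θ₂'
  have hη0 : 0 ≤ η := (abs_nonneg r₂).trans hr₂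
  -- `ρ = c₀ η` and the two smallness facts `ρ ≤ φ/4`, `16M(1 + φ⁻¹)ρ ≤ K⁻¹/2`
  set ρ := c₀ * η with hρdef
  have hρ0 : 0 ≤ ρ := by positivity
  have hρφ : ρ ≤ c₀ * c₂ * φ :=
    calc ρ = c₀ * η := hρdef
      _ ≤ c₀ * (c₂ * φ) := mul_le_mul_of_nonneg_left hηφ hc₀pos.le
      _ = c₀ * c₂ * φ := (mul_assoc _ _ _).symm
  have hc₂4 : c₀ * c₂ * 4 ≤ 1 := by
    have h1 : c₀ * c₂ * 4 = (4 * c₀) / D := by rw [hc₂def]; ring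
    rw [h1, div_le_one hDpos, hDdef]
    have : 0 ≤ 64 * M * (π + 1) * c₀ * K := by positivity
    linarith
  have hρφ4 : ρ ≤ φ / 4 := by
    have h1 := mul_le_mul_of_nonneg_right hc₂4 hφpos.le
    have : c₀ * c₂ * φ ≤ φ / 4 := by linarith
    exact hρφ.trans this
  have hsmall : 16 * M * (1 + φ⁻¹) * ρ ≤ K⁻¹ / 2 := by
    have h1 : 16 * M * (1 + φ⁻¹) * ρ ≤ 16 * M * (1 + φ⁻¹) * (c₀ * c₂ * φ) :=
      mul_le_mul_of_nonneg_left hρφ (by positivity)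
    have hφ1 : (1 + φ⁻¹) * φ = φ + 1 := by rw [add_mul, one_mul, inv_mul_cancel₀ hφpos.ne']
    have h2 : 16 * M * (1 + φ⁻¹) * (c₀ * c₂ * φ) = 16 * M * c₀ * c₂ * (φ + 1) := by
      rw [← hφ1]; ring
    have h3 : 16 * M * c₀ * c₂ * (φ + 1) ≤ 16 * M * c₀ * c₂ * (π + 1) := by
      have : φ ≤ π := by linarith [pi_pos]
      gcongr
    have h4 : 16 * M * c₀ * c₂ * (π + 1) ≤ K⁻¹ / 4 := by
      have e1 : 16 * M * c₀ * c₂ * (π + 1) = (16 * M * c₀ * (π + 1)) / D := by rw [hc₂def]; ring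
      rw [e1, div_le_iff₀ hDpos, hDdef]
      have e2 : K⁻¹ / 4 * (4 * c₀ + 64 * M * (π + 1) * c₀ * K + 1) =
          K⁻¹ / 4 * (4 * c₀ + 1) + 16 * M * c₀ * (π + 1) * (K⁻¹ * K) := by ring
      rw [e2, inv_mul_cancel₀ hK0, mul_one]
      have : 0 ≤ K⁻¹ / 4 * (4 * c₀ + 1) := by positivity
      linarith
    have hK4 : K⁻¹ / 4 ≤ K⁻¹ / 2 := by
      have : 0 ≤ K⁻¹ := by positivity
      linarith
    linarith
  -- the frame at `θ̄₁`
  have hs₁ : 0 < speed u θ₁' 0 := lt_of_lt_of_le (hupos θ₁') (le_speed u θ₁' 0 (hupos θ₁').le)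
  set τb := unitTangent u θ₁' 0 with hτb
  set nb := unitNormal u θ₁' 0 with hnb
  have hnn : nb ⬝ᵥ nb = 1 := normal_dot_normal (hupos θ₁')
  have hττ : τb ⬝ᵥ τb = 1 := by
    rw [hτb, tangent_dot_tangent (hupos θ₁') (hupos θ₁'), sub_self, Real.cos_zero]
  have hnτ : nb ⬝ᵥ τb = 0 := normal_dot_tangent (hupos θ₁')
  have hτn : τb ⬝ᵥ nb = 0 := by rw [dotProduct_comm]; exact hnτ
  -- the data `b⃗`, `r⃗` and the target `y`
  set b := fermiPoint u θ₁' + fermiPoint u θ₂' with hbdef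
  set r := r₁ • nb + r₂ • τb with hrdef
  have hrτ : r ⬝ᵥ τb = r₂ := by
    rw [hrdef, add_dotProduct, smul_dotProduct, smul_dotProduct, hnτ, hττ, smul_eq_mul, smul_eq_mul]
    ring
  have hrn : r ⬝ᵥ nb = r₁ := by
    rw [hrdef, add_dotProduct, smul_dotProduct, smul_dotProduct, hnn, hτn, smul_eq_mul, smul_eq_mul]
    ring
  set y : ℝ × ℝ := ((b + r) ⬝ᵥ τb, ((b + r) ⬝ᵥ nb) / φ) with hydef
  have hKρ : K⁻¹ / 2 * ρ = (1 + cr) * η := by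
    calc K⁻¹ / 2 * ρ = (1 + cr) * η * (K⁻¹ * K) := by rw [hρdef, hc₀def]; ring
      _ = (1 + cr) * η := by rw [inv_mul_cancel₀ hK0, mul_one]
  have hy1 : y.1 = b ⬝ᵥ τb + r₂ := by
    show (b + r) ⬝ᵥ τb = _
    rw [add_dotProduct b r τb, hrτ]
  have hy2 : y.2 = (b ⬝ᵥ nb + r₁) / φ := by
    show (b + r) ⬝ᵥ nb / φ = _
    rw [add_dotProduct b r nb, hrn]
  have hy : dist y (b ⬝ᵥ τb, (b ⬝ᵥ nb) / φ) ≤ K⁻¹ / 2 * ρ := by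
    rw [Prod.dist_eq, hKρ]
    show max (dist y.1 (b ⬝ᵥ τb)) (dist y.2 (b ⬝ᵥ nb / φ)) ≤ (1 + cr) * η
    rw [hy1, hy2, Real.dist_eq, Real.dist_eq]
    have e1 : b ⬝ᵥ τb + r₂ - b ⬝ᵥ τb = r₂ := by ring
    have e2 : (b ⬝ᵥ nb + r₁) / φ - b ⬝ᵥ nb / φ = r₁ / φ := by ring
    rw [e1, e2, abs_div, abs_of_pos hφpos]
    have hcrη : 0 ≤ cr * η := mul_nonneg hcr.le hη0
    have hηφ0 : 0 ≤ η * φ := mul_nonneg hη0 hφpos.le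
    refine max_le ?_ ?_
    · calc |r₂| ≤ η := hr₂
        _ ≤ (1 + cr) * η := by linarith
    · rw [div_le_iff₀ hφpos]
      calc |r₁| ≤ cr * η * φ := hr₁
        _ ≤ (1 + cr) * η * φ := by linarith
  -- the quantitative inverse function theorem
  obtain ⟨θ, hθ, h1, h2⟩ :=
    pair_surj hD hcu hu hM0 hM ha₁ hslope (θ₁', θ₂') hφpos hρ0 hsmall y hy
  have hG : fermiPoint u θ.1 + fermiPoint u θ.2 = b + r := by
    have hτ' : (fermiPoint u θ.1 + fermiPoint u θ.2) ⬝ᵥ τb = (b + r) ⬝ᵥ τb := h1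
    have hn' : (fermiPoint u θ.1 + fermiPoint u θ.2) ⬝ᵥ nb = (b + r) ⬝ᵥ nb := by
      have h2' : (fermiPoint u θ.1 + fermiPoint u θ.2) ⬝ᵥ nb / φ = (b + r) ⬝ᵥ nb / φ := h2
      exact (div_left_inj' hφpos.ne').1 h2'
    calc fermiPoint u θ.1 + fermiPoint u θ.2
        = ((fermiPoint u θ.1 + fermiPoint u θ.2) ⬝ᵥ nb) • nb +
            ((fermiPoint u θ.1 + fermiPoint u θ.2) ⬝ᵥ τb) • τb := frame_decomp hs₁ _
      _ = ((b + r) ⬝ᵥ nb) • nb + ((b + r) ⬝ᵥ τb) • τb := by rw [hn', hτ']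
      _ = b + r := (frame_decomp hs₁ _).symm
  -- `|θᵢ - θ̄ᵢ| ≤ ρ = c₀ η ≤ φ/4`
  rw [Prod.dist_eq] at hθ
  have hθ1 : |θ.1 - θ₁'| ≤ ρ := by
    have := (le_max_left _ _).trans hθ; rwa [Real.dist_eq] at this
  have hθ2 : |θ.2 - θ₂'| ≤ ρ := by
    have := (le_max_right _ _).trans hθ; rwa [Real.dist_eq] at this
  -- the new pair is still a proper, non-antipodal pair
  have hdev : torusDist ((θ.1 - θ.2) - (θ₁' - θ₂')) ≤ φ / 2 := by
    calc torusDist ((θ.1 - θ.2) - (θ₁' - θ₂')) ≤ |(θ.1 - θ.2) - (θ₁' - θ₂')| := torusDist_le_abs _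
      _ = |(θ.1 - θ₁') + (-(θ.2 - θ₂'))| := by ring_nf
      _ ≤ |θ.1 - θ₁'| + |-(θ.2 - θ₂')| := abs_add_le _ _
      _ ≤ ρ + ρ := by rw [abs_neg]; exact add_le_add hθ1 hθ2
      _ ≤ φ / 2 := by linarith
  have hpos : 0 < torusDist (θ.1 - θ.2) := by
    have htri := torusDist_add_le (θ.1 - θ.2) (-((θ.1 - θ.2) - (θ₁' - θ₂')))
    have e : (θ.1 - θ.2) + -((θ.1 - θ.2) - (θ₁' - θ₂')) = θ₁' - θ₂' := by ring
    rw [e, torusDist_neg] at htri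
    linarith
  have hltπ : torusDist (θ.1 - θ.2) < π := by
    have htri := torusDist_add_le (θ₁' - θ₂') ((θ.1 - θ.2) - (θ₁' - θ₂'))
    have e : (θ₁' - θ₂') + ((θ.1 - θ.2) - (θ₁' - θ₂')) = θ.1 - θ.2 := by ring
    rw [e] at htri
    linarith
  have hmem := chord_sum_mem_pairRange hD hcu hu ha₁ ha₂ hslope θ.1 θ.2 hpos hltπ
  rw [hG] at hmem
  exact ⟨hmem, θ.1, θ.2, hG.symm, hθ1, hθ2⟩

end BGM2003

end Literature.MathematicalPhysics.QuantumLattice.FermiRG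

end
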